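import Literature.NumberTheory.Automorphic.ShimuraCurveLocalUnitNorms
import Literature.NumberTheory.Automorphic.BrandtXi
import Literature.NumberTheory.Automorphic.BrandtModuleDictionary
import Literature.NumberTheory.Automorphic.DefiniteMaximalOrdersLeftOrderFibres
import Literature.NumberTheory.Automorphic.DefiniteOrderUnitsFinite
import Literature.NumberTheory.Automorphic.BrandtMatrixThetaSeries
import Literature.NumberTheory.Automorphic.BrandtThetaSeriesClassFunction
import Literature.NumberTheory.ModularForms.SiegelThetaMultiplierGaussSum
import Literature.NumberTheory.ModularForms.SiegelThetaMultiplierCyclotomic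
import Literature.NumberTheory.EllipticCurves.ModularFormsGamma0Genus
import Mathlib.NumberTheory.ModularForms.CuspFormSubmodule
import Mathlib.LinearAlgebra.Matrix.ToLin
import Literature.NumberTheory.Automorphic.BrandtSetupAdmissible
import HarnessLib
import Literature.NumberTheory.Automorphic.BrandtThetaSeriesHeckeAction
import Literature.NumberTheory.Automorphic.BrandtHeckeProjector
import Literature.NumberTheory.Automorphic.BrandtEigenvectorDegreeZero
import Literature.NumberTheory.Automorphic.EichlerSubidealCount
import Literature.NumberTheory.EllipticCurves.CongruenceNumber
import Literature.NumberTheory.EllipticCurves.HeckeCongruenceModulus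
import Literature.NumberTheory.EllipticCurves.NewformsMultiplicityOneProofs
import Literature.NumberTheory.EllipticCurves.NewformsHeckeProofs
import Literature.NumberTheory.EllipticCurves.NewformsRealCoefficients
import Summits.ABC.ABC.Theses.DefiniteXi
import Summits.ABC.ABC.Theorems.DefiniteXiXiStrongBoundAllTamExp
import Literature.NumberTheory.Automorphic.BrandtEigenvectorNonEisenstein
import Literature.NumberTheory.Automorphic.BrandtXiSetupIndependence
import Literature.NumberTheory.EllipticCurves.PastenSpectralDegreeProofs
import Literature.NumberTheory.EllipticCurves.PastenCongruenceModulusProofs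
import Literature.NumberTheory.EllipticCurves.ModularDegreeMinimal
import Literature.NumberTheory.EllipticCurves.ModularCurveManinSemistableBridgeProofs
import Literature.NumberTheory.EllipticCurves.SzpiroFreyConductorProofs
import Literature.NumberTheory.Automorphic.ShimuraCurveRibetTakahashiCokernelProofs
import Literature.NumberTheory.EllipticCurves.PastenValuationProductThm75MultiplicityProofs

/-!
# CERTIFICATE (stub-ideation k=1 · GEN 11) for `stub_xiDegreeComparison` / crux `SteinbergCore` (stmt-ABC-15024)

ONE self-contained file, 0 sorries:
* PART I  = the gen-10 certificate `STUB_IDEAS_stub_xiDegreeComparison_1_g10_XiCoreComplete.lean` VERBATIM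
  (H1 theta cuspidality → kernel → `StubIdeasK1G10.xiCoreDivisibility : XiCoreDivisibility`);
* PART II = the gen-11 tail `STUB_IDEAS_stub_xiDegreeComparison_1_g11_Sketch.lean` VERBATIM (body)
  (`XiCongruenceComparison`, `xiCongruenceComparison_of_core`, the re-cut glue, Plan A assembly);
* PART III = the three unconditional corollaries:
  `StubIdeasK1G11.xiCongruenceComparison : XiCongruenceComparison` (child 1♮ is a THEOREM),
  `StubIdeasK1G11.stub_xiDegreeComparison_of_facts : ARS 2.1(b) → FreyModularity → ⟨registered stub, verbatim⟩`,
  `StubIdeasK1G11.steinbergCore_of_facts : CongruenceNumberBound → AbcValuationProduct → FreyModularity → SteinbergCore`,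
-/

-- ======================= PART I : gen-10 certificate (verbatim body) =======================

set_option linter.dupNamespace false

/-!
# XiCoreDivisibility — COMPLETE CERTIFICATE (stub-ideation k1, gen 10)

This file is the mechanical concatenation of

* PART A = `STUB_IDEAS_stub_xiDegreeComparison_1_g9_H1complete.lean` (k1 gen 7–9: H1 = cuspidality of
  Brandt theta differences, `StubIdeasK1G9.thetaTransfer_H1`, 0 sorries), verbatim;
* PART B = `STUB_IDEAS_stub_xiDegreeComparison_1_g10_Sketch.lean` (k1 gen 10: theta-lift package K1–K3,
  k2 gen-4 kernel copied verbatim in `KernelK2G4`, composition K5), verbatim;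
* PART C = one line: `theorem xiCoreDivisibility : XiCoreDivisibility`.

so that k3's `ProbeExtremesG4.XiCoreDivisibility` (the Brandt/Eichler core divisibility
`ξ(N⁺,N⁻) ∣ |2 w_i φ_i ⟨φ, y⟩_w| · congruenceNumber f` for every degree-zero `y`, from which k3's PROVED
L2 `factorization_le_of_core` gives `p⁶ ∤ ξ → v_p ξ ≤ v_p((2·w_max)³ · congruenceNumber f)`) is
certified by the kernel in ONE file with NO hypotheses.  Read PART B (the Sketch) for the mathematics; this file exists only as the certificate.
-/

-- ======================= PART A (k1 g7–g9, verbatim) =======================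

/-!
# Stub-ideas k=1 · GEN 9 · H1 COMPLETE — `∀ S i j k l, IsCuspForm (Θ_ij − Θ_kl)` for every Brandt setup, kernel-checked

Family 1 RECOGNISE & IMPORT, crux `SteinbergCore`, line `p6_tamagawa_split`, stub `stub_xiDegreeComparison`.
This file is the CONCATENATION (verbatim, each in its own namespace — the Cruxes workfiles are not importable
modules, hence one file) of

* gen 7  `STUB_IDEAS_stub_xiDegreeComparison_1_g7_Sketch.lean` (ns `…StubIdeasK1G7`, 0 sorries):
         B2 — unit residues mod `p^e` are reduced norms from `O` at `p ∤ N⁻`;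
* gen 9  `STUB_IDEAS_stub_xiDegreeComparison_1_g9_Sketch.lean` (ns `…StubIdeasK1G9`, 0 sorries):
         B5 ⟸ (N⁺,N⁻)=1 + B2 — the arithmetic sublattice datum `ᵗU [T_ij] U = n [T_il]`, `U V = n·1`,
         `n ⊥ c`, `n ≡ 1 (mod (c, N/(N,c)))` (one lattice CRT on `(I_j : I_l)_L` + `toMatrix` bookkeeping);
* gen 8  `STUB_IDEAS_stub_xiDegreeComparison_1_g8_Sketch.lean` (ns `…StubIdeasK1G8`, 0 sorries):
         H1 ⟸ B5 (`brandtTheta_sub_isCuspForm_of_B5`: cusp values of `Θ_ij ∣₂ γ` via Andrianov–Zhuravlev, Siegel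
         Gauss sums, the `Γ₀(N)`-double-coset lemma C1);

followed by the assembly (ns `…StubIdeasK1G9`, end of file):

  `b2Statement_holds : B2Statement S`                                              (gen 7, rebound)
  `brandtTheta_sub_isCuspForm (hcop : N⁺.Coprime N⁻) (i j k l)`                    (gen 8 ∘ gen 9 ∘ gen 7)
  `brandtTheta_sub_isCuspForm' (S) (i j k l) : IsCuspForm (S.brandtTheta i j − S.brandtTheta k l)`  — UNCONDITIONAL
      (`NeZero (N⁺N⁻)` from `XiSetup.nplus_pos`/`S.squarefree`, `(N⁺,N⁻)=1` from the tree's `XiSetup.coprime`)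
  `thetaTransfer_H1` : k2's Prop `ThetaTransferG3.brandtTheta_sub_isCuspForm`, VERBATIM, proved.

So H1 — the one residual NAMED FACT of the converged k1+k2+k3 chain for `stub_xiDegreeComparison` (k2 gen 3/4:
`stub_xiDegreeComparison_of_thetaTransfer (hΘ : H1) (hMK) (hARS) (hMod)` closes the stub with `C = 1`) — is a THEOREM:
axioms of `thetaTransfer_H1` = {propext, Classical.choice, Quot.sound}.  Evidence file of stub-ideation k=1 (gen 9);
not a proposal — a prover lands it as Theorems files split per section (D-0064: g7 ≈ 3 decls, g9 ≈ 15, g8 ≈ 45).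
-/

noncomputable section

-- ════════ gen 7 (verbatim) ════════

namespace Summit.ABC.ABC.Cruxes.SteinbergCore.StubIdeasK1G7

open Literature.NumberTheory.Automorphic

variable {Nplus Nminus : ℕ} (S : Brandt.XiSetup Nplus Nminus)

/-- **B2a (port of `ShimuraCurveData.exists_eichler_model_localAt`)**: at `p ∤ N⁻`, `O₍ₚ₎` is a standard local
Eichler order in some matrix model. [cite: VignerasLNM800, Ch. II §2 Thm. 2.3 (2) and Lemme 2.4] -/
theorem exists_eichler_model_localAt (hN : 0 < Nplus) {p : ℕ} [hp : Fact p.Prime] (hpN : ¬ p ∣ Nminus) :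
    ∃ (Ψ : S.D →ₐ[ℚ] Matrix (Fin 2) (Fin 2) ℚ_[p]) (e : ℕ),
      ∀ x : S.D, x ∈ localAt p S.O ↔ (∀ i j, ‖Ψ x i j‖ ≤ 1) ∧ ‖Ψ x 1 0‖ ≤ (p : ℝ) ^ (-(e : ℤ)) := by
  have hdiv : ∀ x : S.D, x ≠ 0 → IsUnit x := fun x hx => isUnit_of_isTotallyDefinite S.D S.isTotallyDefinite hx
  have hEO : IsEichlerOrder S.O Nplus := isEichlerOrder_iff_brandt.mpr S.isEichlerOrder
  obtain ⟨φ⟩ := exists_algHom_matrix_of_not_dvd S.mem_ramifiedPlaces_iff' hpN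
  by_cases hpM : p ∣ Nplus
  · obtain ⟨O₁, O₂, hO₁, hO₂, hO, -⟩ := hEO
    obtain ⟨Ψ, e, -, hΛe⟩ := exists_eichler_model hdiv hO₁ hO₂ φ
    refine ⟨Ψ, e, fun x => ?_⟩
    rw [hO]
    exact hΛe x
  · obtain ⟨O₁, hO₁, -, hloc⟩ := hEO.exists_isMaximalZOrder_localAt_eq hN.ne' hp.out hpM
    obtain ⟨u, hu⟩ := hO₁.exists_conjUnit_localAt_iff hdiv φ
    refine ⟨AlgHom.conjUnit φ u, 0, fun x => ?_⟩
    rw [hloc, hu x]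
    simp only [CharP.cast_eq_zero, neg_zero, zpow_zero]
    exact ⟨fun h => ⟨h, h 1 0⟩, fun h => h.1⟩

/-- **B2b (port of `ShimuraCurveData.exists_mem_localAt_reducedNorm_eq_mul_of_not_dvd`)**: for `p ∤ N⁻`, a rational
`u` with `v_p(u) = 0` and `m ≥ 0` there is `g ∈ O₍ₚ₎` with `nrd g = u (1 + p^m r)`, `r ∈ ℤ₍ₚ₎` (approximate
surjectivity of `nrd : O_pˣ → ℤ_pˣ` for local Eichler orders). [cite: VignerasLNM800, Ch. II §2 and Ch. III §5 Cor. 5.7] -/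
theorem exists_mem_localAt_reducedNorm_eq_mul_of_not_dvd (hN : 0 < Nplus) {p : ℕ}
    (hp : p.Prime) (hpN : ¬ p ∣ Nminus) {u : ℚ} (hu0 : u ≠ 0) (hu : padicValRat p u = 0) (m : ℕ) :
    ∃ g : S.D, g ∈ localAt p S.O ∧ ∃ r : ℚ, ¬ p ∣ r.den ∧
      reducedNorm ℚ S.D g = u * (1 + (p : ℚ) ^ m * r) := by
  haveI : Fact p.Prime := ⟨hp⟩
  have hpR : (0 : ℝ) < p := by exact_mod_cast hp.pos
  have hp1 : (1 : ℝ) < p := by exact_mod_cast hp.one_lt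
  have hpQ : (p : ℚ) ≠ 0 := Nat.cast_ne_zero.mpr hp.ne_zero
  obtain ⟨Ψ, e, hΛ⟩ := exists_eichler_model_localAt S hN hpN
  set T : Matrix (Fin 2) (Fin 2) ℚ_[p] := !![((u : ℚ) : ℚ_[p]), 0; 0, 1] with hT
  obtain ⟨g, hg⟩ := AlgHom.exists_norm_sub_le Ψ T (m + e)
  have hunorm : ‖((u : ℚ) : ℚ_[p])‖ = 1 := by
    rw [Padic.norm_ratCast_eq_zpow hu0, hu, neg_zero, zpow_zero]
  have hε1 : (p : ℝ) ^ (-((m + e : ℕ) : ℤ)) ≤ 1 := zpow_le_one_of_nonpos₀ hp1.le (by omega)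
  have hεe : (p : ℝ) ^ (-((m + e : ℕ) : ℤ)) ≤ (p : ℝ) ^ (-(e : ℤ)) :=
    zpow_le_zpow_right₀ hp1.le (by push_cast; omega)
  have hTnorm : ∀ i j, ‖T i j‖ ≤ 1 := by
    intro i j
    fin_cases i <;> fin_cases j <;> simp [hT, hunorm]
  set E : Matrix (Fin 2) (Fin 2) ℚ_[p] := Ψ g - T with hE
  have hEnorm : ∀ i j, ‖E i j‖ ≤ (p : ℝ) ^ (-((m + e : ℕ) : ℤ)) := hg
  have hΨg : Ψ g = T + E := by rw [hE]; abel
  have hgΛ : g ∈ localAt p S.O := by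
    rw [hΛ]
    refine ⟨fun i j => ?_, ?_⟩
    · rw [hΨg, Matrix.add_apply]
      exact (Padic.nonarchimedean _ _).trans (max_le (hTnorm i j) ((hEnorm i j).trans hε1))
    · rw [hΨg, Matrix.add_apply]
      have hT10 : T 1 0 = 0 := by simp [hT]
      rw [hT10, zero_add]
      exact (hEnorm 1 0).trans hεe
  have hdet : (Ψ g).det = ((u : ℚ) : ℚ_[p]) + (((u : ℚ) : ℚ_[p]) * E 1 1 + E 0 0 + E 0 0 * E 1 1 - E 0 1 * E 1 0) := by
    rw [hΨg, Matrix.det_fin_two]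
    simp only [Matrix.add_apply, hT, Matrix.of_apply, Matrix.cons_val', Matrix.cons_val_zero,
      Matrix.cons_val_one, Matrix.empty_val', Matrix.cons_val_fin_one]
    ring
  set δ : ℚ_[p] := ((u : ℚ) : ℚ_[p]) * E 1 1 + E 0 0 + E 0 0 * E 1 1 - E 0 1 * E 1 0 with hδ
  have hδnorm : ‖δ‖ ≤ (p : ℝ) ^ (-((m + e : ℕ) : ℤ)) := by
    have hε0 : (0 : ℝ) ≤ (p : ℝ) ^ (-((m + e : ℕ) : ℤ)) := zpow_nonneg hpR.le _
    have h1 : ‖((u : ℚ) : ℚ_[p]) * E 1 1‖ ≤ (p : ℝ) ^ (-((m + e : ℕ) : ℤ)) := by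
      rw [norm_mul, hunorm, one_mul]; exact hEnorm 1 1
    have h2 : ‖E 0 0 * E 1 1‖ ≤ (p : ℝ) ^ (-((m + e : ℕ) : ℤ)) := by
      rw [norm_mul]
      exact (mul_le_mul (hEnorm 0 0) ((hEnorm 1 1).trans hε1) (norm_nonneg _) hε0).trans
        (by rw [mul_one])
    have h3 : ‖E 0 1 * E 1 0‖ ≤ (p : ℝ) ^ (-((m + e : ℕ) : ℤ)) := by
      rw [norm_mul]
      exact (mul_le_mul (hEnorm 0 1) ((hEnorm 1 0).trans hε1) (norm_nonneg _) hε0).trans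
        (by rw [mul_one])
    rw [hδ, sub_eq_add_neg]
    refine (Padic.nonarchimedean _ _).trans (max_le ?_ (by rw [norm_neg]; exact h3))
    refine (Padic.nonarchimedean _ _).trans (max_le ?_ h2)
    exact (Padic.nonarchimedean _ _).trans (max_le h1 (hEnorm 0 0))
  have hnrd : ((reducedNorm ℚ S.D g : ℚ) : ℚ_[p]) - ((u : ℚ) : ℚ_[p]) = δ := by
    have h := AlgHom.det_eq_reducedNorm Ψ g
    rw [hdet] at h
    rw [show ((reducedNorm ℚ S.D g : ℚ) : ℚ_[p]) = algebraMap ℚ ℚ_[p] (reducedNorm ℚ S.D g) from rfl,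
      ← h]
    ring
  set r : ℚ := (reducedNorm ℚ S.D g - u) / (u * (p : ℚ) ^ m) with hr
  refine ⟨g, hgΛ, r, ?_, ?_⟩
  · rw [← Padic.norm_ratCast_le_one_iff, hr]
    push_cast
    rw [hnrd, norm_div, norm_mul, hunorm, one_mul, norm_pow, Padic.norm_p, inv_pow,
      div_le_one (by positivity)]
    calc ‖δ‖ ≤ (p : ℝ) ^ (-((m + e : ℕ) : ℤ)) := hδnorm
      _ ≤ (p : ℝ) ^ (-(m : ℤ)) := zpow_le_zpow_right₀ hp1.le (by push_cast; omega)
      _ = ((p : ℝ) ^ m)⁻¹ := by rw [zpow_neg, zpow_natCast]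
  · rw [hr]
    field_simp
    ring

/-- **B2 (the gen-6 signature, from B2b by clearing denominators).** With `u = t`, `m = e`: `g ∈ O₍ₚ₎`,
`nrd g = t (1 + p^e r)`; pick `s ≥ 1`, `p ∤ s`, `s • g ∈ O` (`mem_localAt_iff`) and `s' : ℤ` with `s s' ≡ 1 (mod p^e)`;
`z = s' • (s • g) ∈ O` has `nrd z = (s s')² t (1 + p^e r) ∈ ℤ` (`S.isEichlerOrder.isOrder.exists_int_reducedTrace_reducedNorm`)
and `nrd z − t = ((s s')² − 1) t + (s s')² t p^e r ≡ 0 (mod p^e)` (the last term is an integer equal to `p^e` times a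
`p`-integral rational: `padicValRat`). [cite: VignerasLNM800, Ch. II §2] -/
theorem exists_mem_order_reducedNorm_modEq_of_not_dvd {p : ℕ} [hpf : Fact p.Prime] (hp : ¬ p ∣ Nminus) (hN : 0 < Nplus)
    (e : ℕ) {t : ℤ} (ht : IsCoprime t p) :
    ∃ z ∈ S.O, ∃ nz : ℤ, reducedNorm ℚ S.D z = nz ∧ (p : ℤ) ^ e ∣ nz - t := by
  have hpp : p.Prime := hpf.out
  have hpt : ¬ (p : ℤ) ∣ t := fun h => by
    have hu := ht.isUnit_of_dvd' h dvd_rfl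
    rw [Int.isUnit_iff] at hu
    have := hpp.two_le
    omega
  have ht0 : t ≠ 0 := fun h => hpt (h ▸ dvd_zero _)
  have htQ : (t : ℚ) ≠ 0 := Int.cast_ne_zero.mpr ht0
  have hvt : padicValRat p (t : ℚ) = 0 := by
    simp [padicValRat.of_int, padicValInt.eq_zero_of_not_dvd hpt]
  obtain ⟨g, hg, r, hr, hnrd⟩ := exists_mem_localAt_reducedNorm_eq_mul_of_not_dvd S hN hpp hp htQ hvt e
  obtain ⟨s, hs0, hsp, hsg⟩ := mem_localAt_iff.mp hg
  have hcop : IsCoprime (s : ℤ) ((p : ℤ) ^ e) := (Nat.isCoprime_iff_coprime.mpr hsp).pow_right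
  obtain ⟨a, b, hab⟩ := hcop
  refine ⟨a • ((s : ℤ) • g), S.O.smul_mem a hsg, ?_⟩
  obtain ⟨-, nz, -, hnz⟩ := S.isEichlerOrder.isOrder.exists_int_reducedTrace_reducedNorm (S.O.smul_mem a hsg)
  refine ⟨nz, hnz, ?_⟩
  have hq : (nz : ℚ) = (a : ℚ) ^ 2 * ((s : ℚ) ^ 2 * ((t : ℚ) * (1 + (p : ℚ) ^ e * r))) := by
    rw [← hnz, reducedNorm_zsmul, reducedNorm_zsmul, hnrd]; push_cast; ring
  have key : (r.den : ℤ) * (nz - t) = ((a * s) ^ 2 - 1) * t * r.den + (p : ℤ) ^ e * ((a * s) ^ 2 * t * r.num) := by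
    have h : (((r.den : ℤ) * (nz - t) : ℤ) : ℚ) =
        ((((a * s) ^ 2 - 1) * t * r.den + (p : ℤ) ^ e * ((a * s) ^ 2 * t * r.num) : ℤ) : ℚ) := by
      push_cast
      rw [hq, ← Rat.mul_den_eq_num r]
      ring
    exact_mod_cast h
  have h1 : (p : ℤ) ^ e ∣ (a * s) ^ 2 - 1 := by
    have : (a * (s : ℤ)) ^ 2 - 1 = (a * s - 1) * (a * s + 1) := by ring
    rw [this]
    exact Dvd.dvd.mul_right ⟨-b, by linear_combination hab⟩ _
  have h2 : (p : ℤ) ^ e ∣ (r.den : ℤ) * (nz - t) := by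
    rw [key]
    exact dvd_add ((h1.mul_right _).mul_right _) (dvd_mul_right _ _)
  have hcop' : IsCoprime ((p : ℤ) ^ e) (r.den : ℤ) :=
    (Nat.isCoprime_iff_coprime.mpr ((Nat.Prime.coprime_iff_not_dvd hpp).mpr hr)).pow_left
  exact hcop'.dvd_of_dvd_mul_left h2

end Summit.ABC.ABC.Cruxes.SteinbergCore.StubIdeasK1G7

-- ════════ gen 9 (verbatim) ════════

namespace Summit.ABC.ABC.Cruxes.SteinbergCore.StubIdeasK1G9

open Matrix Module
open scoped MatrixGroups Pointwise

open Literature.NumberTheory.Automorphic Literature.NumberTheory.Automorphic.Brandt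

variable {Nplus Nminus : ℕ} (S : XiSetup Nplus Nminus)

/-! ## §0 Dictionary (verbatim gen 5/6/8) -/

/-- The Gram matrix `[T_{ij}]` behind `S.brandtTheta i j` (gen 8 §0, verbatim). -/
def brandtGram (i j : ClassSet S.O) : Matrix (Fin 4) (Fin 4) ℤ :=
  normFormGram (S.nonempty_basis_transporterLeft i.rep_mem j.rep_mem).some (S.nrdGen j.rep_mem / S.nrdGen i.rep_mem)

/-- B5 (gen-6/8 signature, verbatim `StubIdeasK1G8.B5Statement`). -/
def B5Statement (i j l : ClassSet S.O) : Prop :=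
  ∀ c : ℕ, 0 < c → ∃ n : ℕ, n.Coprime c ∧ n ≡ 1 [MOD Nat.gcd c ((Nplus * Nminus) / Nat.gcd (Nplus * Nminus) c)] ∧
    ∃ U V : Matrix (Fin 4) (Fin 4) ℤ,
      Uᵀ * brandtGram S i j * U = (n : ℤ) • brandtGram S i l ∧ U * V = (n : ℤ) • (1 : Matrix (Fin 4) (Fin 4) ℤ)

/-- B2 (gen-6 signature; PROVED in gen 7 as `StubIdeasK1G7.exists_mem_order_reducedNorm_modEq_of_not_dvd`,
with `0 < N⁺` from `S.nplus_ne_zero`) as a Prop: unit residues mod `p^e` are reduced norms from `O` at `p ∤ N⁻`. -/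
def B2Statement : Prop :=
  ∀ (p : ℕ), p.Prime → ¬ p ∣ Nminus → ∀ (e : ℕ) (t : ℤ), IsCoprime t p →
    ∃ z ∈ S.O, ∃ nz : ℤ, reducedNorm ℚ S.D z = nz ∧ (p : ℤ) ^ e ∣ nz - t

/-! ## §1 The gen-9 helpers (statements; sizes XS–M; each one prover cycle) -/

/-- **H-a (B1-local, size XS–S, PROVED).** A right `O`-ideal contains an element whose normalised norm `nrd β / q_I`
is prime to a given prime `p`: otherwise every generator `nrd β` of `nrdIdeal I = ℤ q_I` lies in `ℤ (p q_I)`,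
so `q_I ∈ ℤ p q_I`, absurd. [cite: Voight2021, Def. 16.3.1 and Lemma 16.3.2] -/
theorem exists_mem_reducedNorm_eq_mul_not_dvd {I : Submodule ℤ S.D} (hI : I ∈ rightIdeals S.O) {p : ℕ} (hp : p.Prime) :
    ∃ β ∈ I, ∃ m : ℤ, reducedNorm ℚ S.D β = m * S.nrdGen hI ∧ ¬ (p : ℤ) ∣ m := by
  by_contra h
  push Not at h
  have hq := S.nrdGen_pos hI
  have hn := S.nrdIdeal_eq_span_nrdGen hI
  have hle : nrdIdeal I ≤ ℤ ∙ ((p : ℚ) * S.nrdGen hI) := by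
    refine nrdIdeal_le_iff.mpr fun x hx => ?_
    obtain ⟨m, hm⟩ := S.exists_int_reducedNorm_eq_mul hn hx
    obtain ⟨k, hk⟩ := h x hx m hm
    rw [Submodule.mem_span_singleton]
    exact ⟨k, by rw [hm, hk, zsmul_eq_mul]; push_cast; ring⟩
  have hmem : S.nrdGen hI ∈ ℤ ∙ ((p : ℚ) * S.nrdGen hI) :=
    hle (by rw [hn]; exact Submodule.mem_span_singleton_self _)
  rw [Submodule.mem_span_singleton] at hmem
  obtain ⟨k, hk⟩ := hmem
  rw [zsmul_eq_mul] at hk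
  have hkp : (k : ℚ) * p = 1 := by
    have h1 : (k : ℚ) * p * S.nrdGen hI = 1 * S.nrdGen hI := by rw [mul_assoc, hk, one_mul]
    exact mul_right_cancel₀ hq.ne' h1
  have hkp' : k * (p : ℤ) = 1 := by exact_mod_cast hkp
  have hdvd : (p : ℤ) ∣ 1 := ⟨k, by rw [mul_comm]; exact hkp'.symm⟩
  have hp1 : (p : ℤ) = 1 := Int.eq_one_of_dvd_one (by positivity) hdvd
  exact hp.ne_one (by exact_mod_cast hp1)

/-- **H-b (size S, PROVED).** `q'⁻¹ · β z β̄' ∈ (I : I')_L` for `β ∈ I`, `z ∈ O`, `β' ∈ I'`: for `m ∈ I'`, `β̄' m ∈ Ī' I' = q' O`, so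
`q'⁻¹ β z β̄' m ∈ β z O ⊆ I`. [cite: Voight2021, 16.6.14 and 41.1.3] -/
theorem algebraMap_mul_mem_transporterLeft {I I' : Submodule ℤ S.D} (hI : I ∈ rightIdeals S.O) (hI' : I' ∈ rightIdeals S.O)
    {β z β' : S.D} (hβ : β ∈ I) (hz : z ∈ S.O) (hβ' : β' ∈ I') :
    algebraMap ℚ S.D (S.nrdGen hI')⁻¹ * (β * z * standardInvolution ℚ S.D β') ∈ transporterLeft I' I := by
  obtain ⟨q, hq, hn, -, u, hu, hconj, -⟩ := S.exists_nrdIdeal_eq_span_and_latticeConj_mul_self_eq hI'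
  have hqq : S.nrdGen hI' = q := S.nrdGen_eq hI' hq hn
  rw [mem_transporterLeft_iff]
  intro m hm
  have h1 : standardInvolution ℚ S.D β' * m ∈ latticeConj I' * I' :=
    Submodule.mul_mem_mul (by rw [mem_latticeConj_iff, standardInvolution_standardInvolution]; exact hβ') hm
  rw [hconj, mem_units_smul_iff_mul_mem] at h1
  have hinv : ((u⁻¹ : S.Dˣ) : S.D) = algebraMap ℚ S.D q⁻¹ :=
    Units.inv_eq_of_mul_eq_one_right (by rw [hu, ← map_mul, mul_inv_cancel₀ hq.ne', map_one])
  rw [hinv] at h1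
  have h2 : z * (algebraMap ℚ S.D q⁻¹ * (standardInvolution ℚ S.D β' * m)) ∈ S.O :=
    S.isEichlerOrder.isOrder.mul_mem _ hz _ h1
  have h3 : β * (z * (algebraMap ℚ S.D q⁻¹ * (standardInvolution ℚ S.D β' * m))) ∈ I := by
    have hz' : z * (algebraMap ℚ S.D q⁻¹ * (standardInvolution ℚ S.D β' * m)) ∈ rightOrder I := by
      rw [hI.2.1]; exact h2
    exact hz' β hβ
  have heq : algebraMap ℚ S.D (S.nrdGen hI')⁻¹ * (β * z * standardInvolution ℚ S.D β') * m =
      β * (z * (algebraMap ℚ S.D q⁻¹ * (standardInvolution ℚ S.D β' * m))) := by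
    simp only [hqq, mul_assoc, Algebra.left_comm]
  rw [heq]
  exact h3

/-- **H-b′ (size XS, PROVED).** Its reduced norm: `nrd(q'⁻¹ β z β̄') = q'⁻² nrd β · nrd z · nrd β'`. [cite: VignerasLNM800, Ch. I §1 Lemme 1.1] -/
theorem reducedNorm_algebraMap_mul (q : ℚ) (β z β' : S.D) :
    reducedNorm ℚ S.D (algebraMap ℚ S.D q * (β * z * standardInvolution ℚ S.D β')) =
      q ^ 2 * (reducedNorm ℚ S.D β * reducedNorm ℚ S.D z * reducedNorm ℚ S.D β') := by
  rw [reducedNorm_mul_holds, reducedNorm_mul_holds, reducedNorm_mul_holds, reducedNorm_algebraMap,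
    reducedNorm_standardInvolution]

/-- **H-c (lattice CRT for the norm form, size S, PROVED).** Finitely many local targets `x_p ∈ I` are met simultaneously:
`∃ y ∈ I` with `nrd y ≡ nrd x_p (mod p^{e_p} · q_I)` for all `p ∈ P` (coordinatewise CRT in `I ≅ ℤ⁴`, then
`nrd(x + p^e d) = nrd x + p^{2e} nrd d + p^e trd(x d̄)` with `nrd d ∈ ℤ q_I`, `trd(x d̄) ∈ ℤ q_I`). [folklore] -/
theorem exists_mem_forall_pow_dvd_reducedNorm_sub {I : Submodule ℤ S.D} (hI : I ∈ rightIdeals S.O)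
    (P : Finset ℕ) (hP : ∀ p ∈ P, p.Prime) (e : ℕ → ℕ) (x : ℕ → S.D) (hx : ∀ p ∈ P, x p ∈ I) :
    ∃ y ∈ I, ∀ p ∈ P, ∃ k : ℤ,
      reducedNorm ℚ S.D y - reducedNorm ℚ S.D (x p) = k * (p : ℚ) ^ e p * S.nrdGen hI := by
  classical
  obtain ⟨b⟩ := hI.1.nonempty_basis_fin_four
  have hn := S.nrdIdeal_eq_span_nrdGen hI
  -- coordinates of the local targets in the basis `b`
  let g : P → Fin 4 → ℤ := fun p => b.repr ⟨x p, hx p p.2⟩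
  -- the moduli `p ^ e p`, `p ∈ P`, are pairwise coprime
  have hcop : Pairwise fun p p' : P =>
      IsCoprime (Ideal.span {((p : ℕ) : ℤ) ^ e p}) (Ideal.span {((p' : ℕ) : ℤ) ^ e p'}) := by
    intro p p' hne
    rw [Ideal.isCoprime_span_singleton_iff]
    have hne' : (p : ℕ) ≠ p' := fun h => hne (Subtype.ext h)
    have h0 : IsCoprime ((p : ℕ) : ℤ) ((p' : ℕ) : ℤ) :=
      Nat.isCoprime_iff_coprime.mpr ((Nat.coprime_primes (hP p p.2) (hP p' p'.2)).mpr hne')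
    exact h0.pow
  -- CRT, one coordinate at a time
  have key : ∀ r : Fin 4, ∃ wr : ℤ, ∀ p : P, wr - g p r ∈ Ideal.span {((p : ℕ) : ℤ) ^ e p} :=
    fun r => Ideal.exists_forall_sub_mem_ideal (I := fun p : P => Ideal.span {((p : ℕ) : ℤ) ^ e p}) hcop (fun p => g p r)
  choose w hw using key
  have key2 : ∀ (p : P) (r : Fin 4), ∃ d : ℤ, w r - g p r = ((p : ℕ) : ℤ) ^ e p * d :=
    fun p r => Ideal.mem_span_singleton.mp (hw r p)
  choose d hd using key2
  refine ⟨∑ r, w r • (b r : S.D), I.sum_mem fun r _ => I.smul_mem _ (b r).2, fun p hp => ?_⟩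
  -- the correction `δ ∈ I` with `y = x_p + p^e • δ`
  set δ : S.D := ∑ r, d ⟨p, hp⟩ r • (b r : S.D) with hδdef
  have hδ : δ ∈ I := I.sum_mem fun r _ => I.smul_mem _ (b r).2
  have hxsum : x p = ∑ r, g ⟨p, hp⟩ r • (b r : S.D) := by
    have h := congrArg Subtype.val (b.sum_repr ⟨x p, hx p hp⟩)
    simp only [Submodule.coe_sum, Submodule.coe_smul_of_tower] at h
    exact h.symm
  have hy : ∑ r, w r • (b r : S.D) = x p + (((p : ℕ) : ℤ) ^ e p) • δ := by
    rw [hxsum, hδdef, Finset.smul_sum, ← Finset.sum_add_distrib]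
    refine Finset.sum_congr rfl fun r _ => ?_
    have hw' : w r = g ⟨p, hp⟩ r + ((p : ℕ) : ℤ) ^ e p * d ⟨p, hp⟩ r := by
      have h := hd ⟨p, hp⟩ r; linear_combination h
    rw [hw', add_smul, mul_smul]
  have hmain : reducedNorm ℚ S.D (∑ r, w r • (b r : S.D)) - reducedNorm ℚ S.D (x p) =
      ((p : ℚ) ^ e p) ^ 2 * reducedNorm ℚ S.D δ +
        (p : ℚ) ^ e p * reducedTrace ℚ S.D (x p * standardInvolution ℚ S.D δ) := by
    rw [hy, ← Int.cast_smul_eq_zsmul ℚ, reducedNorm_add, reducedNorm_smul, standardInvolution_smul, mul_smul_comm,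
      map_smul, smul_eq_mul]
    push_cast
    ring
  obtain ⟨a, ha⟩ := S.exists_int_reducedNorm_eq_mul hn hδ
  obtain ⟨b', hb'⟩ := S.exists_int_reducedTrace_mul_standardInvolution_eq_mul hn (hx p hp) hδ
  refine ⟨(p : ℤ) ^ e p * a + b', ?_⟩
  rw [hmain, ha, hb']
  push_cast
  ring

/-- **H-d (= gen-6 B4, size S, PROVED).** The involution swaps Eichler's lattices up to the scalar `q'/q`:
`y ∈ (I : I')_L = q'⁻¹ I Ī'` ⇒ `ȳ ∈ q'⁻¹ I' Ī = (q/q') (I' : I)_L`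
(tree `XiSetup.exists_transporterLeft_eq_units_inv_smul_mul_latticeConj` twice, `latticeConj_mul`,
`latticeConj_latticeConj`, `standardInvolution_algebraMap`). [cite: Voight2021, 41.1.3 and 16.6.14] -/
theorem smul_standardInvolution_mem_transporterLeft {I I' : Submodule ℤ S.D} (hI : I ∈ rightIdeals S.O)
    (hI' : I' ∈ rightIdeals S.O) {y : S.D} (hy : y ∈ transporterLeft I' I) :
    algebraMap ℚ S.D (S.nrdGen hI' / S.nrdGen hI) * standardInvolution ℚ S.D y ∈ transporterLeft I I' := by
  obtain ⟨q', u', hq', hn', hu', h'⟩ := S.exists_transporterLeft_eq_units_inv_smul_mul_latticeConj hI hI'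
  obtain ⟨q, u, hq, hn, hu, h⟩ := S.exists_transporterLeft_eq_units_inv_smul_mul_latticeConj hI' hI
  have hq'e : S.nrdGen hI' = q' := S.nrdGen_eq hI' hq' hn'
  have hqe : S.nrdGen hI = q := S.nrdGen_eq hI hq hn
  rw [h', mem_units_smul_iff_mul_mem, inv_inv, hu'] at hy
  rw [h, mem_units_smul_iff_mul_mem, inv_inv, hu, hq'e, hqe]
  have hqq : q * (q' / q) = q' := by field_simp
  have hprod : algebraMap ℚ S.D q * (algebraMap ℚ S.D (q' / q) * standardInvolution ℚ S.D y) =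
      standardInvolution ℚ S.D (algebraMap ℚ S.D q' * y) := by
    rw [← mul_assoc, ← map_mul, hqq, standardInvolution_mul_rev, standardInvolution_algebraMap, ← Algebra.commutes]
  have hmem : standardInvolution ℚ S.D (algebraMap ℚ S.D q' * y) ∈ latticeConj (I * latticeConj I') := by
    rw [mem_latticeConj_iff, standardInvolution_standardInvolution]; exact hy
  rw [latticeConj_mul, latticeConj_latticeConj] at hmem
  rw [hprod]
  exact hmem

/-- Entry formula `(ᵗU G U)_{st} = U_{·s} ⬝ (G U_{·t})` (bookkeeping for H-e). -/
theorem transpose_mul_mul_apply {m : Type*} [Fintype m] (U G : Matrix m m ℤ) (s t : m) :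
    (Uᵀ * G * U) s t = (fun r => U r s) ⬝ᵥ (G *ᵥ fun r => U r t) := by
  rw [Matrix.mul_assoc]
  simp only [Matrix.mul_apply, Matrix.transpose_apply, dotProduct, mulVec]

/-- **H-e (= B5b, basis bookkeeping, size M, PROVED).** Any `y ∈ (I_j : I_l)_L` with `Q_{lj}(y) = nrd(y) q_l/q_j = n` gives the
sublattice datum: `U` = matrix of `w ↦ y w : (I_l : I_i)_L → (I_j : I_i)_L` in the bases behind `brandtGram`, `V` = matrix of
`x ↦ (q_l/q_j) ȳ x` back (H-d); `ᵗU [T_ij] U = n [T_il]` because `trd((y b_s)(y b_t)‾) = nrd(y) trd(b_s b̄_t)`, and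
`U V = n · 1` because `y · (q_l/q_j) ȳ = n`. [cite: Voight2021, §40.4 (p. 744) and 41.1.3] -/
theorem exists_gram_datum_of_mem_transporterLeft (i j l : ClassSet S.O) {y : S.D} (hy : y ∈ transporterLeft l.rep j.rep)
    {n : ℕ} (hn : reducedNorm ℚ S.D y * S.nrdGen l.rep_mem = n * S.nrdGen j.rep_mem) :
    ∃ U V : Matrix (Fin 4) (Fin 4) ℤ,
      Uᵀ * brandtGram S i j * U = (n : ℤ) • brandtGram S i l ∧ U * V = (n : ℤ) • (1 : Matrix (Fin 4) (Fin 4) ℤ) := by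
  classical
  set qi := S.nrdGen i.rep_mem with hqi
  set qj := S.nrdGen j.rep_mem with hqj
  set ql := S.nrdGen l.rep_mem with hql
  have hqi0 : 0 < qi := S.nrdGen_pos i.rep_mem
  have hqj0 : 0 < qj := S.nrdGen_pos j.rep_mem
  have hql0 : 0 < ql := S.nrdGen_pos l.rep_mem
  set bij := (S.nonempty_basis_transporterLeft i.rep_mem j.rep_mem).some with hbij
  set bil := (S.nonempty_basis_transporterLeft i.rep_mem l.rep_mem).some with hbil
  have hGij : brandtGram S i j = normFormGram bij (qj / qi) := rfl
  have hGil : brandtGram S i l = normFormGram bil (ql / qi) := rfl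
  have hnij : nrdIdeal (transporterLeft i.rep j.rep) = ℤ ∙ (qj / qi) :=
    S.nrdIdeal_transporterLeft j.rep_mem i.rep_mem hqj0 hqi0 (S.nrdIdeal_eq_span_nrdGen j.rep_mem)
      (S.nrdIdeal_eq_span_nrdGen i.rep_mem)
  have hnil : nrdIdeal (transporterLeft i.rep l.rep) = ℤ ∙ (ql / qi) :=
    S.nrdIdeal_transporterLeft l.rep_mem i.rep_mem hql0 hqi0 (S.nrdIdeal_eq_span_nrdGen l.rep_mem)
      (S.nrdIdeal_eq_span_nrdGen i.rep_mem)
  have hAij : ∀ r s, ((normFormGram bij (qj / qi) r s : ℤ) : ℚ) * (qj / qi) =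
      reducedTrace ℚ S.D ((bij r : S.D) * standardInvolution ℚ S.D (bij s : S.D)) :=
    fun r s => S.cast_normFormGram_mul (div_pos hqj0 hqi0).ne' hnij bij r s
  have hAil : ∀ r s, ((normFormGram bil (ql / qi) r s : ℤ) : ℚ) * (ql / qi) =
      reducedTrace ℚ S.D ((bil r : S.D) * standardInvolution ℚ S.D (bil s : S.D)) :=
    fun r s => S.cast_normFormGram_mul (div_pos hql0 hqi0).ne' hnil bil r s
  -- `y' := (q_l/q_j) ȳ ∈ (I_l : I_j)_L` with `y y' = n`, `ȳ y = nrd y`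
  set y' := algebraMap ℚ S.D (ql / qj) * standardInvolution ℚ S.D y with hy'def
  have hy' : y' ∈ transporterLeft j.rep l.rep :=
    smul_standardInvolution_mem_transporterLeft S j.rep_mem l.rep_mem hy
  have hsc : ql / qj * reducedNorm ℚ S.D y = n := by
    field_simp
    linear_combination hn
  have hyy' : y * y' = (n : S.D) := by
    rw [hy'def, Algebra.left_comm, mul_standardInvolution_holds ℚ S.D y, ← map_mul, hsc, map_natCast]
  have hbar : standardInvolution ℚ S.D y * y = algebraMap ℚ S.D (reducedNorm ℚ S.D y) := by
    have h := mul_standardInvolution_holds ℚ S.D (standardInvolution ℚ S.D y)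
    rwa [standardInvolution_standardInvolution, reducedNorm_standardInvolution] at h
  -- the two lattice maps
  have hf : ∀ w ∈ transporterLeft i.rep l.rep, y * w ∈ transporterLeft i.rep j.rep := fun w hw m hm => by
    rw [mul_assoc]; exact hy _ (hw m hm)
  have hg : ∀ x ∈ transporterLeft i.rep j.rep, y' * x ∈ transporterLeft i.rep l.rep := fun x hx m hm => by
    rw [mul_assoc]; exact hy' _ (hx m hm)
  set f : transporterLeft i.rep l.rep →ₗ[ℤ] transporterLeft i.rep j.rep := (LinearMap.mulLeft ℤ y).restrict hf
    with hfdef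
  set g : transporterLeft i.rep j.rep →ₗ[ℤ] transporterLeft i.rep l.rep := (LinearMap.mulLeft ℤ y').restrict hg
    with hgdef
  have hf_apply : ∀ w, ((f w : transporterLeft i.rep j.rep) : S.D) = y * w := fun w => rfl
  have hg_apply : ∀ x, ((g x : transporterLeft i.rep l.rep) : S.D) = y' * x := fun x => rfl
  have hfg : f.comp g = (n : ℤ) • LinearMap.id := by
    refine LinearMap.ext fun x => Subtype.ext ?_
    simp only [LinearMap.comp_apply, LinearMap.smul_apply, LinearMap.id_apply, Submodule.coe_smul_of_tower]
    rw [hf_apply, hg_apply, ← mul_assoc, hyy', natCast_zsmul, nsmul_eq_mul]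
  refine ⟨LinearMap.toMatrix bil bij f, LinearMap.toMatrix bij bil g, ?_, ?_⟩
  · -- the Gram identity `ᵗU [T_ij] U = n [T_il]`
    have hcol : ∀ t, ((bij.equivFun.symm (fun r => LinearMap.toMatrix bil bij f r t) : transporterLeft i.rep j.rep) : S.D)
        = y * (bil t : S.D) := by
      intro t
      have h : (fun r => LinearMap.toMatrix bil bij f r t) = ⇑(bij.repr (f (bil t))) := by
        funext r; rw [LinearMap.toMatrix_apply]
      rw [h, Basis.equivFun_symm_apply, Basis.sum_repr, hf_apply]
    ext s t
    rw [hGij, hGil, transpose_mul_mul_apply, Matrix.smul_apply, smul_eq_mul]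
    have h1 := S.cast_dotProduct_normFormGram_mulVec hAij (fun r => LinearMap.toMatrix bil bij f r s)
      (fun r => LinearMap.toMatrix bil bij f r t)
    rw [hcol, hcol] at h1
    have h2 : reducedTrace ℚ S.D ((y * (bil s : S.D)) * standardInvolution ℚ S.D (y * (bil t : S.D))) =
        reducedNorm ℚ S.D y * reducedTrace ℚ S.D ((bil s : S.D) * standardInvolution ℚ S.D (bil t : S.D)) := by
      rw [standardInvolution_mul_rev]
      have h3 : y * (bil s : S.D) * (standardInvolution ℚ S.D (bil t : S.D) * standardInvolution ℚ S.D y)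
          = (y * ((bil s : S.D) * standardInvolution ℚ S.D (bil t : S.D))) * standardInvolution ℚ S.D y := by
        simp only [mul_assoc]
      rw [h3, reducedTrace_mul_comm, ← mul_assoc, hbar, ← Algebra.smul_def, map_smul, smul_eq_mul]
    have hne : (qj / qi : ℚ) ≠ 0 := (div_pos hqj0 hqi0).ne'
    have h4 : ((((fun r => LinearMap.toMatrix bil bij f r s) ⬝ᵥ normFormGram bij (qj / qi) *ᵥ
        fun r => LinearMap.toMatrix bil bij f r t : ℤ)) : ℚ) * (qj / qi) =
        (((n : ℤ) * normFormGram bil (ql / qi) s t : ℤ) : ℚ) * (qj / qi) := by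
      rw [h1, h2, ← hAil s t]
      push_cast
      rw [show reducedNorm ℚ S.D y * ((normFormGram bil (ql / qi) s t : ℚ) * (ql / qi)) =
          (normFormGram bil (ql / qi) s t : ℚ) * (reducedNorm ℚ S.D y * ql) / qi by ring, hn]
      ring
    exact_mod_cast mul_right_cancel₀ hne h4
  · -- `U V = n · 1`
    rw [← LinearMap.toMatrix_comp bij bil bij f g, hfg, map_zsmul, LinearMap.toMatrix_id]

/-- **H-g (size XS–S, elementary, PROVED).** A prime dividing the modulus `(c, N/(N,c))`, `N = N⁺N⁻`, `(N⁺,N⁻) = 1`, `N⁻` squarefree,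
satisfies `p² ∣ N⁺` and `p ∤ N⁻` (so B2 applies at it). [folklore] -/
theorem sq_dvd_and_not_dvd_of_dvd_gcd_level (hcop : Nplus.Coprime Nminus) (hsq : Squarefree Nminus) {c p : ℕ}
    (hp : p.Prime) (hpg : p ∣ Nat.gcd c ((Nplus * Nminus) / Nat.gcd (Nplus * Nminus) c)) :
    p ^ 2 ∣ Nplus ∧ ¬ p ∣ Nminus := by
  set N := Nplus * Nminus with hN
  set d := Nat.gcd N c with hd
  have hpc : p ∣ c := (Nat.dvd_gcd_iff.mp hpg).1
  have hpNd : p ∣ N / d := (Nat.dvd_gcd_iff.mp hpg).2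
  have hdN : d ∣ N := Nat.gcd_dvd_left N c
  have hpN : p ∣ N := hpNd.trans (Nat.div_dvd_of_dvd hdN)
  have hpd : p ∣ d := Nat.dvd_gcd hpN hpc
  have hp2N : p ^ 2 ∣ Nplus * Nminus :=
    calc p ^ 2 = p * p := sq p
      _ ∣ N / d * d := Nat.mul_dvd_mul hpNd hpd
      _ = N := Nat.div_mul_cancel hdN
  have hnot : ¬ p ∣ Nminus := by
    intro hpm
    have hpp : ¬ p ∣ Nplus := fun h =>
      hp.ne_one (Nat.Coprime.eq_one_of_dvd (Nat.Coprime.coprime_dvd_left h hcop) hpm)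
    have hcop2 : (p ^ 2).Coprime Nplus := Nat.Coprime.pow_left 2 ((Nat.Prime.coprime_iff_not_dvd hp).2 hpp)
    have h2m : p ^ 2 ∣ Nminus := hcop2.dvd_of_dvd_mul_left hp2N
    exact hp.ne_one (Nat.isUnit_iff.mp (hsq p (by simpa [sq] using h2m)))
  have hcop3 : (p ^ 2).Coprime Nminus := Nat.Coprime.pow_left 2 ((Nat.Prime.coprime_iff_not_dvd hp).2 hnot)
  exact ⟨hcop3.dvd_of_dvd_mul_right hp2N, hnot⟩

/-- **H-f (= B5a, size M, PROVED — the assembly of H-a, H-b, H-c, H-g with B2).** For classes `j, l` and `c ≥ 1` there is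
`y ∈ (I_j : I_l)_L` whose value `n = Q_{lj}(y) = nrd(y) q_l/q_j` is prime to `c` and `≡ 1 (mod (c, N/(N,c)))`:
local targets `x_p = q_l⁻¹ β_j^{(p)} z_p β̄_l^{(p)}` (`p ∣ c`; H-a at `p` for `β`'s, `z_p = 1` unless `p` divides the modulus,
where `z_p` comes from B2 with `nrd z_p ≡ (m_j m_l)⁻¹`), glued by H-c in the lattice `(I_j : I_l)_L` (a right ideal of
`O_L(I_l)`, setup `S.ofLeftOrder`). [cite: Voight2021, 41.1.3] [cite: VignerasLNM800, Ch. III §5] -/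
theorem exists_mem_transporterLeft_coprime_modEq (hcop : Nplus.Coprime Nminus) (hB2 : B2Statement S)
    (j l : ClassSet S.O) {c : ℕ} (hc : 0 < c) :
    ∃ y ∈ transporterLeft l.rep j.rep, ∃ n : ℕ,
      reducedNorm ℚ S.D y * S.nrdGen l.rep_mem = n * S.nrdGen j.rep_mem ∧ n.Coprime c ∧
        n ≡ 1 [MOD Nat.gcd c ((Nplus * Nminus) / Nat.gcd (Nplus * Nminus) c)] := by
  classical
  -- notation: `q_j`, `q_l`, the modulus `g`, the exponents `E p = v_p(g) + 1`
  set qj := S.nrdGen j.rep_mem with hqj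
  set ql := S.nrdGen l.rep_mem with hql
  have hqj0 : 0 < qj := S.nrdGen_pos j.rep_mem
  have hql0 : 0 < ql := S.nrdGen_pos l.rep_mem
  have hr0 : (0 : ℚ) < qj / ql := div_pos hqj0 hql0
  set g := Nat.gcd c ((Nplus * Nminus) / Nat.gcd (Nplus * Nminus) c) with hg
  have hg0 : g ≠ 0 := (Nat.gcd_pos_of_pos_left _ hc).ne'
  set E : ℕ → ℕ := fun p => g.factorization p + 1 with hE
  -- the lattice `Λ = (I_j : I_l)_L`, a right ideal of `O_L(I_l)` with `nrd(Λ) = ℤ q_j/q_l`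
  set S' := S.ofLeftOrder l.rep_mem with hS'
  have hΛ : transporterLeft l.rep j.rep ∈ rightIdeals S'.O :=
    S.transporterLeft_mem_rightIdeals_leftOrder l.rep_mem j.rep_mem
  have hnΛ : nrdIdeal (transporterLeft l.rep j.rep) = ℤ ∙ (qj / ql) :=
    S.nrdIdeal_transporterLeft j.rep_mem l.rep_mem hqj0 hql0 (S.nrdIdeal_eq_span_nrdGen j.rep_mem)
      (S.nrdIdeal_eq_span_nrdGen l.rep_mem)
  have hgen : S'.nrdGen hΛ = qj / ql := S'.nrdGen_eq hΛ hr0 hnΛ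
  -- the primes of `c`
  set P := c.primeFactors with hPdef
  have hPp : ∀ p ∈ P, p.Prime := fun p hp => (Nat.mem_primeFactors.mp hp).1
  -- H-a at each prime of `c`, for `I_j` and for `I_l`
  have keyj : ∀ p ∈ P, ∃ β ∈ j.rep, ∃ m : ℤ, reducedNorm ℚ S.D β = m * qj ∧ ¬ (p : ℤ) ∣ m :=
    fun p hp => exists_mem_reducedNorm_eq_mul_not_dvd S j.rep_mem (hPp p hp)
  choose! βj hβj mj hmj hpj using keyj
  have keyl : ∀ p ∈ P, ∃ β ∈ l.rep, ∃ m : ℤ, reducedNorm ℚ S.D β = m * ql ∧ ¬ (p : ℤ) ∣ m :=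
    fun p hp => exists_mem_reducedNorm_eq_mul_not_dvd S l.rep_mem (hPp p hp)
  choose! βl hβl ml hml hpl using keyl
  -- the local correctors `z_p ∈ O` (B2 at the primes of the modulus, `1` elsewhere)
  have keyz : ∀ p ∈ P, ∃ z ∈ S.O, ∃ nz : ℤ, reducedNorm ℚ S.D z = nz ∧ ¬ (p : ℤ) ∣ nz * (mj p * ml p) ∧
      (p ∣ g → (p : ℤ) ^ E p ∣ nz * (mj p * ml p) - 1) := by
    intro p hp
    have hpP := hPp p hp
    have hpint : Prime (p : ℤ) := Nat.prime_iff_prime_int.mp hpP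
    have hM : ¬ (p : ℤ) ∣ mj p * ml p := fun h => (hpint.dvd_or_dvd h).elim (hpj p hp) (hpl p hp)
    by_cases hpg : p ∣ g
    · have hpNm : ¬ p ∣ Nminus := (sq_dvd_and_not_dvd_of_dvd_gcd_level hcop S.squarefree hpP hpg).2
      have hcopM : IsCoprime ((p : ℤ) ^ E p) (mj p * ml p) :=
        ((Irreducible.coprime_iff_not_dvd hpint.irreducible).mpr hM).pow_left
      obtain ⟨u, v, huv⟩ := hcopM
      have hvp : IsCoprime v (p : ℤ) := by
        have h1 : IsCoprime v ((p : ℤ) ^ E p) := ⟨mj p * ml p, u, by linear_combination huv⟩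
        have h2 : (p : ℤ) ^ E p = (p : ℤ) ^ g.factorization p * p := pow_succ _ _
        rw [h2] at h1
        exact h1.of_mul_right_right
      obtain ⟨z, hz, nz, hnz, hdvd⟩ := hB2 p hpP hpNm (E p) v hvp
      have hmain : (p : ℤ) ^ E p ∣ nz * (mj p * ml p) - 1 := by
        have h3 : nz * (mj p * ml p) - 1 = (nz - v) * (mj p * ml p) - u * (p : ℤ) ^ E p := by
          linear_combination huv
        rw [h3]
        exact dvd_sub (hdvd.mul_right _) (dvd_mul_left _ _)
      refine ⟨z, hz, nz, hnz, fun h => ?_, fun _ => hmain⟩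
      have h4 : (p : ℤ) ∣ nz * (mj p * ml p) - 1 := (dvd_pow_self (p : ℤ) (Nat.succ_ne_zero _)).trans hmain
      have h5 : (p : ℤ) ∣ 1 := by
        have := dvd_sub h h4
        rwa [sub_sub_cancel] at this
      exact hpint.not_dvd_one h5
    · refine ⟨1, S.isEichlerOrder.isOrder.one_mem, 1, by rw [Int.cast_one]; exact reducedNorm_one ℚ S.D,
        by rwa [one_mul], fun h => (hpg h).elim⟩
  choose! z hz nz hnz hpz hgz using keyz
  -- the local targets `x_p = q_l⁻¹ β_j z_p β̄_l ∈ Λ`, `nrd x_p = (nz·m_j·m_l) · q_j/q_l`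
  set x : ℕ → S.D := fun p => algebraMap ℚ S.D ql⁻¹ * (βj p * z p * standardInvolution ℚ S.D (βl p)) with hx
  have hxΛ : ∀ p ∈ P, x p ∈ transporterLeft l.rep j.rep := fun p hp =>
    algebraMap_mul_mem_transporterLeft S j.rep_mem l.rep_mem (hβj p hp) (hz p hp) (hβl p hp)
  have hxn : ∀ p ∈ P, reducedNorm ℚ S.D (x p) = ((nz p * (mj p * ml p) : ℤ) : ℚ) * (qj / ql) := by
    intro p hp
    simp only [hx]
    rw [reducedNorm_algebraMap_mul, hmj p hp, hnz p hp, hml p hp]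
    push_cast
    field_simp
  -- ONE lattice CRT (H-c) in `Λ`
  obtain ⟨y, hy, hyc⟩ := exists_mem_forall_pow_dvd_reducedNorm_sub S' hΛ P hPp E x hxΛ
  have hyc' : ∀ p ∈ P, ∃ k : ℤ,
      reducedNorm ℚ S.D y - reducedNorm ℚ S.D (x p) = k * (p : ℚ) ^ E p * (qj / ql) := by
    intro p hp
    obtain ⟨k, hk⟩ := hyc p hp
    exact ⟨k, by rw [← hgen]; exact hk⟩
  -- `Q(y) = K ∈ ℤ_{≥ 0}`
  obtain ⟨K, hK⟩ := S.exists_int_reducedNorm_eq_mul hnΛ hy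
  have hK0 : 0 ≤ K := by
    have h0 : 0 ≤ reducedNorm ℚ S.D y := reducedNorm_nonneg_of_isTotallyDefinite _ S.isTotallyDefinite y
    rw [hK] at h0
    by_contra hneg
    push Not at hneg
    have : (K : ℚ) * (qj / ql) < 0 := mul_neg_of_neg_of_pos (by exact_mod_cast hneg) hr0
    linarith
  have hKA : ∀ p ∈ P, ∃ k : ℤ, K - nz p * (mj p * ml p) = k * (p : ℤ) ^ E p := by
    intro p hp
    obtain ⟨k, hk⟩ := hyc' p hp
    refine ⟨k, ?_⟩
    rw [hK, hxn p hp, ← sub_mul] at hk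
    have h1 := mul_right_cancel₀ hr0.ne' hk
    exact_mod_cast h1
  have hKn : ((K.toNat : ℕ) : ℤ) = K := Int.toNat_of_nonneg hK0
  refine ⟨y, hy, K.toNat, ?_, ?_, ?_⟩
  · have h1 : ((K.toNat : ℕ) : ℚ) = (K : ℚ) := by exact_mod_cast hKn
    rw [h1, hK]
    field_simp
  · refine Nat.coprime_of_dvd fun p hp hpK hpc => ?_
    have hpP : p ∈ P := Nat.mem_primeFactors.mpr ⟨hp, hpc, hc.ne'⟩
    obtain ⟨k, hk⟩ := hKA p hpP
    have h1 : (p : ℤ) ∣ K := by rw [← hKn]; exact Int.natCast_dvd_natCast.mpr hpK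
    have h2 : (p : ℤ) ∣ k * (p : ℤ) ^ E p := (dvd_pow_self (p : ℤ) (Nat.succ_ne_zero _)).mul_left _
    have h3 : (p : ℤ) ∣ nz p * (mj p * ml p) := by
      have := dvd_sub h1 h2
      rwa [← hk, sub_sub_cancel] at this
    exact hpz p hpP h3
  · -- `K ≡ 1 (mod g)`, prime power by prime power
    have hdiv : (g : ℤ) ∣ K - 1 := by
      rw [Int.natCast_dvd]
      refine (Nat.dvd_iff_prime_pow_dvd_dvd _ _).mpr fun p k hp hpk => ?_
      rcases Nat.eq_zero_or_pos k with rfl | hk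
      · simp
      have hkle : k ≤ g.factorization p := (hp.pow_dvd_iff_le_factorization hg0).mp hpk
      have hpg : p ∣ g := (dvd_pow_self p hk.ne').trans hpk
      have hpc : p ∣ c := hpg.trans (Nat.gcd_dvd_left _ _)
      have hpP : p ∈ P := Nat.mem_primeFactors.mpr ⟨hp, hpc, hc.ne'⟩
      obtain ⟨t, ht⟩ := hKA p hpP
      have h1 : (p : ℤ) ^ E p ∣ K - 1 := by
        have h2 : K - 1 = t * (p : ℤ) ^ E p + (nz p * (mj p * ml p) - 1) := by linear_combination ht
        rw [h2]
        exact dvd_add (dvd_mul_left _ _) (hgz p hpP hpg)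
      have h3 : ((p ^ k : ℕ) : ℤ) ∣ K - 1 := by
        push_cast
        exact (pow_dvd_pow (p : ℤ) (hkle.trans (Nat.le_succ _))).trans h1
      exact Int.natCast_dvd.mp h3
    rw [Nat.modEq_iff_dvd]
    push_cast [hKn]
    exact dvd_sub_comm.mp hdiv

/-! ## §2 Composition: B5 from H-f and H-e (kernel-checked) -/

/-- **B5 ⟸ (N⁺,N⁻)=1 + B2 (PROVED, via H-f + H-e).** With gen 7's B2, the tree's `XiSetup.coprime` and gen 8's
`brandtTheta_sub_isCuspForm_of_B5` this gives H1 unconditionally (`…_1_g9_H1complete.lean`). -/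
theorem b5Statement_of (hcop : Nplus.Coprime Nminus) (hB2 : B2Statement S) (i j l : ClassSet S.O) :
    B5Statement S i j l := by
  intro c hc
  obtain ⟨y, hy, n, hn, hnc, hmod⟩ := exists_mem_transporterLeft_coprime_modEq S hcop hB2 j l hc
  obtain ⟨U, V, hU, hV⟩ := exists_gram_datum_of_mem_transporterLeft S i j l hy hn
  exact ⟨n, hnc, hmod, U, V, hU, hV⟩

end Summit.ABC.ABC.Cruxes.SteinbergCore.StubIdeasK1G9

-- ════════ gen 8 (verbatim) ════════

namespace Summit.ABC.ABC.Cruxes.SteinbergCore.StubIdeasK1G8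

open Complex hiding I
open Matrix Filter Topology ModularForm
open Complex (I)
open scoped MatrixGroups UpperHalfPlane

open Literature.NumberTheory.ModularForms
open Literature.NumberTheory.ModularForms.SiegelModularForm (one1 one1_map one1_mul one1_inv smul_one1 det_one1
  one1_injective eq_one1 spOfSL spOfSL_mem moeb_spOfSL det_denom_spOfSL num_denom_spOfSL)
open Literature.NumberTheory.EllipticCurves.ModularForms
open Literature.NumberTheory.Automorphic Literature.NumberTheory.Automorphic.Brandt

/-! ## §0 Dictionary (gen 5/6) and the facts about `[T_ij]` the E-block consumes -/

variable {Nplus Nminus : ℕ} (S : XiSetup Nplus Nminus)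

/-- The Gram matrix `[T_{ij}]` behind `S.brandtTheta i j`. -/
def brandtGram (i j : ClassSet S.O) : Matrix (Fin 4) (Fin 4) ℤ :=
  normFormGram (S.nonempty_basis_transporterLeft i.rep_mem j.rep_mem).some (S.nrdGen j.rep_mem / S.nrdGen i.rep_mem)

theorem brandtTheta_apply (i j : ClassSet S.O) (τ : ℍ) :
    S.brandtTheta i j τ = siegelThetaSeries (brandtGram S i j) (one1 (τ : ℂ)) := rfl

/-- The Gram identity `⌊trd(b_r b̄_s)/q⌋ · q = trd(b_r b̄_s)` for the basis behind `brandtGram`. -/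
theorem cast_brandtGram_mul (i j : ClassSet S.O) (r s : Fin 4) :
    ((brandtGram S i j r s : ℤ) : ℚ) * (S.nrdGen j.rep_mem / S.nrdGen i.rep_mem) =
      reducedTrace ℚ S.D (((S.nonempty_basis_transporterLeft i.rep_mem j.rep_mem).some r : S.D) *
        standardInvolution ℚ S.D ((S.nonempty_basis_transporterLeft i.rep_mem j.rep_mem).some s : S.D)) :=
  (S.ofLeftOrder i.rep_mem).cast_normFormGram_mul (div_pos (S.nrdGen_pos j.rep_mem) (S.nrdGen_pos i.rep_mem)).ne'
    (S.nrdIdeal_transporterLeft j.rep_mem i.rep_mem (S.nrdGen_pos j.rep_mem) (S.nrdGen_pos i.rep_mem)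
      (S.nrdIdeal_eq_span_nrdGen j.rep_mem) (S.nrdIdeal_eq_span_nrdGen i.rep_mem)) _ r s

theorem det_brandtGram (i j : ClassSet S.O) : (brandtGram S i j).det = ((Nplus * Nminus : ℕ) : ℤ) ^ 2 :=
  (S.ofLeftOrder i.rep_mem).det_normFormGram (S.transporterLeft_mem_rightIdeals_leftOrder i.rep_mem j.rep_mem)
    (div_pos (S.nrdGen_pos j.rep_mem) (S.nrdGen_pos i.rep_mem))
    (S.nrdIdeal_transporterLeft j.rep_mem i.rep_mem (S.nrdGen_pos j.rep_mem) (S.nrdGen_pos i.rep_mem)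
      (S.nrdIdeal_eq_span_nrdGen j.rep_mem) (S.nrdIdeal_eq_span_nrdGen i.rep_mem)) (cast_brandtGram_mul S i j)

/-- NEW (proved). `[T_ij]` is symmetric. -/
theorem brandtGram_isSymm (i j : ClassSet S.O) : (brandtGram S i j).IsSymm :=
  isSymm_of_normFormGram (div_pos (S.nrdGen_pos j.rep_mem) (S.nrdGen_pos i.rep_mem)).ne' (cast_brandtGram_mul S i j)

/-- NEW (proved). `[T_ij]` is even. -/
theorem even_brandtGram_diag (i j : ClassSet S.O) (r : Fin 4) : Even (brandtGram S i j r r) :=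
  (S.ofLeftOrder i.rep_mem).even_normFormGram_diag (div_pos (S.nrdGen_pos j.rep_mem) (S.nrdGen_pos i.rep_mem)).ne'
    (S.nrdIdeal_transporterLeft j.rep_mem i.rep_mem (S.nrdGen_pos j.rep_mem) (S.nrdGen_pos i.rep_mem)
      (S.nrdIdeal_eq_span_nrdGen j.rep_mem) (S.nrdIdeal_eq_span_nrdGen i.rep_mem)) (cast_brandtGram_mul S i j) r

/-- NEW (proved). `[T_ij] > 0`. -/
theorem posDef_brandtGram (i j : ClassSet S.O) : ((brandtGram S i j).map ((↑) : ℤ → ℝ)).PosDef :=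
  (S.ofLeftOrder i.rep_mem).posDef_normFormGram_map (S.transporterLeft_mem_rightIdeals_leftOrder i.rep_mem j.rep_mem).1
    (div_pos (S.nrdGen_pos j.rep_mem) (S.nrdGen_pos i.rep_mem)) (cast_brandtGram_mul S i j)

/-- NEW (proved). The LEVEL DATUM of `[T_ij]`: `P·[T] = [T]·P = N⁺N⁻ · 1`, `P` even. -/
theorem exists_brandtGram_levelDatum (i j : ClassSet S.O) :
    ∃ P : Matrix (Fin 4) (Fin 4) ℤ, P * brandtGram S i j = ((Nplus * Nminus : ℕ) : ℤ) • (1 : Matrix (Fin 4) (Fin 4) ℤ) ∧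
      brandtGram S i j * P = ((Nplus * Nminus : ℕ) : ℤ) • (1 : Matrix (Fin 4) (Fin 4) ℤ) ∧ ∀ r, Even (P r r) :=
  (S.ofLeftOrder i.rep_mem).exists_normFormGram_levelDatum (S.transporterLeft_mem_rightIdeals_leftOrder i.rep_mem j.rep_mem)
    (div_pos (S.nrdGen_pos j.rep_mem) (S.nrdGen_pos i.rep_mem))
    (S.nrdIdeal_transporterLeft j.rep_mem i.rep_mem (S.nrdGen_pos j.rep_mem) (S.nrdGen_pos i.rep_mem)
      (S.nrdIdeal_eq_span_nrdGen j.rep_mem) (S.nrdIdeal_eq_span_nrdGen i.rep_mem)) (cast_brandtGram_mul S i j)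

/-- Cusp constant of `θ_Q ∣ γ` (gen 5, verbatim): `d^{m/2}` at `c = 0`, else `(√det Q)⁻¹ (ic)^{−m/2} |c|^m G(a/c, Q)`. -/
def thetaCuspValue {m : ℕ} (Q : Matrix (Fin m) (Fin m) ℤ) (γ : SL(2, ℤ)) : ℂ :=
  if γ 1 0 = 0 then ((γ 1 1 : ℤ) : ℂ) ^ (m / 2)
  else ((Real.sqrt ((Q.det : ℤ) : ℝ) : ℝ) : ℂ)⁻¹ * (I * ((γ 1 0 : ℤ) : ℂ)) ^ (-((m / 2 : ℕ) : ℤ)) *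
      (((γ 1 0).natAbs : ℕ) : ℂ) ^ m *
        siegelGaussSum Q (γ 1 0).natAbs (one1 (((γ 0 0 : ℤ) : ℂ) / ((γ 1 0 : ℤ) : ℂ)))

/-! ## §E0 The symplectic matrix `M = spOfSL (γ·S)` of the cusp path (all PROVED) -/

/-- Entries of `γ·S = (b, −a; d, −c)`. -/
theorem mul_S_apply (γ : SL(2, ℤ)) :
    (γ * ModularGroup.S) 0 0 = γ 0 1 ∧ (γ * ModularGroup.S) 0 1 = -(γ 0 0) ∧
      (γ * ModularGroup.S) 1 0 = γ 1 1 ∧ (γ * ModularGroup.S) 1 1 = -(γ 1 0) := by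
  refine ⟨?_, ?_, ?_, ?_⟩ <;>
    simp [Matrix.SpecialLinearGroup.coe_mul, ModularGroup.coe_S, Matrix.mul_apply, Fin.sum_univ_two]

/-- Blocks of `M = spOfSL (γ·S)`: `B = (−a)`, `C = (d)`, `D = (−c)`. -/
theorem toBlocks_spOfSL_mul_S (γ : SL(2, ℤ)) :
    (spOfSL (γ * ModularGroup.S)).toBlocks₁₂ = one1 (-(γ 0 0)) ∧ (spOfSL (γ * ModularGroup.S)).toBlocks₂₁ = one1 (γ 1 1) ∧
      (spOfSL (γ * ModularGroup.S)).toBlocks₂₂ = one1 (-(γ 1 0)) := by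
  obtain ⟨-, h01, h10, h11⟩ := mul_S_apply γ
  refine ⟨?_, ?_, ?_⟩
  · rw [spOfSL, Matrix.toBlocks_fromBlocks₁₂, h01]
  · rw [spOfSL, Matrix.toBlocks_fromBlocks₂₁, h10]
  · rw [spOfSL, Matrix.toBlocks_fromBlocks₂₂, h11]

/-- `det D = −c ≠ 0` off the cusp `∞`. -/
theorem det_toBlocks₂₂_spOfSL_mul_S (γ : SL(2, ℤ)) : (spOfSL (γ * ModularGroup.S)).toBlocks₂₂.det = -(γ 1 0) := by
  rw [(toBlocks_spOfSL_mul_S γ).2.2, det_one1]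

/-- `d·BD⁻¹ = (a·sign c)` is integral for `d = |c|`. -/
theorem natAbs_smul_B_mul_inv_D (γ : SL(2, ℤ)) (hc : γ 1 0 ≠ 0) :
    (((γ 1 0).natAbs : ℕ) : ℂ) • ((spOfSL (γ * ModularGroup.S)).toBlocks₁₂.map ((↑) : ℤ → ℂ) *
        ((spOfSL (γ * ModularGroup.S)).toBlocks₂₂.map ((↑) : ℤ → ℂ))⁻¹) =
      (one1 (γ 0 0 * Int.sign (γ 1 0))).map ((↑) : ℤ → ℂ) := by
  obtain ⟨h12, -, h22⟩ := toBlocks_spOfSL_mul_S γ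
  have hc' : ((-(γ 1 0) : ℤ) : ℂ) ≠ 0 := by exact_mod_cast (neg_ne_zero.2 hc)
  rw [h12, h22, one1_map, one1_map, one1_inv hc', one1_mul, smul_one1, one1_map]
  congr 1
  have habs : (((γ 1 0).natAbs : ℕ) : ℂ) = ((Int.sign (γ 1 0) * γ 1 0 : ℤ) : ℂ) := by
    rw [Int.sign_mul_self_eq_natAbs, Int.cast_natCast]
  have hc0 : ((γ 1 0 : ℤ) : ℂ) ≠ 0 := by exact_mod_cast hc
  rw [habs]
  push_cast
  field_simp

/-- `BD⁻¹ = (a/c)` for `M = spOfSL (γ·S)`. -/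
theorem B_mul_inv_D_eq (γ : SL(2, ℤ)) (hc : γ 1 0 ≠ 0) :
    (spOfSL (γ * ModularGroup.S)).toBlocks₁₂.map ((↑) : ℤ → ℂ) * ((spOfSL (γ * ModularGroup.S)).toBlocks₂₂.map ((↑) : ℤ → ℂ))⁻¹ =
      one1 (((γ 0 0 : ℤ) : ℂ) / ((γ 1 0 : ℤ) : ℂ)) := by
  obtain ⟨h12, -, h22⟩ := toBlocks_spOfSL_mul_S γ
  have hc' : ((-(γ 1 0) : ℤ) : ℂ) ≠ 0 := by exact_mod_cast (neg_ne_zero.2 hc)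
  rw [h12, h22, one1_map, one1_map, one1_inv hc', one1_mul]
  congr 1
  push_cast
  rw [neg_mul, inv_neg, mul_neg, neg_neg, div_eq_mul_inv]

/-- The cusp path in Siegel coordinates: `M⟨it·1⟩ = ((γ·S)·(it)) = (γ·(i/t))`. -/
theorem moeb_spOfSL_mul_S_I_smul (γ : SL(2, ℤ)) {t : ℝ} (ht : 0 < t) :
    SiegelUpperHalfSpace.moeb ((spOfSL (γ * ModularGroup.S)).map ((↑) : ℤ → ℂ)) ((I * (t : ℂ)) • (1 : Matrix (Fin 1) (Fin 1) ℂ)) =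
      one1 (((γ • (ModularGroup.S • UpperHalfPlane.ofComplex (I * t)) : ℍ) : ℂ)) := by
  have hIm : 0 < (I * t : ℂ).im := by simp [ht]
  have h1 : (I * (t : ℂ)) • (1 : Matrix (Fin 1) (Fin 1) ℂ) = one1 (((UpperHalfPlane.ofComplex (I * t) : ℍ) : ℂ)) := by
    rw [UpperHalfPlane.ofComplex_apply_of_im_pos hIm, ← SiegelModularForm.one1_one, smul_one1, mul_one]
  rw [h1, moeb_spOfSL, mul_smul]

/-- `det(C·(it) + D) = c_δ·it + d_δ` for `M = spOfSL δ` at `Z = it·1`. -/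
theorem det_denom_spOfSL_I_smul (δ : SL(2, ℤ)) {t : ℝ} (ht : 0 < t) :
    (SiegelUpperHalfSpace.denom ((spOfSL δ).map ((↑) : ℤ → ℂ)) ((I * (t : ℂ)) • (1 : Matrix (Fin 1) (Fin 1) ℂ))).det =
      ((δ 1 0 : ℤ) : ℂ) * (I * t) + ((δ 1 1 : ℤ) : ℂ) := by
  have hIm : 0 < (I * t : ℂ).im := by simp [ht]
  have h1 : (I * (t : ℂ)) • (1 : Matrix (Fin 1) (Fin 1) ℂ) = one1 (((UpperHalfPlane.ofComplex (I * t) : ℍ) : ℂ)) := by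
    rw [UpperHalfPlane.ofComplex_apply_of_im_pos hIm, ← SiegelModularForm.one1_one, smul_one1, mul_one]
  rw [h1, det_denom_spOfSL, ModularGroup.denom_apply, UpperHalfPlane.ofComplex_apply_of_im_pos hIm]

/-- The path `t ↦ S·(it) = i/t` runs into the cusp `i∞` as `t → 0⁺`. -/
theorem tendsto_S_smul_ofComplex_I_mul :
    Tendsto (fun t : ℝ => ModularGroup.S • UpperHalfPlane.ofComplex (I * t)) (𝓝[>] 0) UpperHalfPlane.atImInfty := by
  rw [UpperHalfPlane.atImInfty, Filter.tendsto_comap_iff]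
  refine tendsto_inv_nhdsGT_zero.congr' (eventually_nhdsWithin_of_forall fun t (ht : 0 < t) => ?_)
  have hIm : 0 < (I * t : ℂ).im := by simp [ht]
  rw [Function.comp_apply, UpperHalfPlane.modular_S_smul, UpperHalfPlane.im, UpperHalfPlane.coe_mk,
    UpperHalfPlane.ofComplex_apply_of_im_pos hIm]
  simp [Complex.inv_im, Complex.normSq_apply]

/-- The scalar identity behind E1: `t²(ci + d t)^{−2} · (t⁻¹ c⁻² (d·it − c)(−c))² = −c⁻²` (through
`d·it − c = it·(c(−it)⁻¹ + d)` and `I² = −1`). PROVED. -/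
theorem cuspPath_scalar (s c d t : ℂ) (hs : s ≠ 0) (hc : c ≠ 0) (ht : t ≠ 0) (hx : c * (-(I * t))⁻¹ + d ≠ 0) :
    s⁻¹ * (t⁻¹ * (c ^ 2)⁻¹ * (d * (I * t) + -c) * -c) ^ 2 * ((c * (-(I * t))⁻¹ + d) ^ 2)⁻¹ = -(s⁻¹ * (c ^ 2)⁻¹) := by
  have hIt : -(I * t) ≠ 0 := neg_ne_zero.2 (mul_ne_zero I_ne_zero ht)
  have hy : d * (I * t) + -c = I * t * (c * (-(I * t))⁻¹ + d) := by
    field_simp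
    ring
  rw [hy]
  generalize c * (-(I * t))⁻¹ + d = x at hx ⊢
  have hI : (I * t * x) ^ 2 = -(t ^ 2 * x ^ 2) := by
    rw [mul_pow, mul_pow, I_sq]; ring
  rw [show (t⁻¹ * (c ^ 2)⁻¹ * (I * t * x) * -c) ^ 2 = (t⁻¹ * (c ^ 2)⁻¹ * -c) ^ 2 * (I * t * x) ^ 2 by ring, hI]
  field_simp

/-! ## §E The analytic spine E1 → E1b → E1′ (ALL PROVED, gen 8) -/

/-- **E1 (PROVED, gen 8).** `(Θ_ij ∣₂ γ)(S·it) = −(√det[T])⁻¹ c⁻² Σ_{L : Fin 4 → Fin |c|} e{[T][L]·a/c}·Θ_P(Z′_t, W_L)`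
for `c = γ₁₀ ≠ 0`, `t > 0`, `P` the level datum.  PROOF ROUTE: `ModularForm.SL_slash_apply`, `brandtTheta_apply`,
`moeb_spOfSL_mul_S_I_smul` (backwards) to reach `siegelThetaSeries [T] (M⟨it·1⟩)`; then
`siegelThetaSeries_moeb_I_smul_eq_sum [T] (brandtGram_isSymm) (even_brandtGram_diag) (posDef_brandtGram) ⟨2, rfl⟩ hN hPQ hQP
(spOfSL_mem _) (det_toBlocks₂₂_spOfSL_mul_S ▸ …) (Int.natAbs_pos.2 hc) (natAbs_smul_B_mul_inv_D γ hc) ht` (n = 1, so `(…)^n`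
is `(…)^1`), `B_mul_inv_D_eq` under `Finset.sum_congr`; the scalar algebra: `denom(γ, S·it) = (ci + d_γ t)/t`
(`ModularGroup.denom_apply`, `modular_S_smul`), `det (denom M (it·1)) = d_γ·it − c = i(ci + d_γ t)` (`denom_fromBlocks`,
`det_one1`), `det D = −c`, whence `t²(ci+d_γ t)^{−2} · (t⁻¹ c⁻² (d_γ it − c)(−c))² = −c⁻²` (`field_simp; ring` with `I_sq`). -/
theorem slash_brandtTheta_apply_cuspPath [NeZero (Nplus * Nminus)] (i j : ClassSet S.O) (γ : SL(2, ℤ)) (hc : γ 1 0 ≠ 0)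
    {P : Matrix (Fin 4) (Fin 4) ℤ} (hPQ : P * brandtGram S i j = ((Nplus * Nminus : ℕ) : ℤ) • (1 : Matrix (Fin 4) (Fin 4) ℤ))
    (hQP : brandtGram S i j * P = ((Nplus * Nminus : ℕ) : ℤ) • (1 : Matrix (Fin 4) (Fin 4) ℤ)) {t : ℝ} (ht : 0 < t) :
    (⇑(S.brandtTheta i j) ∣[(2 : ℤ)] (γ : GL (Fin 2) ℝ)) (ModularGroup.S • UpperHalfPlane.ofComplex (I * t)) =
      -((((Real.sqrt ((brandtGram S i j).map ((↑) : ℤ → ℝ)).det : ℝ) : ℂ))⁻¹ * (((γ 1 0 : ℤ) : ℂ) ^ 2)⁻¹) *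
        ∑ L : Matrix (Fin 4) (Fin 1) (Fin (γ 1 0).natAbs),
          siegelThetaSeriesTerm (brandtGram S i j) (one1 (((γ 0 0 : ℤ) : ℂ) / ((γ 1 0 : ℤ) : ℂ))) (L.map fun x => ((x : ℕ) : ℤ)) *
            siegelJacobiTheta P (0 : Matrix (Fin 1) (Fin 4) ℂ)
              ((((Nplus * Nminus : ℕ) : ℤ) : ℂ)⁻¹ • ((-((I * (t : ℂ))⁻¹ * ((((γ 1 0).natAbs : ℕ) : ℂ) ^ 2)⁻¹)) •
                (SiegelUpperHalfSpace.denom ((spOfSL (γ * ModularGroup.S)).map ((↑) : ℤ → ℂ))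
                    ((I * (t : ℂ)) • (1 : Matrix (Fin 1) (Fin 1) ℂ)) *
                  ((spOfSL (γ * ModularGroup.S)).toBlocks₂₂.map ((↑) : ℤ → ℂ))ᵀ)))
              ((((Nplus * Nminus : ℕ) : ℤ) : ℂ)⁻¹ •
                (((((γ 1 0).natAbs : ℕ) : ℂ))⁻¹ • ((L.map fun x => ((x : ℕ) : ℤ)).map ((↑) : ℤ → ℂ))ᵀ *
                  (brandtGram S i j).map ((↑) : ℤ → ℂ))) := by
  set Q := brandtGram S i j with hQdef
  have hQ := brandtGram_isSymm S i j
  have hQe := even_brandtGram_diag S i j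
  have hQp := posDef_brandtGram S i j
  have hN : (0 : ℤ) < ((Nplus * Nminus : ℕ) : ℤ) := by exact_mod_cast Nat.pos_of_ne_zero (NeZero.ne (Nplus * Nminus))
  have hM := spOfSL_mem (γ * ModularGroup.S)
  have hD : (spOfSL (γ * ModularGroup.S)).toBlocks₂₂.det ≠ 0 := by
    rw [det_toBlocks₂₂_spOfSL_mul_S]; exact neg_ne_zero.2 hc
  have hd : 0 < (γ 1 0).natAbs := Int.natAbs_pos.2 hc
  have hdS := natAbs_smul_B_mul_inv_D γ hc
  have hIm : 0 < (I * t : ℂ).im := by simp [ht]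
  -- the point `S·(it) = (−it)⁻¹` and the automorphy factor `c(−it)⁻¹ + d ≠ 0`
  have hcoe : ((ModularGroup.S • UpperHalfPlane.ofComplex (I * t) : ℍ) : ℂ) = (-(I * t))⁻¹ := by
    rw [UpperHalfPlane.modular_S_smul, UpperHalfPlane.coe_mk, UpperHalfPlane.ofComplex_apply_of_im_pos hIm]
  have hx := UpperHalfPlane.denom_ne_zero (γ : GL (Fin 2) ℝ) (ModularGroup.S • UpperHalfPlane.ofComplex (I * t))
  rw [ModularGroup.denom_apply, hcoe] at hx
  -- expand along (4.13)–(4.14)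
  rw [← ModularForm.SL_slash, ModularForm.SL_slash_apply, ModularGroup.denom_apply, hcoe, brandtTheta_apply, ← hQdef,
    ← moeb_spOfSL_mul_S_I_smul γ ht,
    siegelThetaSeries_moeb_I_smul_eq_sum Q hQ hQe hQp ⟨2, rfl⟩ hN hPQ hQP hM hD hd hdS ht]
  simp only [B_mul_inv_D_eq γ hc]
  rw [det_denom_spOfSL_I_smul (γ * ModularGroup.S) ht, det_toBlocks₂₂_spOfSL_mul_S, (mul_S_apply γ).2.2.1,
    (mul_S_apply γ).2.2.2]
  -- scalar algebra: `t²(ci + d_γ t)^{−2} · (t⁻¹ c⁻² (d_γ it − c)(−c))² = −c⁻²`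
  have ht0 : (t : ℂ) ≠ 0 := by exact_mod_cast ht.ne'
  have hc0 : ((γ 1 0 : ℤ) : ℂ) ≠ 0 := by exact_mod_cast hc
  have hd0 : (((γ 1 0).natAbs : ℕ) : ℂ) ≠ 0 := by exact_mod_cast hd.ne'
  have hd2 : (((γ 1 0).natAbs : ℕ) : ℂ) ^ 2 = ((γ 1 0 : ℤ) : ℂ) ^ 2 := by
    rw [← Int.cast_natCast, ← Int.cast_pow, Int.natAbs_sq, Int.cast_pow]
  have hs : ((Real.sqrt (Q.map ((↑) : ℤ → ℝ)).det : ℝ) : ℂ) ≠ 0 := by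
    exact_mod_cast (Real.sqrt_pos.2 hQp.det_pos).ne'
  have hIt : (-(I * (t : ℂ))) ≠ 0 := neg_ne_zero.2 (mul_ne_zero I_ne_zero ht0)
  rw [show (4 / 2 : ℕ) = 2 from rfl, _root_.zpow_neg, zpow_ofNat, mul_right_comm]
  congr 1
  simp only [pow_one]
  push_cast
  rw [hd2]
  linear_combination cuspPath_scalar _ _ ((γ 1 1 : ℤ) : ℂ) _ hs hc0 ht0 hx

/-- **E1b (PROVED, gen 8).** The limit along the path is the gen-5 cusp constant:
`(Θ_ij ∣₂ γ)(S·it) → thetaCuspValue [T_ij] γ` as `t → 0⁺` (`c ≠ 0`).  PROOF ROUTE: `Tendsto.congr'` with E1 on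
`𝓝[>] 0`; `tendsto_finset_sum` and, termwise, `tendsto_siegelJacobiTheta_zPrime P hP hPp hD hd hN W` with the REAL matrix
`W = N⁻¹|c|⁻¹ ᵗL [T]` (`Matrix.map` bookkeeping: `W.map ofReal = …`; `hP`, `hPp` from `isSymm_of_level₅`/`posDef_map_of_level`
as in the tree's proof of `siegelThetaChi_eq_pow_mul_siegelGaussSum`); the value: `Σ_L e{[T][L]a/c} = |c|⁴ · siegelGaussSum [T] |c| (a/c)`
(`siegelGaussSum_def`, `4 * 1 = 4`), `(I c)^{−2} = −(c²)⁻¹` (`I_sq`), `√det([T]ℝ) = √((det[T] : ℤ) : ℝ)` (`Int.cast_det` /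
`RingHom.map_det`), `thetaCuspValue, if_neg hc`. -/
theorem tendsto_slash_brandtTheta_cuspPath [NeZero (Nplus * Nminus)] (i j : ClassSet S.O) (γ : SL(2, ℤ)) (hc : γ 1 0 ≠ 0) :
    Tendsto (fun t : ℝ => (⇑(S.brandtTheta i j) ∣[(2 : ℤ)] (γ : GL (Fin 2) ℝ)) (ModularGroup.S • UpperHalfPlane.ofComplex (I * t)))
      (𝓝[>] 0) (𝓝 (thetaCuspValue (brandtGram S i j) γ)) := by
  obtain ⟨P, hPQ, hQP, -⟩ := exists_brandtGram_levelDatum S i j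
  have hQ := brandtGram_isSymm S i j
  have hQp := posDef_brandtGram S i j
  set Q := brandtGram S i j with hQdef
  have hN : (0 : ℤ) < ((Nplus * Nminus : ℕ) : ℤ) := by exact_mod_cast Nat.pos_of_ne_zero (NeZero.ne (Nplus * Nminus))
  -- `P = N[T]⁻¹` is symmetric and positive
  have hP : P.IsSymm := by
    have h1 : Pᵀ * Q = P * Q := by
      rw [hPQ, ← hQ.eq, ← Matrix.transpose_mul, hQP, Matrix.transpose_smul, Matrix.transpose_one]
    have h2 : ((Nplus * Nminus : ℕ) : ℤ) • Pᵀ = ((Nplus * Nminus : ℕ) : ℤ) • P := by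
      calc ((Nplus * Nminus : ℕ) : ℤ) • Pᵀ = Pᵀ * (Q * P) := by rw [hQP, Matrix.mul_smul, Matrix.mul_one]
        _ = P * (Q * P) := by rw [← Matrix.mul_assoc, h1, Matrix.mul_assoc]
        _ = ((Nplus * Nminus : ℕ) : ℤ) • P := by rw [hQP, Matrix.mul_smul, Matrix.mul_one]
    refine Matrix.IsSymm.ext fun a b => mul_left_cancel₀ hN.ne' ?_
    have h := congr_fun (congr_fun h2 a) b
    simpa only [Matrix.smul_apply, Matrix.transpose_apply, smul_eq_mul] using h
  have hPp : (P.map ((↑) : ℤ → ℝ)).PosDef := posDef_map_of_level Q hQp hN hQP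
  have hD : (spOfSL (γ * ModularGroup.S)).toBlocks₂₂.det ≠ 0 := by
    rw [det_toBlocks₂₂_spOfSL_mul_S]; exact neg_ne_zero.2 hc
  have hd : 0 < (γ 1 0).natAbs := Int.natAbs_pos.2 hc
  -- termwise: every theta factor `Θ_P(Z′_t, W_L) → 1` (A–Z: "we can take the limit term by term … equal to 1")
  have hterm : ∀ L : Matrix (Fin 4) (Fin 1) (Fin (γ 1 0).natAbs),
      Tendsto (fun t : ℝ => siegelJacobiTheta P (0 : Matrix (Fin 1) (Fin 4) ℂ)
        ((((Nplus * Nminus : ℕ) : ℤ) : ℂ)⁻¹ • ((-((I * (t : ℂ))⁻¹ * ((((γ 1 0).natAbs : ℕ) : ℂ) ^ 2)⁻¹)) •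
          (SiegelUpperHalfSpace.denom ((spOfSL (γ * ModularGroup.S)).map ((↑) : ℤ → ℂ))
              ((I * (t : ℂ)) • (1 : Matrix (Fin 1) (Fin 1) ℂ)) *
            ((spOfSL (γ * ModularGroup.S)).toBlocks₂₂.map ((↑) : ℤ → ℂ))ᵀ)))
        ((((Nplus * Nminus : ℕ) : ℤ) : ℂ)⁻¹ •
          (((((γ 1 0).natAbs : ℕ) : ℂ))⁻¹ • ((L.map fun x => ((x : ℕ) : ℤ)).map ((↑) : ℤ → ℂ))ᵀ * Q.map ((↑) : ℤ → ℂ))))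
        (𝓝[>] 0) (𝓝 1) := by
    intro L
    have h := tendsto_siegelJacobiTheta_zPrime hP hPp hD hd hN
      ((((Nplus * Nminus : ℕ) : ℤ) : ℝ)⁻¹ •
        (((((γ 1 0).natAbs : ℕ) : ℝ))⁻¹ • ((L.map fun x => ((x : ℕ) : ℤ)).map ((↑) : ℤ → ℝ))ᵀ * Q.map ((↑) : ℤ → ℝ)))
    have hW : ((((Nplus * Nminus : ℕ) : ℤ) : ℝ)⁻¹ •
        (((((γ 1 0).natAbs : ℕ) : ℝ))⁻¹ • ((L.map fun x => ((x : ℕ) : ℤ)).map ((↑) : ℤ → ℝ))ᵀ * Q.map ((↑) : ℤ → ℝ))).map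
          ((↑) : ℝ → ℂ) =
        (((Nplus * Nminus : ℕ) : ℤ) : ℂ)⁻¹ •
          (((((γ 1 0).natAbs : ℕ) : ℂ))⁻¹ • ((L.map fun x => ((x : ℕ) : ℤ)).map ((↑) : ℤ → ℂ))ᵀ * Q.map ((↑) : ℤ → ℂ)) := by
      ext a b
      simp [Matrix.map_apply, Matrix.mul_apply, Matrix.smul_apply, Matrix.transpose_apply, Complex.ofReal_mul,
        Complex.ofReal_inv, Finset.mul_sum, -Nat.cast_natAbs]
    rw [hW] at h
    exact h
  -- E1 along the filter, the finite sum of limits, and the value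
  have hE : ∀ᶠ t : ℝ in 𝓝[>] 0, _ = _ :=
    eventually_nhdsWithin_of_forall fun t (ht : 0 < t) => slash_brandtTheta_apply_cuspPath S i j γ hc hPQ hQP ht
  have hsum := (tendsto_finsetSum Finset.univ fun L _ =>
    (hterm L).const_mul (siegelThetaSeriesTerm Q (one1 (((γ 0 0 : ℤ) : ℂ) / ((γ 1 0 : ℤ) : ℂ))) (L.map fun x => ((x : ℕ) : ℤ)))).const_mul
      (-((((Real.sqrt (Q.map ((↑) : ℤ → ℝ)).det : ℝ) : ℂ))⁻¹ * (((γ 1 0 : ℤ) : ℂ) ^ 2)⁻¹))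
  have hdet : ((Q.map ((↑) : ℤ → ℝ)).det : ℝ) = ((Q.det : ℤ) : ℝ) := by
    rw [show Q.map ((↑) : ℤ → ℝ) = (Int.castRingHom ℝ).mapMatrix Q from rfl, ← RingHom.map_det, eq_intCast]
  have hc0 : ((γ 1 0 : ℤ) : ℂ) ≠ 0 := by exact_mod_cast hc
  have hd0 : (((γ 1 0).natAbs : ℕ) : ℂ) ≠ 0 := by exact_mod_cast hd.ne'
  have hv : -((((Real.sqrt (Q.map ((↑) : ℤ → ℝ)).det : ℝ) : ℂ))⁻¹ * (((γ 1 0 : ℤ) : ℂ) ^ 2)⁻¹) *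
      ∑ L : Matrix (Fin 4) (Fin 1) (Fin (γ 1 0).natAbs),
        siegelThetaSeriesTerm Q (one1 (((γ 0 0 : ℤ) : ℂ) / ((γ 1 0 : ℤ) : ℂ))) (L.map fun x => ((x : ℕ) : ℤ)) * 1 =
      thetaCuspValue Q γ := by
    rw [thetaCuspValue, if_neg hc, siegelGaussSum_def, hdet]
    simp only [mul_one]
    rw [show (-((4 / 2 : ℕ) : ℤ)) = -(2 : ℤ) by norm_num, _root_.zpow_neg, zpow_ofNat, mul_pow, I_sq]
    field_simp
  rw [hv] at hsum
  exact hsum.congr' (hE.mono fun t ht => ht.symm)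

/-- Every `SL₂(ℤ)`-translate of `Θ_ij` tends to its `valueAtInfty` at `i∞` (tree `tendsto_cosetSlash`; as in gen-5 L1). PROVED. -/
theorem tendsto_slash_brandtTheta_atImInfty [NeZero (Nplus * Nminus)] (i j : ClassSet S.O) (γ : SL(2, ℤ)) :
    Tendsto (⇑(S.brandtTheta i j) ∣[(2 : ℤ)] (γ : GL (Fin 2) ℝ)) UpperHalfPlane.atImInfty
      (𝓝 (UpperHalfPlane.valueAtInfty (⇑(S.brandtTheta i j) ∣[(2 : ℤ)] (γ : GL (Fin 2) ℝ)))) := by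
  have := tendsto_cosetSlash (coe_mem_formSpace (S.brandtTheta i j))
    ((γ⁻¹ : SL(2, ℤ)) : SL(2, ℤ) ⧸ CongruenceSubgroup.Gamma0 (Nplus * Nminus))
  rwa [cosetSlash_mk (slash_eq_of_mem_gamma0Space (coe_mem_formSpace (S.brandtTheta i j))), inv_inv] at this

/-- **E1c (c = 0, PROVED).** At the cusp `∞` itself: `γ = ±T^h ∈ Γ₀(N)`, so `v(Θ_ij ∣₂ γ) = v(Θ_ij) = 1 = d²`. -/
theorem valueAtInfty_slash_brandtTheta_of_apply_eq_zero [NeZero (Nplus * Nminus)] (i j : ClassSet S.O) (γ : SL(2, ℤ))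
    (hc : γ 1 0 = 0) :
    UpperHalfPlane.valueAtInfty (⇑(S.brandtTheta i j) ∣[(2 : ℤ)] (γ : GL (Fin 2) ℝ)) = thetaCuspValue (brandtGram S i j) γ := by
  have hγ : γ ∈ CongruenceSubgroup.Gamma0 (Nplus * Nminus) := by
    rw [CongruenceSubgroup.Gamma0_mem, hc, Int.cast_zero]
  rw [slash_eq_of_mem_gamma0Space (coe_mem_formSpace (S.brandtTheta i j)) γ hγ, S.valueAtInfty_brandtTheta,
    thetaCuspValue, if_pos hc]
  have hdet := Matrix.det_fin_two (γ : Matrix (Fin 2) (Fin 2) ℤ)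
  rw [γ.det_coe, hc, mul_zero, sub_zero] at hdet
  rcases Int.eq_one_or_neg_one_of_mul_eq_one' hdet.symm with ⟨-, h⟩ | ⟨-, h⟩ <;> rw [h] <;> norm_num

/-- **E1′ (PROVED from E1b).** `valueAtInfty (Θ_ij ∣₂ γ) = thetaCuspValue [T_ij] γ` for every `γ ∈ SL₂(ℤ)`:
`c = 0` is E1c; `c ≠ 0` is uniqueness of limits along the path `S·(it) → i∞` between E1b and
`tendsto_slash_brandtTheta_atImInfty`. This is the E1′ the gen-6 composition `brandtTheta_sub_isCuspForm` consumes. -/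
theorem valueAtInfty_slash_brandtTheta [NeZero (Nplus * Nminus)] (i j : ClassSet S.O) (γ : SL(2, ℤ)) :
    UpperHalfPlane.valueAtInfty (⇑(S.brandtTheta i j) ∣[(2 : ℤ)] (γ : GL (Fin 2) ℝ)) = thetaCuspValue (brandtGram S i j) γ := by
  by_cases hc : γ 1 0 = 0
  · exact valueAtInfty_slash_brandtTheta_of_apply_eq_zero S i j γ hc
  · exact tendsto_nhds_unique ((tendsto_slash_brandtTheta_atImInfty S i j γ).comp tendsto_S_smul_ofComplex_I_mul)
      (tendsto_slash_brandtTheta_cuspPath S i j γ hc)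

/-! ## §F One cheap arithmetic helper of the gen-6 block: C3b (PROVED, gen 8) -/

/-- **C3b (gen 6, PROVED gen 8).** `G(a/c, Q)` depends only on `a mod c` for even symmetric `Q`: by
`siegelGaussSum_fin_one_eq_sum_stdAddChar` (A–Z (4.10), Prop. 4.9) it is `|c|^{-m} Σ_L ψ_{|c|}(a·sgn c·Q[L]/2)`, and
`a ≡ a' (mod |c|)` in `ZMod |c|` (`ZMod.intCast_eq_intCast_iff`). -/
theorem siegelGaussSum_congr_num {m : ℕ} {Q : Matrix (Fin m) (Fin m) ℤ} (hQ : Q.IsSymm) (hQe : ∀ i, Even (Q i i))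
    {a a' c : ℤ} (hc : c ≠ 0) (h : a ≡ a' [ZMOD c]) :
    siegelGaussSum Q c.natAbs (one1 ((a : ℂ) / (c : ℂ))) = siegelGaussSum Q c.natAbs (one1 ((a' : ℂ) / (c : ℂ))) := by
  haveI : NeZero c.natAbs := ⟨Int.natAbs_ne_zero.2 hc⟩
  have h' : a ≡ a' [ZMOD (c.natAbs : ℤ)] := Int.modEq_iff_dvd.2 (Int.natAbs_dvd.2 (Int.modEq_iff_dvd.1 h))
  show siegelGaussSum Q _ (Matrix.of fun _ _ : Fin 1 => _) = siegelGaussSum Q _ (Matrix.of fun _ _ : Fin 1 => _)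
  rw [siegelGaussSum_fin_one_eq_sum_stdAddChar Q hQ hQe rfl a, siegelGaussSum_fin_one_eq_sum_stdAddChar Q hQ hQe rfl a']
  congr 1
  refine Finset.sum_congr rfl fun L _ => ?_
  congr 1
  exact (ZMod.intCast_eq_intCast_iff _ _ _).2 ((h'.mul_right _).mul_right _)

/-! ## §G E2′ — the exact-conjugation case of the gen-6 helper E2 (the only case C4 uses; PROVED gen 8) -/

theorem map_mul_intCast {R : Type*} [NonAssocRing R] {a b c : Type*} [Fintype b] (A : Matrix a b ℤ) (B : Matrix b c ℤ) :
    (A * B).map ((↑) : ℤ → R) = A.map ((↑) : ℤ → R) * B.map ((↑) : ℤ → R) :=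
  Matrix.map_mul (f := Int.castRingHom R)

/-- `e{Q[U][L]·S} = e{Q[UL]·S}`. -/
theorem siegelThetaSeriesTerm_conj {m n : ℕ} (Q U : Matrix (Fin m) (Fin m) ℤ) (S' : Matrix (Fin n) (Fin n) ℂ)
    (L : Matrix (Fin m) (Fin n) ℤ) :
    siegelThetaSeriesTerm (Uᵀ * Q * U) S' L = siegelThetaSeriesTerm Q S' (U * L) := by
  rw [siegelThetaSeriesTerm_def, siegelThetaSeriesTerm_def, map_mul_intCast, map_mul_intCast, map_mul_intCast,
    Matrix.transpose_map, Matrix.transpose_mul]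
  simp only [Matrix.mul_assoc]

/-- **E2′ (gen 8, PROVED).** `G_d(S, Q[U]) = G_d(S, Q)` for `U` invertible modulo `d` (`UV ≡ 1 (mod d)`) and `dS` integral,
`S` symmetric: reindex `L ↦ UL` on `M_{m,n}(ℤ/d)`; the phase only sees `L mod d` (`siegelThetaSeriesTerm_add_smul`, A–Z (4.10)).
C4 uses it with `U, V` from B5 (`UᵀT_ijU = n·T_il`, `UV = n·1`, `n ⊥ c`, `V ↦ n̄V`), `d = |c|`, `S = (a/c)`, `T = (a·sgn c)`. -/
theorem siegelGaussSum_conj {m n : ℕ} {Q : Matrix (Fin m) (Fin m) ℤ} (hQ : Q.IsSymm) (hQe : ∀ i, Even (Q i i))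
    {S' : Matrix (Fin n) (Fin n) ℂ} (hS : S'.IsSymm) {d : ℕ} (hd : 0 < d) {T : Matrix (Fin n) (Fin n) ℤ}
    (hdS : (d : ℂ) • S' = T.map ((↑) : ℤ → ℂ)) {U V : Matrix (Fin m) (Fin m) ℤ}
    (hUV : ∀ r s, (d : ℤ) ∣ (U * V - 1) r s) :
    siegelGaussSum (Uᵀ * Q * U) d S' = siegelGaussSum Q d S' := by
  haveI : NeZero d := ⟨hd.ne'⟩
  -- `U`, `V` modulo `d` are mutually inverse
  set Ub : Matrix (Fin m) (Fin m) (ZMod d) := U.map ((↑) : ℤ → ZMod d) with hUb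
  set Vb : Matrix (Fin m) (Fin m) (ZMod d) := V.map ((↑) : ℤ → ZMod d) with hVb
  have hUVb : Ub * Vb = 1 := by
    rw [hUb, hVb, ← map_mul_intCast]
    ext r s
    have h := (ZMod.intCast_zmod_eq_zero_iff_dvd ((U * V - 1) r s) d).2 (hUV r s)
    rw [Matrix.sub_apply, Int.cast_sub, sub_eq_zero] at h
    rw [Matrix.map_apply, h, Matrix.one_apply, Matrix.one_apply]
    split_ifs <;> simp
  have hVUb : Vb * Ub = 1 := mul_eq_one_comm.1 hUVb
  -- `Fin d`-indexed sums as `ZMod d`-indexed sums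
  have hval : ∀ x : Fin d, ((ZMod.finEquiv d).toEquiv x).val = (x : ℕ) := by
    intro x
    obtain ⟨k, rfl⟩ : ∃ k, d = k + 1 := ⟨d - 1, (Nat.succ_pred_eq_of_pos hd).symm⟩
    rfl
  have hA : ∀ Q' : Matrix (Fin m) (Fin m) ℤ,
      ∑ L : Matrix (Fin m) (Fin n) (Fin d), siegelThetaSeriesTerm Q' S' (L.map fun x => ((x : ℕ) : ℤ)) =
        ∑ X : Matrix (Fin m) (Fin n) (ZMod d), siegelThetaSeriesTerm Q' S' (X.map fun x => ((x.val : ℕ) : ℤ)) := by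
    intro Q'
    refine Fintype.sum_equiv (ZMod.finEquiv d).toEquiv.mapMatrix _ _ fun L => ?_
    congr 1
    ext r s
    simp only [Equiv.mapMatrix_apply, Matrix.map_apply]
    exact (congrArg (fun t : ℕ => (t : ℤ)) (hval (L r s))).symm
  -- lift / reduce
  have hrl : ∀ X : Matrix (Fin m) (Fin n) (ZMod d), (X.map fun x => ((x.val : ℕ) : ℤ)).map ((↑) : ℤ → ZMod d) = X := by
    intro X; ext r s; simp [Matrix.map_apply]
  have hper : ∀ M : Matrix (Fin m) (Fin n) ℤ, siegelThetaSeriesTerm Q S' M =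
      siegelThetaSeriesTerm Q S' ((M.map ((↑) : ℤ → ZMod d)).map fun x => ((x.val : ℕ) : ℤ)) := by
    intro M
    have hM : M = ((M.map ((↑) : ℤ → ZMod d)).map fun x => ((x.val : ℕ) : ℤ)) + (d : ℤ) • M.map (fun z => z / (d : ℤ)) := by
      ext r s
      simp only [Matrix.add_apply, Matrix.map_apply, Matrix.smul_apply, smul_eq_mul, ZMod.val_intCast]
      rw [mul_comm]
      exact (Int.emod_add_ediv_mul _ _).symm
    have hdS' : (((d : ℕ) : ℤ) : ℂ) • S' = T.map ((↑) : ℤ → ℂ) := by rw [Int.cast_natCast]; exact hdS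
    conv_lhs => rw [hM]
    exact siegelThetaSeriesTerm_add_smul hQ hQe hS hdS' _ _
  have hredU : ∀ X : Matrix (Fin m) (Fin n) (ZMod d),
      (U * X.map fun x => ((x.val : ℕ) : ℤ)).map ((↑) : ℤ → ZMod d) = Ub * X := by
    intro X; rw [map_mul_intCast, hrl]
  let e : Matrix (Fin m) (Fin n) (ZMod d) ≃ Matrix (Fin m) (Fin n) (ZMod d) :=
    ⟨fun X => Ub * X, fun X => Vb * X, fun X => by simp only; rw [← Matrix.mul_assoc, hVUb, Matrix.one_mul],
      fun X => by simp only; rw [← Matrix.mul_assoc, hUVb, Matrix.one_mul]⟩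
  have he : ∀ X, e X = Ub * X := fun X => rfl
  have hsum : ∑ X : Matrix (Fin m) (Fin n) (ZMod d), siegelThetaSeriesTerm (Uᵀ * Q * U) S' (X.map fun x => ((x.val : ℕ) : ℤ)) =
      ∑ X : Matrix (Fin m) (Fin n) (ZMod d), siegelThetaSeriesTerm Q S' (X.map fun x => ((x.val : ℕ) : ℤ)) := by
    calc ∑ X : Matrix (Fin m) (Fin n) (ZMod d), siegelThetaSeriesTerm (Uᵀ * Q * U) S' (X.map fun x => ((x.val : ℕ) : ℤ))
        = ∑ X : Matrix (Fin m) (Fin n) (ZMod d), siegelThetaSeriesTerm Q S' ((e X).map fun x => ((x.val : ℕ) : ℤ)) := by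
          refine Finset.sum_congr rfl fun X _ => ?_
          rw [siegelThetaSeriesTerm_conj, hper (U * _), hredU, he]
      _ = ∑ X : Matrix (Fin m) (Fin n) (ZMod d), siegelThetaSeriesTerm Q S' (X.map fun x => ((x.val : ℕ) : ℤ)) :=
          Fintype.sum_equiv e _ _ fun X => rfl
  rw [siegelGaussSum_def, siegelGaussSum_def]
  exact congrArg (fun z => ((d : ℂ) ^ (m * n))⁻¹ * z) ((hA _).trans (hsum.trans (hA _).symm))

/-! ## §H C4 assembled from B5 and C1 (taken as HYPOTHESES) — the interface check (PROVED gen 8)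

With E2′, C3a, C3b and `det_brandtGram` in hand, the gen-6 assembly item C4 is a theorem modulo exactly B5 and C1,
whose gen-6 signatures are consumed VERBATIM below (so a prover closing B5 and C1 as typed closes C4, hence H1). -/

/-- **C3a (g6, proved there; copied).** `G_d(T, nQ) = G_d(nT, Q)`. -/
theorem siegelGaussSum_natCast_smul {m k : ℕ} (Q : Matrix (Fin m) (Fin m) ℤ) (n d : ℕ) (T : Matrix (Fin k) (Fin k) ℂ) :
    siegelGaussSum ((n : ℤ) • Q) d T = siegelGaussSum Q d ((n : ℂ) • T) := by
  simp only [siegelGaussSum]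
  refine congrArg₂ (· * ·) rfl (Finset.sum_congr rfl fun L _ => ?_)
  rw [siegelThetaSeriesTerm_def, siegelThetaSeriesTerm_def]
  have hmap : ((n : ℤ) • Q).map ((↑) : ℤ → ℂ) = (n : ℂ) • Q.map ((↑) : ℤ → ℂ) := by
    ext i j; simp only [Matrix.map_apply, Matrix.smul_apply, smul_eq_mul, Int.cast_mul, Int.cast_natCast]
  simp only [hmap, Matrix.mul_smul, Matrix.smul_mul]

/-- **C4 from B5 + C1 (gen 8, PROVED).** For `c = 0` take `γ' = γ`; for `c ≠ 0` take `n, U, V` from B5 at `|c|`, the matrix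
`γ' = (na, −v; c, u)` (`u·na + v·c = 1`), C1 for `γ' ∈ Γ₀(N)γT^ℤ`, and
`G(a/c,[T_ij]) = G(a/c,[T_ij][U])` (E2′ with `V' = n̄V`) `= G(a/c, n[T_il])` (B5) `= G(na/c,[T_il])` (C3a). -/
theorem exists_thetaCuspValue_brandtGram_eq_sameRow_of [NeZero (Nplus * Nminus)] (i j l : ClassSet S.O)
    (hB5 : ∀ c : ℕ, 0 < c → ∃ n : ℕ, n.Coprime c ∧ n ≡ 1 [MOD Nat.gcd c ((Nplus * Nminus) / Nat.gcd (Nplus * Nminus) c)] ∧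
      ∃ U V : Matrix (Fin 4) (Fin 4) ℤ,
        Uᵀ * brandtGram S i j * U = (n : ℤ) • brandtGram S i l ∧ U * V = (n : ℤ) • (1 : Matrix (Fin 4) (Fin 4) ℤ))
    (hC1 : ∀ γ γ' : SL(2, ℤ), γ 1 0 ≠ 0 → γ' 1 0 = γ 1 0 → ∀ n : ℤ, (γ 1 0 : ℤ) ∣ γ' 0 0 - n * γ 0 0 →
      ((Nat.gcd (γ 1 0).natAbs ((Nplus * Nminus) / Nat.gcd (Nplus * Nminus) (γ 1 0).natAbs) : ℕ) : ℤ) ∣ n - 1 →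
      ∃ δ ∈ CongruenceSubgroup.Gamma0 (Nplus * Nminus), ∃ h : ℤ, γ' = δ * γ * ModularGroup.T ^ h)
    (γ : SL(2, ℤ)) :
    ∃ γ' : SL(2, ℤ), (∃ δ ∈ CongruenceSubgroup.Gamma0 (Nplus * Nminus), ∃ h : ℤ, γ' = δ * γ * ModularGroup.T ^ h) ∧
      thetaCuspValue (brandtGram S i j) γ = thetaCuspValue (brandtGram S i l) γ' := by
  by_cases hc : γ 1 0 = 0
  · refine ⟨γ, ⟨1, one_mem _, 0, by simp⟩, ?_⟩
    rw [thetaCuspValue, thetaCuspValue, if_pos hc, if_pos hc]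
  -- data from B5 at `|c|`
  have hd : 0 < (γ 1 0).natAbs := Int.natAbs_pos.2 hc
  obtain ⟨n, hn, hng, U, V, hU, hUV⟩ := hB5 (γ 1 0).natAbs hd
  -- `γ' = (na, -v; c, u)`
  have hac : IsCoprime (γ 0 0 : ℤ) (γ 1 0) := by
    refine ⟨γ 1 1, -(γ 0 1), ?_⟩
    have hdet := γ.prop
    rw [Matrix.det_fin_two] at hdet
    linear_combination hdet
  have hnd : IsCoprime (n : ℤ) ((γ 1 0).natAbs : ℤ) := Nat.isCoprime_iff_coprime.2 hn
  have hnc : IsCoprime (n : ℤ) (γ 1 0) := by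
    rcases Int.natAbs_eq (γ 1 0) with h | h
    · rw [h]; exact hnd
    · rw [h]; exact hnd.neg_right
  obtain ⟨u, v, huv⟩ := hnc.mul_left hac
  let γ' : SL(2, ℤ) := ⟨!![(n : ℤ) * γ 0 0, -v; γ 1 0, u], by rw [Matrix.det_fin_two_of]; linear_combination huv⟩
  have h10 : γ' 1 0 = γ 1 0 := rfl
  have h00 : γ' 0 0 = n * γ 0 0 := rfl
  have hc' : γ' 1 0 ≠ 0 := by rw [h10]; exact hc
  -- C1
  have hg : ((Nat.gcd (γ 1 0).natAbs ((Nplus * Nminus) / Nat.gcd (Nplus * Nminus) (γ 1 0).natAbs) : ℕ) : ℤ) ∣ (n : ℤ) - 1 := by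
    have h := Nat.modEq_iff_dvd.1 hng.symm
    rwa [Nat.cast_one] at h
  obtain ⟨δ, hδ, h, hγ'⟩ := hC1 γ γ' hc h10 n (by rw [h00, sub_self]; exact dvd_zero _) hg
  refine ⟨γ', ⟨δ, hδ, h, hγ'⟩, ?_⟩
  -- the Gauss-sum chain
  have hQ := brandtGram_isSymm S i j
  have hQe := even_brandtGram_diag S i j
  have hS : (one1 (((γ 0 0 : ℤ) : ℂ) / ((γ 1 0 : ℤ) : ℂ))).IsSymm := SiegelModularForm.one1_transpose _
  have hc0 : ((γ 1 0 : ℤ) : ℂ) ≠ 0 := by exact_mod_cast hc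
  have hsc : (((γ 1 0).sign : ℤ) : ℂ) * ((γ 1 0 : ℤ) : ℂ) = (((γ 1 0).natAbs : ℕ) : ℂ) := by
    have h := congrArg (fun z : ℤ => (z : ℂ)) (Int.sign_mul_self_eq_natAbs (γ 1 0))
    simpa only [Int.cast_mul, Int.cast_natCast] using h
  have hdS : (((γ 1 0).natAbs : ℕ) : ℂ) • one1 (((γ 0 0 : ℤ) : ℂ) / ((γ 1 0 : ℤ) : ℂ)) =
      (one1 (γ 0 0 * (γ 1 0).sign)).map ((↑) : ℤ → ℂ) := by
    rw [one1_map, smul_one1]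
    congr 1
    field_simp
    push_cast
    linear_combination (-((γ 0 0 : ℤ) : ℂ)) * hsc
  obtain ⟨nb, w, hnb⟩ := hnd
  have hUV' : ∀ r s, (((γ 1 0).natAbs : ℕ) : ℤ) ∣ (U * (nb • V) - 1) r s := by
    intro r s
    rw [Matrix.mul_smul, hUV, smul_smul, Matrix.sub_apply, Matrix.smul_apply, Matrix.one_apply]
    split_ifs
    · exact ⟨-w, by rw [smul_eq_mul, mul_one]; linear_combination hnb⟩
    · simp
  have hG : siegelGaussSum (brandtGram S i j) (γ 1 0).natAbs (one1 (((γ 0 0 : ℤ) : ℂ) / ((γ 1 0 : ℤ) : ℂ))) =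
      siegelGaussSum (brandtGram S i l) (γ 1 0).natAbs (one1 ((((n : ℤ) * γ 0 0 : ℤ) : ℂ) / ((γ 1 0 : ℤ) : ℂ))) := by
    rw [← siegelGaussSum_conj hQ hQe hS hd hdS hUV', hU, siegelGaussSum_natCast_smul, smul_one1]
    congr 2
    push_cast
    ring
  rw [thetaCuspValue, thetaCuspValue, if_neg hc, if_neg hc', det_brandtGram, det_brandtGram, h10, h00, hG]

/-! ## §I H1 modulo exactly {B5, C1} — the gen-6 §D composition re-run on the gen-8 proofs (kernel-checked, 0 sorries)

`B5Statement` / `C1Statement` are the gen-6 signatures of B5 (`exists_brandtGram_sublattice_datum`, with `hN`/`hcop` moved to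
where a prover has them) and C1 (`exists_gamma0_mul_T_zpow`) as `Prop`s; L1 and C2 are the gen-5/6 proofs repeated verbatim. -/

/-- B5 (gen-6 signature) as a hypothesis. -/
def B5Statement (i j l : ClassSet S.O) : Prop :=
  ∀ c : ℕ, 0 < c → ∃ n : ℕ, n.Coprime c ∧ n ≡ 1 [MOD Nat.gcd c ((Nplus * Nminus) / Nat.gcd (Nplus * Nminus) c)] ∧
    ∃ U V : Matrix (Fin 4) (Fin 4) ℤ,
      Uᵀ * brandtGram S i j * U = (n : ℤ) • brandtGram S i l ∧ U * V = (n : ℤ) • (1 : Matrix (Fin 4) (Fin 4) ℤ)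

/-- C1 (gen-6 signature) as a hypothesis. -/
def C1Statement (N : ℕ) : Prop :=
  ∀ γ γ' : SL(2, ℤ), γ 1 0 ≠ 0 → γ' 1 0 = γ 1 0 → ∀ n : ℤ, (γ 1 0 : ℤ) ∣ γ' 0 0 - n * γ 0 0 →
    ((Nat.gcd (γ 1 0).natAbs (N / Nat.gcd N (γ 1 0).natAbs) : ℕ) : ℤ) ∣ n - 1 →
    ∃ δ ∈ CongruenceSubgroup.Gamma0 N, ∃ h : ℤ, γ' = δ * γ * ModularGroup.T ^ h

/-- **L1 (gen 5, PROVED there; repeated).** Equal values of all `SL₂(ℤ)`-translates ⇒ the difference is cuspidal. -/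
theorem isCuspForm_sub_of_forall_valueAtInfty_slash_eq {N : ℕ} [NeZero N] (f g : ModularForm (CongruenceSubgroup.Gamma0 N) 2)
    (h : ∀ γ : SL(2, ℤ), UpperHalfPlane.valueAtInfty (⇑f ∣[(2 : ℤ)] (γ : GL (Fin 2) ℝ)) =
      UpperHalfPlane.valueAtInfty (⇑g ∣[(2 : ℤ)] (γ : GL (Fin 2) ℝ))) :
    ModularForm.IsCuspForm (f - g) := by
  have hF : (⇑f - ⇑g) ∈ gamma0Space N 2 := Submodule.sub_mem _ (coe_mem_formSpace f) (coe_mem_formSpace g)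
  have hlim : ∀ (u : ModularForm (CongruenceSubgroup.Gamma0 N) 2) (γ : SL(2, ℤ)),
      Tendsto (⇑u ∣[(2 : ℤ)] (γ : GL (Fin 2) ℝ)) UpperHalfPlane.atImInfty
        (𝓝 (UpperHalfPlane.valueAtInfty (⇑u ∣[(2 : ℤ)] (γ : GL (Fin 2) ℝ)))) := by
    intro u γ
    have := tendsto_cosetSlash (coe_mem_formSpace u) ((γ⁻¹ : SL(2, ℤ)) : SL(2, ℤ) ⧸ CongruenceSubgroup.Gamma0 N)
    rwa [cosetSlash_mk (slash_eq_of_mem_gamma0Space (coe_mem_formSpace u)), inv_inv] at this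
  have h0 : ∀ γ : SL(2, ℤ), UpperHalfPlane.IsZeroAtImInfty ((⇑f - ⇑g) ∣[(2 : ℤ)] (γ : GL (Fin 2) ℝ)) := by
    intro γ
    have hsub : (⇑f - ⇑g) ∣[(2 : ℤ)] (γ : GL (Fin 2) ℝ) =
        ⇑f ∣[(2 : ℤ)] (γ : GL (Fin 2) ℝ) - ⇑g ∣[(2 : ℤ)] (γ : GL (Fin 2) ℝ) := by
      rw [sub_eq_add_neg, SlashAction.add_slash, SlashAction.neg_slash, ← sub_eq_add_neg]
    show Tendsto ((⇑f - ⇑g) ∣[(2 : ℤ)] (γ : GL (Fin 2) ℝ)) UpperHalfPlane.atImInfty (𝓝 0)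
    rw [hsub]
    have := (hlim f γ).sub (hlim g γ)
    rwa [h γ, sub_self] at this
  refine ⟨cuspFormOfVanishing (⇑f - ⇑g) hF h0, ?_⟩
  ext τ
  rw [CuspForm.toModularFormₗ_apply, ModularForm.sub_apply]
  rfl

/-- **C2 (gen 6, PROVED there; repeated).** `v(f ∣ δ γ T^h) = v(f ∣ γ)` for `δ ∈ Γ₀(N)`. -/
theorem valueAtInfty_slash_gamma0_mul_T_zpow {N : ℕ} [NeZero N] {k : ℤ} (f : ModularForm (CongruenceSubgroup.Gamma0 N) k)
    (γ : SL(2, ℤ)) {δ : SL(2, ℤ)} (hδ : δ ∈ CongruenceSubgroup.Gamma0 N) (h : ℤ) :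
    UpperHalfPlane.valueAtInfty (⇑f ∣[k] ((δ * γ * ModularGroup.T ^ h : SL(2, ℤ)) : GL (Fin 2) ℝ)) =
      UpperHalfPlane.valueAtInfty (⇑f ∣[k] (γ : GL (Fin 2) ℝ)) := by
  have hγ : ⇑f ∣[k] ((δ * γ * ModularGroup.T ^ h : SL(2, ℤ)) : GL (Fin 2) ℝ) =
      transl h (⇑f ∣[k] (γ : GL (Fin 2) ℝ)) := by
    rw [coeGL_mul, coeGL_mul, SlashAction.slash_mul, SlashAction.slash_mul,
      slash_eq_of_mem_gamma0Space (coe_mem_formSpace f) δ hδ, slash_T_zpow_eq_transl]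
  have hlim : Tendsto (⇑f ∣[k] (γ : GL (Fin 2) ℝ)) UpperHalfPlane.atImInfty
      (𝓝 (UpperHalfPlane.valueAtInfty (⇑f ∣[k] (γ : GL (Fin 2) ℝ)))) := by
    have := tendsto_cosetSlash (coe_mem_formSpace f) ((γ⁻¹ : SL(2, ℤ)) : SL(2, ℤ) ⧸ CongruenceSubgroup.Gamma0 N)
    rwa [cosetSlash_mk (slash_eq_of_mem_gamma0Space (coe_mem_formSpace f)), inv_inv] at this
  rw [hγ]
  exact (hlim.comp (tendsto_T_zpow_smul_atImInfty h)).limUnder_eq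

/-- **H1, same row, modulo {B5, C1}.** -/
theorem brandtTheta_sub_isCuspForm_sameRow_of [NeZero (Nplus * Nminus)] (i j l : ClassSet S.O)
    (hB5 : B5Statement S i j l) (hC1 : C1Statement (Nplus * Nminus)) :
    ModularForm.IsCuspForm (S.brandtTheta i j - S.brandtTheta i l) := by
  refine isCuspForm_sub_of_forall_valueAtInfty_slash_eq _ _ fun γ => ?_
  obtain ⟨γ', ⟨δ, hδ, h, rfl⟩, hv⟩ := exists_thetaCuspValue_brandtGram_eq_sameRow_of S i j l hB5 hC1 γ
  rw [valueAtInfty_slash_brandtTheta S i j γ, hv, ← valueAtInfty_slash_brandtTheta S i l,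
    valueAtInfty_slash_gamma0_mul_T_zpow (S.brandtTheta i l) γ hδ h]

/-- **H1 exactly as consumed by k2's closing chain, modulo {B5 (all same-row triples), C1}.** -/
theorem brandtTheta_sub_isCuspForm_of [NeZero (Nplus * Nminus)]
    (hB5 : ∀ i j l : ClassSet S.O, B5Statement S i j l) (hC1 : C1Statement (Nplus * Nminus))
    (i j k l : ClassSet S.O) : ModularForm.IsCuspForm (S.brandtTheta i j - S.brandtTheta k l) := by
  have h1 := brandtTheta_sub_isCuspForm_sameRow_of S i j l (hB5 i j l) hC1
  have h2 := brandtTheta_sub_isCuspForm_sameRow_of S l i k (hB5 l i k) hC1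
  rw [S.brandtTheta_symm l i, S.brandtTheta_symm l k] at h2
  have h3 : S.brandtTheta i j - S.brandtTheta k l =
      (S.brandtTheta i j - S.brandtTheta i l) + (S.brandtTheta i l - S.brandtTheta k l) := by
    abel
  rw [ModularForm.IsCuspForm, h3]
  exact Submodule.add_mem _ h1 h2

/-! ## §J C1 PROVED (gen 8): `Γ₀(N)`-double-coset recognition `γ' ∈ Γ₀(N) γ T^ℤ`

`δ_h := γ' T^{-h} γ⁻¹` has lower-left entry `c (d − d' + h c)`; with `G = (N, c)`, `M = N/G`, `g = (c, M)`:
`g ∣ a' − a` (from `c ∣ a' − n a`, `g ∣ n − 1`), hence `g ∣ d − d' = d d'(a' − a) + c (b d' − b' d)`; Bézout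
`g = |c| x + M y` gives `h` with `M ∣ d − d' + h c`, and then `N = G M ∣ c (d − d' + h c)`. -/
theorem c1Statement_holds (N : ℕ) [NeZero N] : C1Statement N := by
  intro γ γ' hc hcc n hn hg
  have hdet : γ 0 0 * γ 1 1 - γ 0 1 * γ 1 0 = 1 := by
    have h := γ.prop; rw [Matrix.det_fin_two] at h; exact h
  have hdet' : γ' 0 0 * γ' 1 1 - γ' 0 1 * γ 1 0 = 1 := by
    have h := γ'.prop; rw [Matrix.det_fin_two, hcc] at h; exact h
  -- moduli
  set G : ℕ := Nat.gcd N (γ 1 0).natAbs with hG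
  set M : ℕ := N / G with hM
  set g : ℕ := Nat.gcd (γ 1 0).natAbs M with hg'
  have hgc : (g : ℤ) ∣ γ 1 0 := (Int.natCast_dvd_natCast.2 (Nat.gcd_dvd_left _ _)).trans (Int.natAbs_dvd.2 dvd_rfl)
  have hGc : (G : ℤ) ∣ γ 1 0 := (Int.natCast_dvd_natCast.2 (Nat.gcd_dvd_right _ _)).trans (Int.natAbs_dvd.2 dvd_rfl)
  have hNM : (N : ℤ) = G * M := by rw [hM]; exact_mod_cast (Nat.mul_div_cancel' (Nat.gcd_dvd_left _ _)).symm
  -- `g ∣ d - d'`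
  have h1 : (g : ℤ) ∣ γ' 0 0 - γ 0 0 := by
    have : (γ' 0 0 : ℤ) - γ 0 0 = (γ' 0 0 - n * γ 0 0) + (n - 1) * γ 0 0 := by ring
    rw [this]; exact dvd_add (hgc.trans hn) (hg.mul_right _)
  have hdd : (g : ℤ) ∣ γ 1 1 - γ' 1 1 := by
    have : (γ 1 1 : ℤ) - γ' 1 1 = γ 1 1 * γ' 1 1 * (γ' 0 0 - γ 0 0) + γ 1 0 * (γ 0 1 * γ' 1 1 - γ' 0 1 * γ 1 1) := by
      linear_combination γ' 1 1 * hdet - γ 1 1 * hdet'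
    rw [this]; exact dvd_add (h1.mul_left _) (hgc.mul_right _)
  obtain ⟨t, ht⟩ := hdd
  -- Bézout and the shift
  have hbez : (g : ℤ) = ((γ 1 0).natAbs : ℤ) * Nat.gcdA (γ 1 0).natAbs M + (M : ℤ) * Nat.gcdB (γ 1 0).natAbs M :=
    Nat.gcd_eq_gcd_ab _ _
  have habs : (((γ 1 0).natAbs : ℕ) : ℤ) = (γ 1 0).sign * γ 1 0 := (Int.sign_mul_self_eq_natAbs _).symm
  set x : ℤ := Nat.gcdA (γ 1 0).natAbs M with hx
  set y : ℤ := Nat.gcdB (γ 1 0).natAbs M with hy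
  set h : ℤ := -((γ 1 0).sign * x * t) with hh
  have hMdvd : (M : ℤ) ∣ γ 1 1 - γ' 1 1 + h * γ 1 0 :=
    ⟨t * y, by rw [ht, hh]; linear_combination t * hbez + x * t * habs⟩
  refine ⟨γ' * (ModularGroup.T ^ h)⁻¹ * γ⁻¹, ?_, h, by group⟩
  have hentry : ((γ' * (ModularGroup.T ^ h)⁻¹ * γ⁻¹ : SL(2, ℤ)) : Matrix (Fin 2) (Fin 2) ℤ) 1 0 =
      γ 1 0 * (γ 1 1 - γ' 1 1 + h * γ 1 0) := by
    rw [← _root_.zpow_neg, Matrix.SpecialLinearGroup.coe_mul, Matrix.SpecialLinearGroup.coe_mul, ModularGroup.coe_T_zpow,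
      Matrix.SpecialLinearGroup.coe_inv, Matrix.adjugate_fin_two]
    simp [Matrix.mul_apply, Fin.sum_univ_two]
    rw [hcc]; ring
  rw [CongruenceSubgroup.Gamma0_mem, hentry, ZMod.intCast_zmod_eq_zero_iff_dvd]
  obtain ⟨k, hk⟩ := hMdvd
  obtain ⟨c₁, hc₁⟩ := hGc
  refine ⟨c₁ * k, ?_⟩
  rw [hk, hNM, hc₁]; ring

/-- **C1 in the gen-6 signature.** -/
theorem exists_gamma0_mul_T_zpow {N : ℕ} [NeZero N] (γ γ' : SL(2, ℤ)) (hc : γ 1 0 ≠ 0) (hcc : γ' 1 0 = γ 1 0) {n : ℤ}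
    (hn : (γ 1 0 : ℤ) ∣ γ' 0 0 - n * γ 0 0)
    (hg : ((Nat.gcd (γ 1 0).natAbs (N / Nat.gcd N (γ 1 0).natAbs) : ℕ) : ℤ) ∣ n - 1) :
    ∃ δ ∈ CongruenceSubgroup.Gamma0 N, ∃ h : ℤ, γ' = δ * γ * ModularGroup.T ^ h :=
  c1Statement_holds N γ γ' hc hcc n hn hg

/-- **H1 modulo B5 alone (gen 8).** -/
theorem brandtTheta_sub_isCuspForm_of_B5 [NeZero (Nplus * Nminus)]
    (hB5 : ∀ i j l : ClassSet S.O, B5Statement S i j l)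
    (i j k l : ClassSet S.O) : ModularForm.IsCuspForm (S.brandtTheta i j - S.brandtTheta k l) :=
  brandtTheta_sub_isCuspForm_of S hB5 (c1Statement_holds _) i j k l

end Summit.ABC.ABC.Cruxes.SteinbergCore.StubIdeasK1G8

/-! ## H1 assembled (gen 9) -/

namespace Summit.ABC.ABC.Cruxes.SteinbergCore.StubIdeasK1G9

open Literature.NumberTheory.Automorphic Literature.NumberTheory.Automorphic.Brandt

variable {Nplus Nminus : ℕ} (S : XiSetup Nplus Nminus)

/-- B2 holds (gen 7's `exists_mem_order_reducedNorm_modEq_of_not_dvd`, `0 < N⁺` from `NeZero (N⁺N⁻)`). -/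
theorem b2Statement_holds [NeZero (Nplus * Nminus)] : B2Statement S := by
  intro p hp hpN e t ht
  haveI : Fact p.Prime := ⟨hp⟩
  have hN : 0 < Nplus := Nat.pos_of_ne_zero fun h => NeZero.ne (Nplus * Nminus) (by rw [h, zero_mul])
  exact StubIdeasK1G7.exists_mem_order_reducedNorm_modEq_of_not_dvd S hpN hN e ht

/-- B5 holds for coprime `(N⁺, N⁻)` (gen 9), in gen 8's spelling of the statement. -/
theorem b5Statement_holds [NeZero (Nplus * Nminus)] (hcop : Nplus.Coprime Nminus) (i j l : ClassSet S.O) :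
    StubIdeasK1G8.B5Statement S i j l :=
  b5Statement_of S hcop (b2Statement_holds S) i j l

/-- **H1 (complete, hypotheses explicit).** Every difference of Brandt theta series `Θ_ij − Θ_kl` of an Eichler order
of level `(N⁺, N⁻)`, `(N⁺, N⁻) = 1`, is a cusp form of weight 2 and level `Γ₀(N⁺N⁻)`. [cite: EichlerLNM320, Ch. IV §1]
[cite: Pizer1980, Prop. 2.15] [cite: HijikataPizerShemanske1989] -/
theorem brandtTheta_sub_isCuspForm [NeZero (Nplus * Nminus)] (hcop : Nplus.Coprime Nminus)
    (i j k l : ClassSet S.O) : ModularForm.IsCuspForm (S.brandtTheta i j - S.brandtTheta k l) :=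
  StubIdeasK1G8.brandtTheta_sub_isCuspForm_of_B5 S (fun i' j' l' => b5Statement_holds S hcop i' j' l') i j k l

/-- **H1 (unconditional).** `NeZero (N⁺N⁻)` and `(N⁺,N⁻) = 1` are properties of every Brandt setup
(`XiSetup.nplus_pos`, `XiSetup.squarefree`, `XiSetup.coprime`). -/
theorem brandtTheta_sub_isCuspForm' (i j k l : ClassSet S.O) :
    ModularForm.IsCuspForm (S.brandtTheta i j - S.brandtTheta k l) := by
  haveI : NeZero (Nplus * Nminus) := ⟨mul_ne_zero S.nplus_pos.ne' S.squarefree.ne_zero⟩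
  exact brandtTheta_sub_isCuspForm S S.coprime i j k l

/-- **k2's H1, verbatim** (`ThetaTransferG3.brandtTheta_sub_isCuspForm`, the hypothesis `hΘ` of
`stub_xiDegreeComparison_of_thetaTransfer`) — PROVED. -/
theorem thetaTransfer_H1 :
    ∀ (Nplus Nminus : ℕ) (S : XiSetup Nplus Nminus) [Fintype (ClassSet S.O)] (i j k l : ClassSet S.O),
      ModularForm.IsCuspForm (S.brandtTheta i j - S.brandtTheta k l) :=
  fun _ _ S _ i j k l => brandtTheta_sub_isCuspForm' S i j k l

end Summit.ABC.ABC.Cruxes.SteinbergCore.StubIdeasK1G9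

-- ======================= PART B (k1 g10 sketch, verbatim) =======================

/-!
# Sketch (stub-ideation k=1 · GEN 10 · FAMILY 1 RECOGNISE & IMPORT) for `stub_xiDegreeComparison`
# of crux `SteinbergCore` (route-ABC-DefiniteXi, line `p6_tamagawa_split`):
# the IMPORT MAP — theta side typed end-to-end, composed with k2's PROVED kernel into k3's
# `XiCoreDivisibility`.

Companion to `STUB-IDEAS-stub_xiDegreeComparison-1.md` (gen 10).  What the three seats now hold:

* H1 `brandtTheta_sub_isCuspForm` — PROVED (k1 gen 9, `StubIdeasK1G9.thetaTransfer_H1`,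
  `STUB_IDEAS_stub_xiDegreeComparison_1_g9_H1complete.lean`, 0 sorries).  Recorded here as the
  `Prop` `H1` and consumed as a hypothesis `(hΘ : H1)` (crux workfiles are not importable).
* k2 gen 4 (`ThetaTransferG4`, all PROVED): the Brandt-free kernel (β)+(T)
  `dvd_natAbs_mul_congruenceNumber_of_transfer`, self-adjointness H4a′
  `peterssonProduct_anemicHecke_symm`, transport H4b′ `exists_anemicHecke_transport`, orthogonality
  (O) `peterssonProduct_transfer_eq_zero`.  Recorded here VERBATIM as the `Prop`s `KernelT`,
  `SelfAdjH4a`, `TransportH4b`, `OrthO` and consumed as hypotheses.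
* k3 gen 4 (`ProbeExtremesG4`): `XiCoreDivisibility` (copied verbatim below) ⟹ stub modulo
  {ARS 2.1(b), `FreyModularity`} by the Mazur-free tail L2 (PROVED) + L3/L5/L6/L7 (sorry, S/XS).

NEW in this file (k1-owned, the theta side = the only untyped stretch between H1 and the kernel) —
EVERYTHING BELOW IS PROVED (`lean check` rc 0, 0 sorries, axioms {propext, Classical.choice, Quot.sound}):
K1 `isCuspForm_sum_smul_brandtTheta` · the DEFINITION `thetaLift` (row theta lift on the degree-zero
lattice, by `Exists.choose` on H1) with its spec `coe_thetaLift` · K2b/K2c additivity & homogeneity ·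
K2g degree preservation `sum_matrix_mulVec_eq_zero` · K2d `cuspCoeff_thetaLift` (`aₙ(Θ_i v) =
2 w_i (B(n)v)_i`) · K2e integrality `thetaLift_mem_integralCuspForms0` · K2f `T_p`-equivariance
`heckeT_thetaLift` · K3 = H3 `thetaLift_eq_smul_of_isNewformOf` (`Θ_i(φ) = 2 w_i φ_i • f`, by strong
multiplicity one `mem_span_of_equiv_of_mem_newSubspace0` + `a₁`) · K5 the COMPOSITION
`xiCoreDivisibility_of_thetaSide : H1 → KernelT → SelfAdjH4a → TransportH4b → OrthO → XiCoreDivisibility`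
(the interface test of the import map: level `Γ₀(N⁺N⁻)` vs `Γ₀(M)` by `subst`, `ξ ≠ 0` from
`one_le_weight`, the ABSTRACT projector `Brandt.exists_heckeProjector` — NOT the setup form
`exists_heckeProjector_xi`, whose `adjoin` over ALL `B(n)` is too big for H4b′ — and the vacuous row
`φ_i = 0`) · §5b = k2's gen-4 kernel copied VERBATIM (namespace `KernelK2G4`, k2's work, here only so
the chain is kernel-checked in one file) · §5c the four templates ARE k2's theorems (`kernelT_holds`, …) ·
`xiCoreDivisibility_of_H1 : H1 → XiCoreDivisibility`.
The companion certificate `STUB_IDEAS_stub_xiDegreeComparison_1_g10_XiCoreComplete.lean` (= k1 g9 H1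
file ++ this file ++ one line) proves `xiCoreDivisibility : XiCoreDivisibility` with NO hypotheses.
-/

set_option linter.dupNamespace false

noncomputable section

namespace Summit.ABC.ABC.Cruxes.SteinbergCore.StubIdeasK1G10

open scoped MatrixGroups ModularForm Matrix
open CongruenceSubgroup
open Literature.NumberTheory.EllipticCurves Literature.NumberTheory.EllipticCurves.ModularForms
open Literature.NumberTheory.Automorphic Literature.NumberTheory.Automorphic.Brandt

/-! ## §1 H1 — differences of Brandt theta series are cusp forms (PROVED, k1 gen 9) -/

/-- **H1** verbatim (= `StubIdeasK1G9.thetaTransfer_H1` = k2 `ThetaTransferG3.brandtTheta_sub_isCuspForm`):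
`Θ_ij − Θ_kl ∈ S₂(Γ₀(N⁺N⁻))`.  PROVED in `STUB_IDEAS_stub_xiDegreeComparison_1_g9_H1complete.lean`. -/
def H1 : Prop :=
  ∀ (Nplus Nminus : ℕ) (S : XiSetup Nplus Nminus) [Fintype (ClassSet S.O)] (i j k l : ClassSet S.O),
    ModularForm.IsCuspForm (S.brandtTheta i j - S.brandtTheta k l)

variable {Nplus Nminus : ℕ}

/-! ## §2 K1 — degree-zero combinations of one theta row are cuspidal (PROVED from H1) -/

/-- **K1 (XS, PROVED).** `Σ_j v_j = 0 ⟹ Σ_j v_j Θ_ij ∈ S₂(Γ₀(N⁺N⁻))`: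
`Σ_j v_j Θ_ij = Σ_j v_j (Θ_ij − Θ_ii)` and the cusp forms are a submodule. [folklore] -/
theorem isCuspForm_sum_smul_brandtTheta (hΘ : H1) (S : XiSetup Nplus Nminus)
    [Fintype (ClassSet S.O)] (i : ClassSet S.O) {v : ClassSet S.O → ℤ} (hv : ∑ j, v j = 0) :
    ModularForm.IsCuspForm (∑ j, (v j : ℂ) • S.brandtTheta i j) := by
  have h0 : ∑ j, (v j : ℂ) • S.brandtTheta i i = 0 := by
    rw [← Finset.sum_smul, ← Int.cast_sum, hv, Int.cast_zero, zero_smul]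
  have h : ∑ j, (v j : ℂ) • S.brandtTheta i j =
      ∑ j, (v j : ℂ) • (S.brandtTheta i j - S.brandtTheta i i) := by
    simp_rw [smul_sub, Finset.sum_sub_distrib, h0, sub_zero]
  rw [h, ← ModularForm.mem_cuspFormSubmodule_iff]
  exact Submodule.sum_mem _ fun j _ => Submodule.smul_mem _ _ (hΘ Nplus Nminus S i j i i)

/-- From `IsCuspForm` to an honest `CuspForm` with the same underlying modular form
(`IsCuspForm f := f ∈ range toModularFormₗ`, definitional). [folklore] -/
theorem exists_cuspForm_of_isCuspForm {Γ : Subgroup (GL (Fin 2) ℝ)} [Γ.HasDetOne] {k : ℤ}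
    {f : ModularForm Γ k} (h : ModularForm.IsCuspForm f) :
    ∃ g : CuspForm Γ k, (g : ModularForm Γ k) = f := h

/-! ## §3 K2 — the row theta lift `Θ_i : ℤ[Cls O]⁰ → S₂(Γ₀(N⁺N⁻))` and its package -/

/-- **The row theta lift** `Θ_i(v) = Σ_j v_j Θ_ij` for `deg v = 0` (junk `0` off the degree-zero
lattice) — the `Θ` fed to k2's transfer template (T). [folklore] -/
def thetaLift (hΘ : H1) (S : XiSetup Nplus Nminus) [Fintype (ClassSet S.O)] (i : ClassSet S.O)
    (v : ClassSet S.O → ℤ) : CuspForm (Gamma0 (Nplus * Nminus)) 2 :=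
  if hv : ∑ j, v j = 0 then
    (exists_cuspForm_of_isCuspForm (isCuspForm_sum_smul_brandtTheta hΘ S i hv)).choose
  else 0

/-- **K2a (PROVED).** The underlying modular form of `Θ_i(v)` is `Σ_j v_j Θ_ij`. [folklore] -/
theorem coe_thetaLift (hΘ : H1) (S : XiSetup Nplus Nminus) [Fintype (ClassSet S.O)]
    (i : ClassSet S.O) {v : ClassSet S.O → ℤ} (hv : ∑ j, v j = 0) :
    ((thetaLift hΘ S i v : CuspForm (Gamma0 (Nplus * Nminus)) 2) :
        ModularForm (Gamma0 (Nplus * Nminus)) 2) = ∑ j, (v j : ℂ) • S.brandtTheta i j := by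
  rw [thetaLift, dif_pos hv]
  exact (exists_cuspForm_of_isCuspForm (isCuspForm_sum_smul_brandtTheta hΘ S i hv)).choose_spec

/-- Two cusp forms with the same underlying modular form are equal. [folklore] -/
theorem cuspForm_eq_of_coe_eq {Γ : Subgroup (GL (Fin 2) ℝ)} [Γ.HasDetOne] {k : ℤ}
    {g g' : CuspForm Γ k} (h : (g : ModularForm Γ k) = (g' : ModularForm Γ k)) : g = g' :=
  CuspForm.toModularFormₗ_injective h

/-- **K2b (XS, PROVED).** Additivity on the degree-zero lattice. [folklore] -/
theorem thetaLift_add (hΘ : H1) (S : XiSetup Nplus Nminus) [Fintype (ClassSet S.O)]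
    (i : ClassSet S.O) (v v' : ClassSet S.O → ℤ) (hv : ∑ c, v c = 0) (hv' : ∑ c, v' c = 0) :
    thetaLift hΘ S i (v + v') = thetaLift hΘ S i v + thetaLift hΘ S i v' := by
  have hvv' : ∑ c, (v + v') c = 0 := by
    simp only [Pi.add_apply, Finset.sum_add_distrib, hv, hv', add_zero]
  apply CuspForm.toModularFormₗ_injective
  rw [map_add, CuspForm.toModularFormₗ_eq_coe, CuspForm.toModularFormₗ_eq_coe,
    CuspForm.toModularFormₗ_eq_coe, coe_thetaLift hΘ S i hvv', coe_thetaLift hΘ S i hv,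
    coe_thetaLift hΘ S i hv', ← Finset.sum_add_distrib]
  refine Finset.sum_congr rfl fun j _ => ?_
  rw [Pi.add_apply, Int.cast_add, add_smul]

/-- **K2c (XS, PROVED).** `ℤ`-homogeneity on the degree-zero lattice. [folklore] -/
theorem thetaLift_smul (hΘ : H1) (S : XiSetup Nplus Nminus) [Fintype (ClassSet S.O)]
    (i : ClassSet S.O) (a : ℤ) (v : ClassSet S.O → ℤ) (hv : ∑ c, v c = 0) :
    thetaLift hΘ S i (a • v) = (a : ℂ) • thetaLift hΘ S i v := by
  have hav : ∑ c, (a • v) c = 0 := by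
    simp only [Pi.smul_apply, smul_eq_mul, ← Finset.mul_sum, hv, mul_zero]
  apply CuspForm.toModularFormₗ_injective
  rw [map_smul, CuspForm.toModularFormₗ_eq_coe, CuspForm.toModularFormₗ_eq_coe,
    coe_thetaLift hΘ S i hav, coe_thetaLift hΘ S i hv, Finset.smul_sum]
  refine Finset.sum_congr rfl fun j _ => ?_
  rw [Pi.smul_apply, smul_eq_mul, Int.cast_mul, smul_smul]

/-- **K2g (XS, PROVED).** `T(p)`, `p ∤ N⁺N⁻`, preserves the degree-zero lattice: the columns of
`T(p)` sum to `p + 1` (tree `XiSetup.sum_matrix_prime_eq`). [cite: Eichler1973, Ch. II §6 (16)] -/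
theorem sum_matrix_mulVec_eq_zero (S : XiSetup Nplus Nminus) [Fintype (ClassSet S.O)] {p : ℕ}
    (hp : p.Prime) (hpN : ¬ p ∣ Nplus * Nminus) {v : ClassSet S.O → ℤ} (hv : ∑ c, v c = 0) :
    ∑ c, (matrix S.O p *ᵥ v) c = 0 := by
  simp only [Matrix.mulVec, dotProduct]
  rw [Finset.sum_comm]
  simp_rw [← Finset.sum_mul, S.sum_matrix_prime_eq hp hpN, ← Finset.mul_sum, hv, mul_zero]

/-- **K2d (PROVED).** Fourier coefficients of the lift: `a_n(Θ_i v) = 2 w_i (T(n) v)_i` for `n ≥ 1`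
(tree `XiSetup.qExpansion_coeff_sum_smul_brandtTheta` through `coe_thetaLift`; `cuspCoeff` is the
`q`-expansion coefficient of the SAME function `⇑(Θ_i v) = ⇑(↑(Θ_i v) : ModularForm)`).
[cite: Voight2021, §41.1 (p. 752) and 41.1.3] -/
theorem cuspCoeff_thetaLift (hΘ : H1) (S : XiSetup Nplus Nminus) [Fintype (ClassSet S.O)]
    (i : ClassSet S.O) {v : ClassSet S.O → ℤ} (hv : ∑ j, v j = 0) {n : ℕ} (hn : n ≠ 0) :
    cuspCoeff (thetaLift hΘ S i v) n = ((2 * (weight S.O i : ℤ) * (matrix S.O n *ᵥ v) i : ℤ) : ℂ) := by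
  have hcoe : ⇑(thetaLift hΘ S i v) =
      ⇑(((thetaLift hΘ S i v : CuspForm (Gamma0 (Nplus * Nminus)) 2) :
        ModularForm (Gamma0 (Nplus * Nminus)) 2)) := rfl
  rw [cuspCoeff, hcoe, coe_thetaLift hΘ S i hv,
    S.qExpansion_coeff_sum_smul_brandtTheta i (fun j => (v j : ℂ)) hn, XiSetup.heckeFamily_apply]
  simp only [Matrix.mulVec, dotProduct, Matrix.map_apply, Int.coe_castRingHom]
  push_cast
  rfl

/-- **K2d₀ (PROVED).** `a_0(Θ_i v) = deg v = 0` (tree `XiSetup.qExpansion_coeff_zero_sum_smul_brandtTheta`). [folklore] -/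
theorem cuspCoeff_thetaLift_zero (hΘ : H1) (S : XiSetup Nplus Nminus) [Fintype (ClassSet S.O)]
    (i : ClassSet S.O) {v : ClassSet S.O → ℤ} (hv : ∑ j, v j = 0) :
    cuspCoeff (thetaLift hΘ S i v) 0 = 0 := by
  have hcoe : ⇑(thetaLift hΘ S i v) =
      ⇑(((thetaLift hΘ S i v : CuspForm (Gamma0 (Nplus * Nminus)) 2) :
        ModularForm (Gamma0 (Nplus * Nminus)) 2)) := rfl
  rw [cuspCoeff, hcoe, coe_thetaLift hΘ S i hv,
    S.qExpansion_coeff_zero_sum_smul_brandtTheta i (fun j => (v j : ℂ)), ← Int.cast_sum, hv,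
    Int.cast_zero]

/-- **K2e (PROVED).** Integrality: `Θ_i v ∈ S₂(Γ₀(N⁺N⁻); ℤ)` (from K2d, K2d₀). [folklore] -/
theorem thetaLift_mem_integralCuspForms0 (hΘ : H1) (S : XiSetup Nplus Nminus)
    [Fintype (ClassSet S.O)] (i : ClassSet S.O) {v : ClassSet S.O → ℤ} (hv : ∑ j, v j = 0) :
    thetaLift hΘ S i v ∈ integralCuspForms0 (Nplus * Nminus) 2 := by
  rw [mem_integralCuspForms0]
  intro n
  rcases eq_or_ne n 0 with rfl | hn
  · exact ⟨0, by rw [cuspCoeff_thetaLift_zero hΘ S i hv, Int.cast_zero]⟩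
  · exact ⟨_, (cuspCoeff_thetaLift hΘ S i hv hn).symm⟩

/-- **K2f (PROVED).** `T_p`-equivariance for `p ∤ N⁺N⁻`: `T_p (Θ_i v) = Θ_i (T(p) v)`
(tree `XiSetup.modHeckeT_sum_smul_brandtTheta` + `coe_modHeckeT_coe_cuspForm` + `coe_thetaLift`
twice, the second time at `T(p) v`, degree zero by K2g; `heckeFamily p (v ↦ ↑v_j) = ↑(T(p) v)` by
`XiSetup.heckeFamily_apply`). [cite: Pizer1980, §2 Prop. 2.23 and Remark 2.24] -/
theorem heckeT_thetaLift (hΘ : H1) (S : XiSetup Nplus Nminus) [Fintype (ClassSet S.O)]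
    [NeZero (Nplus * Nminus)] (i : ClassSet S.O) {p : ℕ} (hp : p.Prime)
    (hpN : ¬ p ∣ Nplus * Nminus) {v : ClassSet S.O → ℤ} (hv : ∑ c, v c = 0) :
    (haveI : NeZero p := ⟨hp.ne_zero⟩;
      heckeT (Gamma0 (Nplus * Nminus)) 2 p (thetaLift hΘ S i v)) =
      thetaLift hΘ S i (matrix S.O p *ᵥ v) := by
  haveI : NeZero p := ⟨hp.ne_zero⟩
  have hTv : ∑ c, (matrix S.O p *ᵥ v) c = 0 := sum_matrix_mulVec_eq_zero S hp hpN hv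
  refine DFunLike.coe_injective ?_
  have h1 : ⇑(heckeT (Gamma0 (Nplus * Nminus)) 2 p (thetaLift hΘ S i v)) =
      ⇑(modHeckeT (Gamma0 (Nplus * Nminus)) 2 p
        ((thetaLift hΘ S i v : CuspForm (Gamma0 (Nplus * Nminus)) 2) :
          ModularForm (Gamma0 (Nplus * Nminus)) 2)) :=
    (coe_modHeckeT_coe_cuspForm 2 p _).symm
  have h2 : ⇑(thetaLift hΘ S i (matrix S.O p *ᵥ v)) =
      ⇑(((thetaLift hΘ S i (matrix S.O p *ᵥ v) : CuspForm (Gamma0 (Nplus * Nminus)) 2) :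
        ModularForm (Gamma0 (Nplus * Nminus)) 2)) := rfl
  change ⇑(heckeT (Gamma0 (Nplus * Nminus)) 2 p (thetaLift hΘ S i v)) =
    ⇑(thetaLift hΘ S i (matrix S.O p *ᵥ v))
  rw [h1, h2, coe_thetaLift hΘ S i hv, coe_thetaLift hΘ S i hTv,
    S.modHeckeT_sum_smul_brandtTheta i hp hpN (fun j => (v j : ℂ))]
  congr 1
  refine Finset.sum_congr rfl fun k _ => ?_
  congr 1
  simp only [XiSetup.heckeFamily_apply, Matrix.mulVec, dotProduct, Matrix.map_apply,
    Int.coe_castRingHom]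
  push_cast
  rfl

/-! ## §4 K3 = H3 — the lift of the `a(E)`-eigenvector is `2 w_i φ_i · f` (multiplicity one) -/

/-- **K3 (PROVED).** If `f` is the newform of `W` at level `N⁺N⁻` and `φ` lies in the `a(W)`-eigen-lattice
of the Brandt matrices, then `Θ_i(φ) = (2 w_i φ_i) • f`.  Route: `deg φ = 0`
(`XiSetup.sum_eq_zero_of_mem_eigenLattice_lFunction'`); `T_p (Θ_i φ) = a_p • Θ_i φ` for `p ∤ N⁺N⁻`
(K2f + `hφ` + K2c); `T_p f = a_p • f` (`IsNewform0.heckeT_eq_coeff_smul` + `hf.2 p`); strong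
multiplicity one `mem_span_of_equiv_of_mem_newSubspace0 (IsNormalized.ne_zero_gamma0 hf.1.2.2) hf.1.1`
⟹ `Θ_i φ = c • f`; `a₁(Θ_i φ) = 2 w_i φ_i` (K2d at `n = 1`, `matrix_one`), `a₁(f) = 1`.
[cite: Knapp1993, Thm. 9.22] [cite: DiamondShurman2005, Prop. 5.8.5] -/
theorem thetaLift_eq_smul_of_isNewformOf (hΘ : H1) (S : XiSetup Nplus Nminus)
    [Fintype (ClassSet S.O)] [NeZero (Nplus * Nminus)] (i : ClassSet S.O)
    (W : WeierstrassCurve ℚ) [W.IsElliptic] {f : CuspForm (Gamma0 (Nplus * Nminus)) 2}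
    (hf : IsNewformOf W f) {φ : ClassSet S.O → ℤ}
    (hφ : φ ∈ eigenLattice (Nplus * Nminus) (matrix S.O) fun n => W.LFunction n) :
    thetaLift hΘ S i φ = ((2 * (weight S.O i : ℤ) * φ i : ℤ) : ℂ) • f := by
  classical
  have hφdeg : ∑ c, φ c = 0 := S.sum_eq_zero_of_mem_eigenLattice_lFunction' W hφ
  have hf0 : f ≠ 0 := IsNormalized.ne_zero_gamma0 hf.1.2.2
  -- `T_p f = a_p(W) f` away from the level (newform + `aₙ(f) = aₙ(W)`)
  have hfT : ∀ (p : ℕ) (hp : p.Prime), ¬ p ∣ Nplus * Nminus →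
      (haveI : NeZero p := ⟨hp.ne_zero⟩; heckeT (Gamma0 (Nplus * Nminus)) 2 p f) =
        (fun n : ℕ => (W.LFunction n : ℂ)) p • f := by
    intro p hp _
    haveI : NeZero p := ⟨hp.ne_zero⟩
    rw [hf.1.heckeT_eq_coeff_smul hp]
    exact congrArg (· • f) (hf.2 p)
  -- `T_p (Θ_i φ) = a_p(W) Θ_i φ` (K2f + eigenvector + K2c)
  have hg : ∀ (p : ℕ) (hp : p.Prime), ¬ p ∣ Nplus * Nminus →
      (haveI : NeZero p := ⟨hp.ne_zero⟩;
        heckeT (Gamma0 (Nplus * Nminus)) 2 p (thetaLift hΘ S i φ)) =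
        (fun n : ℕ => (W.LFunction n : ℂ)) p • thetaLift hΘ S i φ := by
    intro p hp hpN
    have h := heckeT_thetaLift hΘ S i hp hpN hφdeg
    rw [hφ p hp hpN, thetaLift_smul hΘ S i _ φ hφdeg] at h
    exact h
  -- strong multiplicity one: `Θ_i φ = c • f`
  obtain ⟨c, hc⟩ := Submodule.mem_span_singleton.mp
    (mem_span_of_equiv_of_mem_newSubspace0 hf0 hf.1.1 hfT (thetaLift hΘ S i φ) hg)
  -- compare `a₁`: `a₁(Θ_i φ) = 2 w_i φ_i`, `a₁(c f) = c`
  have h1 : cuspCoeff (thetaLift hΘ S i φ) 1 = ((2 * (weight S.O i : ℤ) * φ i : ℤ) : ℂ) := by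
    rw [cuspCoeff_thetaLift hΘ S i hφdeg one_ne_zero, matrix_one S.O, Matrix.one_mulVec]
  have h2 : cuspCoeff (thetaLift hΘ S i φ) 1 = c := by
    have h3 : (UpperHalfPlane.qExpansion 1 ⇑f).coeff 1 = 1 := hf.1.2.2
    rw [← hc, cuspCoeff, qExpansion_coeff_smul, h3, mul_one]
  rw [← hc, ← h2, h1]

/-! ## §5 k2's PROVED kernel, recorded as `Prop`s (verbatim `ThetaTransferG4`, gen 4) -/

/-- **(β)+(T)** = `ThetaTransferG4.dvd_natAbs_mul_congruenceNumber_of_transfer` (PROVED). -/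
def KernelT : Prop :=
  ∀ (ι : Type) [Fintype ι] (N : ℕ) [NeZero N] (k : ℤ) (w : ι → ℕ) (φ : ι → ℤ) (ξ : ℕ), ξ ≠ 0 →
    ξ = ∑ c, w c * (φ c).natAbs ^ 2 → ∑ c, φ c = 0 →
    ∀ (f : CuspForm (Gamma0 N) k), f ≠ 0 → f ∈ integralCuspForms0 N k →
    ∀ (Θ : (ι → ℤ) → CuspForm (Gamma0 N) k),
      (∀ v v' : ι → ℤ, ∑ c, v c = 0 → ∑ c, v' c = 0 → Θ (v + v') = Θ v + Θ v') →
      (∀ (a : ℤ) (v : ι → ℤ), ∑ c, v c = 0 → Θ (a • v) = (a : ℂ) • Θ v) →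
      (∀ v : ι → ℤ, ∑ c, v c = 0 → Θ v ∈ integralCuspForms0 N k) →
    ∀ (m : ℤ), Θ φ = (m : ℂ) • f →
      (∀ z : ι → ℤ, ∑ c, z c = 0 → ∑ c, (w c : ℤ) * φ c * z c = 0 →
        peterssonProduct (Gamma0 N) k f (Θ z) = 0) →
    ∀ (y : ι → ℤ), ∑ c, y c = 0 →
      ξ ∣ (m * ∑ c, (w c : ℤ) * φ c * y c).natAbs * congruenceNumber f

/-- **H4a′** = `ThetaTransferG4.peterssonProduct_anemicHecke_symm` (PROVED). -/
def SelfAdjH4a : Prop :=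
  ∀ (N : ℕ) [NeZero N] (k : ℤ) (t : anemicHeckeRing N k) (f g : CuspForm (Gamma0 N) k),
    peterssonProduct (Gamma0 N) k ((t : Module.End ℂ (CuspForm (Gamma0 N) k)) f) g =
      peterssonProduct (Gamma0 N) k f ((t : Module.End ℂ (CuspForm (Gamma0 N) k)) g)

/-- **H4b′** = `ThetaTransferG4.exists_anemicHecke_transport` (PROVED). -/
def TransportH4b : Prop :=
  ∀ (ι : Type) [Fintype ι] [DecidableEq ι] (N : ℕ) [NeZero N] (k : ℤ) (T : ℕ → Matrix ι ι ℤ)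
    (Θ : (ι → ℤ) → CuspForm (Gamma0 N) k),
    (∀ p : ℕ, p.Prime → ¬ p ∣ N → ∀ v : ι → ℤ, ∑ c, v c = 0 → ∑ c, (T p *ᵥ v) c = 0) →
    (∀ v v' : ι → ℤ, ∑ c, v c = 0 → ∑ c, v' c = 0 → Θ (v + v') = Θ v + Θ v') →
    (∀ (a : ℤ) (v : ι → ℤ), ∑ c, v c = 0 → Θ (a • v) = (a : ℂ) • Θ v) →
    (∀ (p : ℕ) (hp : p.Prime), ¬ p ∣ N → ∀ v : ι → ℤ, ∑ c, v c = 0 →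
      (haveI : NeZero p := ⟨hp.ne_zero⟩; heckeT (Gamma0 N) k p (Θ v)) = Θ (T p *ᵥ v)) →
    ∀ (M : Matrix ι ι ℤ),
      M ∈ Algebra.adjoin ℤ {X : Matrix ι ι ℤ | ∃ p : ℕ, p.Prime ∧ ¬ p ∣ N ∧ X = T p} →
    ∃ t : anemicHeckeRing N k, ∀ v : ι → ℤ, ∑ c, v c = 0 →
      (t : Module.End ℂ (CuspForm (Gamma0 N) k)) (Θ v) = Θ (M *ᵥ v)

/-- **(O)** = `ThetaTransferG4.peterssonProduct_transfer_eq_zero` (PROVED). -/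
def OrthO : Prop :=
  ∀ (ι : Type) [Fintype ι] [DecidableEq ι] (N : ℕ) [NeZero N] (k : ℤ) (w : ι → ℕ) (φ : ι → ℤ)
    (ξ D : ℕ), ξ ≠ 0 → 0 < D → ξ = ∑ c, w c * (φ c).natAbs ^ 2 →
    ∀ (M : Matrix ι ι ℤ), (∀ c d : ι, (ξ : ℤ) * M c d = (D : ℤ) * (w d : ℤ) * φ d * φ c) →
    ∀ (f : CuspForm (Gamma0 N) k) (Θ : (ι → ℤ) → CuspForm (Gamma0 N) k),
      (∀ (a : ℤ) (v : ι → ℤ), ∑ c, v c = 0 → Θ (a • v) = (a : ℂ) • Θ v) →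
    ∀ (t : anemicHeckeRing N k),
      (∀ v : ι → ℤ, ∑ c, v c = 0 →
        (t : Module.End ℂ (CuspForm (Gamma0 N) k)) (Θ v) = Θ (M *ᵥ v)) →
      (∀ g g' : CuspForm (Gamma0 N) k,
        peterssonProduct (Gamma0 N) k ((t : Module.End ℂ (CuspForm (Gamma0 N) k)) g) g' =
          peterssonProduct (Gamma0 N) k g ((t : Module.End ℂ (CuspForm (Gamma0 N) k)) g')) →
    ∑ c, φ c = 0 → ∀ (m : ℤ), m ≠ 0 → Θ φ = (m : ℂ) • f →
    ∀ (z : ι → ℤ), ∑ c, z c = 0 → ∑ c, (w c : ℤ) * φ c * z c = 0 →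
      peterssonProduct (Gamma0 N) k f (Θ z) = 0


/-! ## §5b k2's PROVED kernel, VERBATIM COPY of `STUB_IDEAS_stub_xiDegreeComparison_2_SketchG4.lean`
(stub-ideation k=2, gen 4, namespace `…ThetaTransferG4`; author: seat k2) — copied here ONLY so that the
composition below is kernel-checked end-to-end in one file (crux workfiles are not importable).
Nothing in this block is k1's work. -/

namespace KernelK2G4


open scoped MatrixGroups ModularForm Matrix
open CongruenceSubgroup
open Literature.NumberTheory.EllipticCurves.ModularForms

/-! ## (β) the Brandt-free kernel: a congruence `ξ g ≡ n f (mod f^⊥)` forces `ξ ∣ |n| · r_f` -/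

/-- **(β) kernel lemma.** If `0 ≠ f`, `g` are integral cusp forms on `Γ₀(N)`, `h ∈ (ℤf)^⊥` and
`ξ • g = n • f + h` with `ξ ≠ 0`, then `ξ ∣ |n| · r_f`.  Proof: `d := gcd(ξ, n)`, `ξ = d ξ₁`,
`n = d n₁`, `u ξ₁ + v n₁ = 1`; `h' := ξ₁ g − n₁ f ∈ (ℤf)^⊥` (as `d • h' = h`); then
`f − (−v h') = ξ₁ • (u f + v g)`, so `ξ₁ ∣ r_f` (`dvd_congruenceNumber_of_sub_eq_smul`) and
`ξ = d ξ₁ ∣ |n| r_f`. -/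
theorem dvd_natAbs_mul_congruenceNumber_of_smul_eq {N : ℕ} [NeZero N] {k : ℤ}
    {f g h : CuspForm (Gamma0 N) k} (hf : f ≠ 0)
    (hfI : f ∈ integralCuspForms0 N k) (hgI : g ∈ integralCuspForms0 N k)
    (hh : h ∈ integralOrthogonal0 f) {ξ : ℕ} (hξ : ξ ≠ 0) {n : ℤ}
    (e : (ξ : ℂ) • g = (n : ℂ) • f + h) : ξ ∣ n.natAbs * congruenceNumber f := by
  -- `d = gcd(ξ, n) > 0`, `ξ = d ξ₁`, `n = d n₁`, `u ξ₁ + v n₁ = 1`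
  set d : ℕ := Int.gcd (ξ : ℤ) n with hd
  have hdpos : 0 < d := Int.gcd_pos_of_ne_zero_left n (by exact_mod_cast hξ)
  have hdξ : (d : ℤ) ∣ (ξ : ℤ) := Int.gcd_dvd_left _ _
  have hdn : (d : ℤ) ∣ n := Int.gcd_dvd_right _ _
  set ξ₁ : ℤ := (ξ : ℤ) / d with hξ₁
  set n₁ : ℤ := n / d with hn₁
  have hξd : (ξ : ℤ) = d * ξ₁ := (Int.mul_ediv_cancel' hdξ).symm
  have hnd : n = d * n₁ := (Int.mul_ediv_cancel' hdn).symm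
  have hcop : Int.gcd ξ₁ n₁ = 1 := Int.gcd_div_gcd_div_gcd hdpos
  obtain ⟨u, v, huv⟩ := Int.isCoprime_iff_gcd_eq_one.mpr hcop
  have hξ₁nn : 0 ≤ ξ₁ := Int.ediv_nonneg (by positivity) (by positivity)
  -- the Petersson pairing with `f`
  set P : CuspForm (Gamma0 N) k →ₗ[ℂ] ℂ := peterssonProductₗ (Gamma0 N) k f with hP
  have hPh : P h = 0 := (mem_integralOrthogonal0.mp hh).2
  -- `h' := ξ₁ g − n₁ f` is integral, and `d • h' = h` makes it orthogonal to `f`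
  set h' : CuspForm (Gamma0 N) k := (ξ₁ : ℂ) • g - (n₁ : ℂ) • f with hh'
  have hh'I : h' ∈ integralCuspForms0 N k := by
    rw [hh', Int.cast_smul_eq_zsmul, Int.cast_smul_eq_zsmul]
    exact Submodule.sub_mem _ (Submodule.smul_mem _ _ hgI) (Submodule.smul_mem _ _ hfI)
  have hdh' : (d : ℂ) • h' = h := by
    have e' : h = (ξ : ℂ) • g - (n : ℂ) • f := by rw [e]; abel
    have hξC : (ξ : ℂ) = (d : ℂ) * (ξ₁ : ℂ) := by exact_mod_cast hξd
    have hnC : (n : ℂ) = (d : ℂ) * (n₁ : ℂ) := by exact_mod_cast hnd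
    rw [e', hh', smul_sub, smul_smul, smul_smul, ← hξC, ← hnC]
  have hPh' : P h' = 0 := by
    have := congrArg P hdh'
    rw [map_smul, hPh, smul_eq_mul, mul_eq_zero] at this
    exact this.resolve_left (by exact_mod_cast hdpos.ne')
  have hh'orth : h' ∈ integralOrthogonal0 f := mem_integralOrthogonal0.mpr ⟨hh'I, hPh'⟩
  -- `f − (−v h') = ξ₁ • (u f + v g)`
  set r : ℕ := ξ₁.toNat with hr
  have hrξ₁ : (r : ℤ) = ξ₁ := Int.toNat_of_nonneg hξ₁nn
  have hrC : (r : ℂ) = (ξ₁ : ℂ) := by exact_mod_cast hrξ₁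
  have hg₁ : -(v • h') ∈ integralOrthogonal0 f :=
    (integralOrthogonal0 f).neg_mem ((integralOrthogonal0 f).smul_mem v hh'orth)
  have hh₁ : u • f + v • g ∈ integralCuspForms0 N k :=
    Submodule.add_mem _ (Submodule.smul_mem _ _ hfI) (Submodule.smul_mem _ _ hgI)
  have huvC : (u : ℂ) * ξ₁ + v * n₁ = 1 := by exact_mod_cast huv
  have key : f - -(v • h') = r • (u • f + v • g) := by
    rw [← Nat.cast_smul_eq_nsmul ℂ, hrC, ← Int.cast_smul_eq_zsmul ℂ v, ← Int.cast_smul_eq_zsmul ℂ u,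
      ← Int.cast_smul_eq_zsmul ℂ v, hh']
    match_scalars <;> first | ring1 | linear_combination -huvC
  have hr_dvd : r ∣ congruenceNumber f := dvd_congruenceNumber_of_sub_eq_smul hf hg₁ hh₁ key
  -- `ξ = d r ∣ |n| · r_f`
  have hξdr : ξ = d * r := by
    have : (ξ : ℤ) = d * r := by rw [hrξ₁]; exact hξd
    exact_mod_cast this
  have hdn' : d ∣ n.natAbs := Int.natCast_dvd.mp hdn
  rw [hξdr]
  exact Nat.mul_dvd_mul hdn' hr_dvd

/-! ## (T) the transfer template: gen 3's H2b + H3 + H4 are exactly its hypotheses -/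

/-- **(T) transfer template (Brandt-free).**  Let `w : ι → ℕ`, `φ : ι → ℤ`, `ξ ≠ 0` with
`ξ = Σ_c w_c |φ_c|²` (VERBATIM the shape of the tree's `Brandt.xi_eq_sum` on the eigen-line), `φ` of degree zero, and
`Θ : ℤ^ι → S_k(Γ₀(N))` additive and `ℤ`-homogeneous on degree-zero vectors, integral-valued there,
with `Θ φ = m • f` (H3: `m = 2 w_i φ_i`) and `Θ z ⊥ f` whenever `z` has degree zero and `⟨φ, z⟩_w = 0`
(H4).  Then for every degree-zero `y`: `ξ ∣ |m ⟨φ, y⟩_w| · r_f` — apply (β) to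
`ξ • Θ y = (m⟨φ,y⟩_w) • f + Θ(ξ y − ⟨φ,y⟩_w φ)`. -/
theorem dvd_natAbs_mul_congruenceNumber_of_transfer {ι : Type*} [Fintype ι] {N : ℕ} [NeZero N]
    {k : ℤ} (w : ι → ℕ) (φ : ι → ℤ) {ξ : ℕ} (hξ : ξ ≠ 0)
    (hξw : ξ = ∑ c, w c * (φ c).natAbs ^ 2)
    (hφ : ∑ c, φ c = 0) {f : CuspForm (Gamma0 N) k} (hf : f ≠ 0) (hfI : f ∈ integralCuspForms0 N k)
    (Θ : (ι → ℤ) → CuspForm (Gamma0 N) k)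
    (hadd : ∀ v v' : ι → ℤ, ∑ c, v c = 0 → ∑ c, v' c = 0 → Θ (v + v') = Θ v + Θ v')
    (hsmul : ∀ (a : ℤ) (v : ι → ℤ), ∑ c, v c = 0 → Θ (a • v) = (a : ℂ) • Θ v)
    (hint : ∀ v : ι → ℤ, ∑ c, v c = 0 → Θ v ∈ integralCuspForms0 N k)
    {m : ℤ} (hφf : Θ φ = (m : ℂ) • f)
    (horth : ∀ z : ι → ℤ, ∑ c, z c = 0 → ∑ c, (w c : ℤ) * φ c * z c = 0 →
      peterssonProduct (Gamma0 N) k f (Θ z) = 0)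
    {y : ι → ℤ} (hy : ∑ c, y c = 0) :
    ξ ∣ (m * ∑ c, (w c : ℤ) * φ c * y c).natAbs * congruenceNumber f := by
  -- `ξ = Σ w φ²` over `ℤ`
  have hξw' : (ξ : ℤ) = ∑ c, (w c : ℤ) * φ c * φ c := by
    rw [hξw]
    push_cast
    refine Finset.sum_congr rfl fun c _ => ?_
    rw [sq_abs]
    ring
  set s : ℤ := ∑ c, (w c : ℤ) * φ c * y c with hs
  -- `z := ξ y − ⟨φ,y⟩_w φ` has degree zero and is `w`-orthogonal to `φ`
  set z : ι → ℤ := ((ξ : ℤ) • y) + ((-s) • φ) with hz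
  have hξy : ∑ c, ((ξ : ℤ) • y) c = 0 := by
    simp only [Pi.smul_apply, smul_eq_mul, ← Finset.mul_sum, hy, mul_zero]
  have hsφ : ∑ c, ((-s) • φ) c = 0 := by
    simp only [Pi.smul_apply, smul_eq_mul, ← Finset.mul_sum, hφ, mul_zero]
  have hz0 : ∑ c, z c = 0 := by
    have : ∑ c, z c = ∑ c, ((ξ : ℤ) • y) c + ∑ c, ((-s) • φ) c := by
      rw [← Finset.sum_add_distrib]
      rfl
    rw [this, hξy, hsφ, add_zero]
  have hzorth : ∑ c, (w c : ℤ) * φ c * z c = 0 := by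
    have hc : ∀ c, (w c : ℤ) * φ c * z c =
        (ξ : ℤ) * ((w c : ℤ) * φ c * y c) - s * ((w c : ℤ) * φ c * φ c) := by
      intro c
      simp only [hz, Pi.add_apply, Pi.smul_apply, smul_eq_mul]
      ring
    simp_rw [hc, Finset.sum_sub_distrib, ← Finset.mul_sum, ← hξw', ← hs]
    ring
  -- `Θ z = ξ Θ y − (m s) f`, i.e. `ξ • Θ y = (m s) • f + Θ z`
  have hΘz : Θ z = (ξ : ℂ) • Θ y + ((-s : ℤ) : ℂ) • ((m : ℂ) • f) := by
    rw [hz, hadd _ _ hξy hsφ, hsmul _ _ hy, hsmul _ _ hφ, hφf]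
    push_cast
    rfl
  have e : (ξ : ℂ) • Θ y = ((m * s : ℤ) : ℂ) • f + Θ z := by
    rw [hΘz, smul_smul]
    push_cast
    module
  have hzO : Θ z ∈ integralOrthogonal0 f :=
    mem_integralOrthogonal0.mpr ⟨hint z hz0, horth z hz0 hzorth⟩
  exact dvd_natAbs_mul_congruenceNumber_of_smul_eq hf hfI (hint y hy) hzO hξ e

/-! ## H4 re-cut over the tree's anemic Hecke ring `𝕋 = ℤ[T_p : p ∤ N]` (`anemicHeckeRing N k`,
`HeckeCongruenceModulus.lean`): self-adjointness of `𝕋` (H4a′), transport of a Brandt-side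
polynomial in the `T(p)` to `𝕋` along any `T(p)`-equivariant `Θ` (H4b′), and the orthogonality
template (O) fed by the integral projector `ξ M = D φ φᵀ W` of `Brandt.exists_heckeProjector`. -/

/-- **H4a′ (S): every element of `𝕋 = ℤ[T_p : p ∤ N]` is Petersson-self-adjoint.**
`Algebra.adjoin_induction`: generators by `heckeT_selfAdjoint_holds` (Diamond–Shurman Thm. 5.5.3,
PROVED), `algebraMap ℤ` by (conjugate-)linearity at an integer, sums trivially, products by
`⟨st·f, g⟩ = ⟨t f, s g⟩ = ⟨f, t s g⟩` and commutativity of `𝕋` (`instCommRingAnemicHeckeRing`). -/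
theorem peterssonProduct_anemicHecke_symm {N : ℕ} [NeZero N] {k : ℤ} (t : anemicHeckeRing N k)
    (f g : CuspForm (Gamma0 N) k) :
    peterssonProduct (Gamma0 N) k ((t : Module.End ℂ (CuspForm (Gamma0 N) k)) f) g =
      peterssonProduct (Gamma0 N) k f ((t : Module.End ℂ (CuspForm (Gamma0 N) k)) g) := by
  obtain ⟨x, hx⟩ := t
  change peterssonProduct (Gamma0 N) k (x f) g = peterssonProduct (Gamma0 N) k f (x g)
  replace hx : x ∈ Algebra.adjoin ℤ (anemicHeckeGenerators N k) := hx
  induction hx using Algebra.adjoin_induction generalizing f g with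
  | mem y hy =>
    obtain ⟨p, hp, hpN, rfl⟩ := hy
    haveI : NeZero p := ⟨hp.ne_zero⟩
    exact heckeT_selfAdjoint_holds N k p hp hpN f g
  | algebraMap r =>
    rw [eq_intCast, Module.End.intCast_apply, Module.End.intCast_apply,
      ← Int.cast_smul_eq_zsmul ℂ, ← Int.cast_smul_eq_zsmul ℂ, peterssonProduct_smul_left,
      peterssonProduct_smul_right, map_intCast]
  | add x y hx hy ihx ihy =>
    rw [LinearMap.add_apply, LinearMap.add_apply, peterssonProduct_add_left,
      peterssonProduct_add_right, ihx, ihy]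
  | mul x y hx hy ihx ihy =>
    have hcomm : x * y = y * x :=
      congrArg Subtype.val (mul_comm (⟨x, hx⟩ : anemicHeckeRing N k) ⟨y, hy⟩)
    conv_rhs => rw [hcomm]
    rw [Module.End.mul_apply, Module.End.mul_apply, ihx, ihy]

/-- **H4b′ (S): transport along an equivariant lift.**  If `Θ` (additive and `ℤ`-homogeneous on the
degree-zero lattice, which the `T(p)`, `p ∤ N`, preserve) intertwines `T(p)` with `T_p` for every
prime `p ∤ N`, then every `M ∈ ℤ[T(p) : p ∤ N]` is intertwined with SOME `t ∈ 𝕋`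
(`Algebra.adjoin_induction`, or `Algebra.adjoin_eq_range` + `MvPolynomial.induction_on` as in
`anemicHeckeRing.exists_eq_aeval`). -/
theorem exists_anemicHecke_transport {ι : Type*} [Fintype ι] [DecidableEq ι] {N : ℕ} [NeZero N]
    {k : ℤ} (T : ℕ → Matrix ι ι ℤ) (Θ : (ι → ℤ) → CuspForm (Gamma0 N) k)
    (hdeg : ∀ p : ℕ, p.Prime → ¬ p ∣ N → ∀ v : ι → ℤ, ∑ c, v c = 0 → ∑ c, (T p *ᵥ v) c = 0)
    (hadd : ∀ v v' : ι → ℤ, ∑ c, v c = 0 → ∑ c, v' c = 0 → Θ (v + v') = Θ v + Θ v')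
    (hsmul : ∀ (a : ℤ) (v : ι → ℤ), ∑ c, v c = 0 → Θ (a • v) = (a : ℂ) • Θ v)
    (hequiv : ∀ (p : ℕ) (hp : p.Prime), ¬ p ∣ N → ∀ v : ι → ℤ, ∑ c, v c = 0 →
      (haveI : NeZero p := ⟨hp.ne_zero⟩; heckeT (Gamma0 N) k p (Θ v)) = Θ (T p *ᵥ v))
    {M : Matrix ι ι ℤ}
    (hM : M ∈ Algebra.adjoin ℤ {X : Matrix ι ι ℤ | ∃ p : ℕ, p.Prime ∧ ¬ p ∣ N ∧ X = T p}) :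
    ∃ t : anemicHeckeRing N k, ∀ v : ι → ℤ, ∑ c, v c = 0 →
      (t : Module.End ℂ (CuspForm (Gamma0 N) k)) (Θ v) = Θ (M *ᵥ v) := by
  -- induct on `M ∈ ℤ[T(p) : p ∤ N]`, carrying degree-preservation along
  suffices h : (∀ v : ι → ℤ, ∑ c, v c = 0 → ∑ c, (M *ᵥ v) c = 0) ∧
      ∃ t : anemicHeckeRing N k, ∀ v : ι → ℤ, ∑ c, v c = 0 →
        (t : Module.End ℂ (CuspForm (Gamma0 N) k)) (Θ v) = Θ (M *ᵥ v) from h.2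
  induction hM using Algebra.adjoin_induction with
  | mem X hX =>
    obtain ⟨p, hp, hpN, rfl⟩ := hX
    haveI : NeZero p := ⟨hp.ne_zero⟩
    exact ⟨hdeg p hp hpN, anemicHeckeRing.T N k p hp hpN, fun v hv => by
      rw [anemicHeckeRing.coe_T]; exact hequiv p hp hpN v hv⟩
  | algebraMap r =>
    have hr : ∀ v : ι → ℤ, (algebraMap ℤ (Matrix ι ι ℤ) r) *ᵥ v = r • v := fun v => by
      rw [Algebra.algebraMap_eq_smul_one, Matrix.smul_mulVec, Matrix.one_mulVec]
    refine ⟨fun v hv => ?_, algebraMap ℤ (anemicHeckeRing N k) r, fun v hv => ?_⟩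
    · rw [hr]
      simp only [Pi.smul_apply, smul_eq_mul, ← Finset.mul_sum, hv, mul_zero]
    · rw [hr, hsmul r v hv, Subalgebra.coe_algebraMap, eq_intCast, Module.End.intCast_apply,
        Int.cast_smul_eq_zsmul]
  | add X Y hX hY ihX ihY =>
    obtain ⟨hdX, tX, htX⟩ := ihX
    obtain ⟨hdY, tY, htY⟩ := ihY
    refine ⟨fun v hv => ?_, tX + tY, fun v hv => ?_⟩
    · rw [Matrix.add_mulVec, Finset.sum_congr rfl fun c _ => Pi.add_apply _ _ c,
        Finset.sum_add_distrib, hdX v hv, hdY v hv, add_zero]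
    · rw [Matrix.add_mulVec, hadd _ _ (hdX v hv) (hdY v hv), ← htX v hv, ← htY v hv,
        Subalgebra.coe_add, LinearMap.add_apply]
  | mul X Y hX hY ihX ihY =>
    obtain ⟨hdX, tX, htX⟩ := ihX
    obtain ⟨hdY, tY, htY⟩ := ihY
    refine ⟨fun v hv => ?_, tX * tY, fun v hv => ?_⟩
    · rw [← Matrix.mulVec_mulVec]
      exact hdX _ (hdY v hv)
    · rw [← Matrix.mulVec_mulVec, ← htX _ (hdY v hv), ← htY v hv, Subalgebra.coe_mul,
        Module.End.mul_apply]

/-- **(O) orthogonality template (S): `z ⊥_w φ ⟹ Θ z ⊥ f`.**  With the projector identity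
`ξ M_{cd} = D w_d φ_d φ_c` (`Brandt.exists_heckeProjector`, verbatim), `ξ = Σ w |φ|²`, a transported
`t ∈ 𝕋` for `M` (H4b′) and self-adjointness (H4a′): `M z = 0` and `M φ = D φ` (divide by `ξ ≠ 0`),
so `t (Θ φ) = D • Θ φ`, i.e. `t f = D f` (`m ≠ 0`), and
`D ⟨f, Θ z⟩ = ⟨t f, Θ z⟩ = ⟨f, t (Θ z)⟩ = ⟨f, Θ (M z)⟩ = ⟨f, Θ 0⟩ = 0`. -/
theorem peterssonProduct_transfer_eq_zero {ι : Type*} [Fintype ι] [DecidableEq ι] {N : ℕ}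
    [NeZero N] {k : ℤ} (w : ι → ℕ) (φ : ι → ℤ) {ξ D : ℕ} (hξ : ξ ≠ 0) (hD : 0 < D)
    (hξw : ξ = ∑ c, w c * (φ c).natAbs ^ 2) {M : Matrix ι ι ℤ}
    (hproj : ∀ c d : ι, (ξ : ℤ) * M c d = (D : ℤ) * (w d : ℤ) * φ d * φ c)
    {f : CuspForm (Gamma0 N) k} (Θ : (ι → ℤ) → CuspForm (Gamma0 N) k)
    (hsmul : ∀ (a : ℤ) (v : ι → ℤ), ∑ c, v c = 0 → Θ (a • v) = (a : ℂ) • Θ v)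
    {t : anemicHeckeRing N k}
    (ht : ∀ v : ι → ℤ, ∑ c, v c = 0 → (t : Module.End ℂ (CuspForm (Gamma0 N) k)) (Θ v) = Θ (M *ᵥ v))
    (hsymm : ∀ g g' : CuspForm (Gamma0 N) k,
      peterssonProduct (Gamma0 N) k ((t : Module.End ℂ (CuspForm (Gamma0 N) k)) g) g' =
        peterssonProduct (Gamma0 N) k g ((t : Module.End ℂ (CuspForm (Gamma0 N) k)) g'))
    (hφ : ∑ c, φ c = 0) {m : ℤ} (hm : m ≠ 0) (hφf : Θ φ = (m : ℂ) • f)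
    {z : ι → ℤ} (hz : ∑ c, z c = 0) (hzorth : ∑ c, (w c : ℤ) * φ c * z c = 0) :
    peterssonProduct (Gamma0 N) k f (Θ z) = 0 := by
  have hξ0 : (ξ : ℤ) ≠ 0 := by exact_mod_cast hξ
  -- `ξ = Σ w φ²` over `ℤ`
  have hξw' : (ξ : ℤ) = ∑ c, (w c : ℤ) * φ c * φ c := by
    rw [hξw]
    push_cast
    refine Finset.sum_congr rfl fun c _ => ?_
    rw [sq_abs]
    ring
  -- `M z = 0` and `M φ = D φ`
  have hMz : M *ᵥ z = 0 := by
    funext c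
    have h1 : (ξ : ℤ) * (M *ᵥ z) c = 0 := by
      simp only [Matrix.mulVec, dotProduct, Finset.mul_sum]
      have hc : ∀ d, (ξ : ℤ) * (M c d * z d) = (D : ℤ) * φ c * ((w d : ℤ) * φ d * z d) := by
        intro d
        rw [← mul_assoc, hproj]
        ring
      simp_rw [hc, ← Finset.mul_sum, hzorth, mul_zero]
    exact (mul_eq_zero.mp h1).resolve_left hξ0
  have hMφ : M *ᵥ φ = (D : ℤ) • φ := by
    funext c
    have h1 : (ξ : ℤ) * (M *ᵥ φ) c = (ξ : ℤ) * ((D : ℤ) * φ c) := by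
      simp only [Matrix.mulVec, dotProduct, Finset.mul_sum]
      have hc : ∀ d, (ξ : ℤ) * (M c d * φ d) = (D : ℤ) * φ c * ((w d : ℤ) * φ d * φ d) := by
        intro d
        rw [← mul_assoc, hproj]
        ring
      simp_rw [hc, ← Finset.mul_sum, ← hξw']
      ring
    rw [Pi.smul_apply, smul_eq_mul]
    exact mul_left_cancel₀ hξ0 h1
  -- `t f = D f`
  have htφ : (t : Module.End ℂ (CuspForm (Gamma0 N) k)) (Θ φ) = (D : ℂ) • Θ φ := by
    rw [ht φ hφ, hMφ, hsmul _ _ hφ]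
    push_cast
    rfl
  have hm0 : (m : ℂ) ≠ 0 := by exact_mod_cast hm
  have htf : (t : Module.End ℂ (CuspForm (Gamma0 N) k)) f = (D : ℂ) • f := by
    have h1 : (m : ℂ) • (t : Module.End ℂ (CuspForm (Gamma0 N) k)) f = (m : ℂ) • ((D : ℂ) • f) := by
      rw [← map_smul, ← hφf, htφ, hφf, smul_comm]
    exact smul_right_injective _ hm0 h1
  -- `t (Θ z) = 0`
  have hΘ0 : Θ 0 = 0 := by
    have h0 := hsmul 0 z hz
    rw [zero_smul, Int.cast_zero, zero_smul] at h0
    exact h0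
  have htz : (t : Module.End ℂ (CuspForm (Gamma0 N) k)) (Θ z) = 0 := by
    rw [ht z hz, hMz, hΘ0]
  -- `D ⟨f, Θ z⟩ = ⟨D f, Θ z⟩ = ⟨t f, Θ z⟩ = ⟨f, t Θ z⟩ = 0`
  have key : (starRingEnd ℂ) (D : ℂ) * peterssonProduct (Gamma0 N) k f (Θ z) = 0 := by
    rw [← peterssonProduct_smul_left, ← htf, hsymm, htz, peterssonProduct_zero_right]
  have hD0 : (starRingEnd ℂ) (D : ℂ) ≠ 0 := by
    rw [Complex.conj_natCast]
    exact_mod_cast hD.ne'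
  exact (mul_eq_zero.mp key).resolve_left hD0

end KernelK2G4

/-! ## §5c the four templates ARE k2's theorems (bridging, PROVED) -/

theorem kernelT_holds : KernelT :=
  fun _ _ _ _ _ w φ _ hξ hξw hφ _ hf hfI Θ hadd hsmul hint _ hφf horth _ hy =>
    KernelK2G4.dvd_natAbs_mul_congruenceNumber_of_transfer w φ hξ hξw hφ hf hfI Θ hadd hsmul hint
      hφf horth hy

theorem selfAdjH4a_holds : SelfAdjH4a :=
  fun _ _ _ t f g => KernelK2G4.peterssonProduct_anemicHecke_symm t f g

theorem transportH4b_holds : TransportH4b :=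
  fun _ _ _ _ _ _ T Θ hdeg hadd hsmul hequiv _ hM =>
    KernelK2G4.exists_anemicHecke_transport T Θ hdeg hadd hsmul hequiv hM

theorem orthO_holds : OrthO :=
  fun _ _ _ _ _ _ w φ _ _ hξ hD hξw _ hproj _ Θ hsmul _ ht hsymm hφ _ hm hφf _ hz hzorth =>
    KernelK2G4.peterssonProduct_transfer_eq_zero w φ hξ hD hξw hproj Θ hsmul ht hsymm hφ hm hφf hz
      hzorth

/-! ## §6 K5 — the composition into k3's `XiCoreDivisibility` (the interface test) -/

/-- k3 `ProbeExtremesG4.XiCoreDivisibility`, VERBATIM. -/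
def XiCoreDivisibility : Prop :=
  ∀ (Nplus Nminus M : ℕ) [NeZero M], Nplus * Nminus = M →
    ∀ (S : XiSetup Nplus Nminus) [Fintype (ClassSet S.O)] (W : WeierstrassCurve ℚ) [W.IsElliptic]
      (f : CuspForm (Gamma0 M) 2), IsNewformOf W f →
    ∀ (φ : ClassSet S.O → ℤ), φ ≠ 0 →
      eigenLattice (Nplus * Nminus) (matrix S.O) (fun n => W.LFunction n) = ℤ ∙ φ →
    ∀ (i : ClassSet S.O) (y : ClassSet S.O → ℤ), ∑ c, y c = 0 →
      (S.xi fun n => W.LFunction n) ∣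
        (2 * (weight S.O i : ℤ) * φ i * ∑ c, (weight S.O c : ℤ) * φ c * y c).natAbs *
          congruenceNumber f

/-- **K5 (S · assembly of the theta side, PROVED modulo K2d–K2f, K3).**
`H1 → (T) → H4a′ → H4b′ → (O) → XiCoreDivisibility`.  ORDER: `subst` the level; `φ ∈ L`, `deg φ = 0`
(`XiSetup.sum_eq_zero_of_eigenLattice_lFunction_eq_span`); `ξ = Σ w φ²` (`XiSetup.xi`, `xiOfOrder_eq`,
`xi_eq_sum`) hence `ξ ≠ 0` (`one_le_weight`, `φ ≠ 0`); `f ≠ 0`, `f` integral (`IsNewformOf`); row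
`φ_i = 0` vacuous; `m := 2 w_i φ_i ≠ 0`; H3; the ABSTRACT projector `Brandt.exists_heckeProjector`
(anemic `adjoin`, as H4b′ wants); transport `t` (H4b′ with K2b/K2c/K2f/K2g); (O) with H4a′; (T). -/
theorem xiCoreDivisibility_of_thetaSide (hΘ : H1) (hT : KernelT) (h4a : SelfAdjH4a)
    (h4b : TransportH4b) (hO : OrthO) : XiCoreDivisibility := by
  classical
  intro Nplus Nminus M _ hM S _ W _ f hf φ hφ0 hL i y hy
  subst hM
  -- the eigenvector: in the lattice, degree zero
  have hφL : φ ∈ eigenLattice (Nplus * Nminus) (matrix S.O) (fun n => W.LFunction n) := by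
    rw [hL]; exact Submodule.mem_span_singleton_self φ
  have hφdeg : ∑ c, φ c = 0 := S.sum_eq_zero_of_eigenLattice_lFunction_eq_span W hL
  -- ξ = Σ w φ² ≠ 0
  have hξw : (S.xi fun n => W.LFunction n) = ∑ c, weight S.O c * (φ c).natAbs ^ 2 := by
    rw [XiSetup.xi, xiOfOrder_eq]
    exact xi_eq_sum _ hφ0 hL
  have hξ : (S.xi fun n => W.LFunction n) ≠ 0 := by
    rw [hξw]
    obtain ⟨c, hc⟩ := Function.ne_iff.mp hφ0
    have hpos : 0 < weight S.O c * (φ c).natAbs ^ 2 :=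
      Nat.mul_pos (S.one_le_weight c) (pow_pos (Int.natAbs_pos.mpr hc) 2)
    have hle : weight S.O c * (φ c).natAbs ^ 2 ≤ ∑ c, weight S.O c * (φ c).natAbs ^ 2 :=
      Finset.single_le_sum (f := fun c => weight S.O c * (φ c).natAbs ^ 2)
        (fun _ _ => Nat.zero_le _) (Finset.mem_univ c)
    exact (lt_of_lt_of_le hpos hle).ne'
  -- the newform: nonzero, integral
  have hf0 : f ≠ 0 := IsNormalized.ne_zero_gamma0 hf.1.2.2
  have hfI : f ∈ integralCuspForms0 (Nplus * Nminus) 2 := fun n => ⟨W.LFunction n, (hf.2 n).symm⟩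
  -- the vacuous row
  by_cases hφi : φ i = 0
  · rw [hφi, mul_zero, zero_mul, Int.natAbs_zero, zero_mul]
    exact dvd_zero _
  have hwi : (weight S.O i : ℤ) ≠ 0 := by
    have := S.one_le_weight i
    exact_mod_cast (by omega : weight S.O i ≠ 0)
  have hm : (2 * (weight S.O i : ℤ) * φ i) ≠ 0 := mul_ne_zero (mul_ne_zero two_ne_zero hwi) hφi
  -- H3
  have hφf := thetaLift_eq_smul_of_isNewformOf hΘ S i W hf hφL
  -- the integral Hecke projector, in the ANEMIC Hecke algebra
  obtain ⟨D, hD, Mx, hMx, hproj⟩ := Brandt.exists_heckeProjector (weight S.O)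
    (fun c => S.one_le_weight c) (Nplus * Nminus) (matrix S.O)
    (fun p _ _ c d => S.weight_mul_matrix_symm p c d) (fun n => W.LFunction n) hφ0 hL
  have hproj' : ∀ c d : ClassSet S.O, ((S.xi fun n => W.LFunction n : ℕ) : ℤ) * Mx c d =
      (D : ℤ) * (weight S.O d : ℤ) * φ d * φ c := by
    intro c d
    rw [XiSetup.xi, xiOfOrder_eq]
    exact hproj c d
  -- transport of the projector to `𝕋`
  obtain ⟨t, ht⟩ := h4b (ClassSet S.O) (Nplus * Nminus) 2 (matrix S.O) (thetaLift hΘ S i)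
    (fun p hp hpN v hv => sum_matrix_mulVec_eq_zero S hp hpN hv)
    (thetaLift_add hΘ S i) (thetaLift_smul hΘ S i)
    (fun p hp hpN v hv => heckeT_thetaLift hΘ S i hp hpN hv) Mx hMx
  -- orthogonality
  have horth : ∀ z : ClassSet S.O → ℤ, ∑ c, z c = 0 →
      ∑ c, (weight S.O c : ℤ) * φ c * z c = 0 →
      peterssonProduct (Gamma0 (Nplus * Nminus)) 2 f (thetaLift hΘ S i z) = 0 :=
    fun z hz hzo => hO (ClassSet S.O) (Nplus * Nminus) 2 (weight S.O) φ _ D hξ hD hξw Mx hproj' f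
      (thetaLift hΘ S i) (thetaLift_smul hΘ S i) t ht (h4a _ 2 t) hφdeg _ hm hφf z hz hzo
  -- the kernel
  exact hT (ClassSet S.O) (Nplus * Nminus) 2 (weight S.O) φ _ hξ hξw hφdeg f hf0 hfI
    (thetaLift hΘ S i) (thetaLift_add hΘ S i) (thetaLift_smul hΘ S i)
    (fun v hv => thetaLift_mem_integralCuspForms0 hΘ S i hv) _ hφf horth y hy

/-- **THE THETA SIDE IS CLOSED: `H1 → XiCoreDivisibility`** (k1 gen 9 H1 ⊕ k1 gen 10 theta package ⊕
k2 gen 4 kernel), kernel-checked in this file with H1 the only hypothesis — and H1 is PROVED in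
`STUB_IDEAS_stub_xiDegreeComparison_1_g9_H1complete.lean` (`StubIdeasK1G9.thetaTransfer_H1`, 0 sorries). -/
theorem xiCoreDivisibility_of_H1 (hΘ : H1) : XiCoreDivisibility :=
  xiCoreDivisibility_of_thetaSide hΘ kernelT_holds selfAdjH4a_holds transportH4b_holds orthO_holds

/-! ## §7 The last arrow (k3 `ProbeExtremesG4.stub_xiDegreeComparison_of_core`, L7):
`stub_xiDegreeComparison ⟸ XiCoreDivisibility ∧ ARS 2.1(b) ∧ FreyModularity`; so the stub's trust base
after gen 10 is exactly {`padicValNat_congruenceNumber_eq_of_not_sq_dvd` (named fact, ARS 2012 Thm 2.1(b)),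
`Summit.ABC.ABC.Theses.DefiniteXi.FreyModularity` (route item stmt-ABC-11340)} plus ONLY k3's gen-4
S/XS sorries L3 (least prime `ℓ ∤ N` is `≤ C_ε N^ε`), L5 (`cps` bookkeeping), L6 (ARS (b) at the optimal
datum), L7 (assembly) — `XiCoreDivisibility` itself is now a theorem (`xiCoreDivisibility_of_H1` here +
`StubIdeasK1G9.thetaTransfer_H1`; single-file certificate `…_1_g10_XiCoreComplete.lean`). -/

end Summit.ABC.ABC.Cruxes.SteinbergCore.StubIdeasK1G10

end

-- ======================= PART C =======================
namespace Summit.ABC.ABC.Cruxes.SteinbergCore.StubIdeasK1G10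

/-- **`XiCoreDivisibility` holds unconditionally** (k3 gen-4 `ProbeExtremesG4.XiCoreDivisibility`,
verbatim): in a definite `XiSetup` of level `(N⁺, N⁻)`, for the newform `f` on `Γ₀(N⁺N⁻)` of an elliptic
curve `W` whose Brandt eigenlattice is `ℤφ`, every class `i` and every degree-zero integer vector `y`,
`ξ ∣ |2 w_i φ_i · Σ_c w_c φ_c y_c| · congruenceNumber f`. -/
theorem xiCoreDivisibility : XiCoreDivisibility :=
  xiCoreDivisibility_of_H1 StubIdeasK1G9.thetaTransfer_H1

end Summit.ABC.ABC.Cruxes.SteinbergCore.StubIdeasK1G10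


-- ======================= PART II : gen-11 tail (verbatim body of the g11 Sketch) =======================

/-!
# Sketch (stub-ideation k=1 · GEN 11 · FAMILY 1 RECOGNISE & IMPORT) for `stub_xiDegreeComparison`
# of crux `SteinbergCore` (stmt-ABC-15024, route-ABC-DefiniteXi, line `Lines/p6_tamagawa_split.lean`)

Companion to `STUB-IDEAS-stub_xiDegreeComparison-1.md` (gen 11).

STATE.  The Brandt/Eichler CORE of the stub is a theorem of the crux dir:
`StubIdeasK1G10.xiCoreDivisibility : XiCoreDivisibility` (`…_1_g10_XiCoreComplete.lean`, 0 sorries).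
What the registered stub still needs is k3's TAIL L3/L5/L6/L7, whose ONLY non-tree inputs are
ARS 2.1(b) (`padicValNat_congruenceNumber_eq_of_not_sq_dvd`, unproved named fact) and the route item
`FreyModularity` — both foreign to the theta-transfer mechanism: they enter solely because the stub is
typed with `cps(deg D)`, `D` minimal, while the mechanism lands on the CONGRUENCE NUMBER `r_f`.

THIS FILE (gen 11) types the import in the currency the mechanism actually produces:

§0  `XiCoreDivisibility` (k3 g4 def, verbatim; PROVED g10).
§1  The facts-free CONGRUENCE FORM of child 1:
    `XiCongruenceComparison` := `ξ ≠ 0 → ∀ f newform of E_(a,b) at level N, cps ξ ≤ C_ε N^ε · cps(r_f)`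
    and its derivation from the core: `xiCongruenceComparison_of_core` — tree lemmas only
    (L1–L2–L4 copied from k3 g4, PROVED; L3 least good prime; L5 `cps` bookkeeping; generator/guard helpers).
§2  The matching atom in the same currency: `CongruenceNumberBound` (= k2-g5 `StubIdeas2G5.CpsCongruenceBound`
    with `cps` unfolded: `cps(r_f) ≤ C_ε N^(2+ε)` for the Frey newform) and the RE-CUT GLUE
    `steinbergCore_of_congruenceSplit : XiCongruenceComparison → CongruenceNumberBound → AbcValuationProduct →
    FreyModularity → SteinbergCore` (PROVED, pure exponent algebra; stub 3 converted by the landed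
    `stub_allTamExp_of_valuationProduct`).  No ARS, no minimality, no `T³`, no Takahashi/JL/Mazur–Kenku.
§3  Back to the REGISTERED stub (Plan A): `stub_of_xiCongruenceComparison :
    XiCongruenceComparison → padicValNat_congruenceNumber_eq_of_not_sq_dvd → FreyModularity → ⟨stub verbatim⟩`
    via L6′ `primeToSix_congruenceNumber_le_primeToSix_deg` (ARS (b) at the lattice-optimal datum, `p ≥ 5`).
-/

set_option linter.dupNamespace false
set_option autoImplicit false

noncomputable section

namespace Summit.ABC.ABC.Cruxes.SteinbergCore.StubIdeasK1G11

open scoped MatrixGroups ModularForm Matrix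
open CongruenceSubgroup
open Literature.NumberTheory.EllipticCurves Literature.NumberTheory.EllipticCurves.ModularForms
open Literature.NumberTheory.Automorphic Literature.NumberTheory.Automorphic.Brandt

/-! ## §0  The core (k3 g4 def verbatim; PROVED by `StubIdeasK1G10.xiCoreDivisibility`) -/

/-- **Core divisibility** (k3 gen-4 `ProbeExtremesG4.XiCoreDivisibility`, verbatim): in a definite
`XiSetup` of level `(N⁺, N⁻)`, for the newform `f` on `Γ₀(N⁺N⁻)` of an elliptic curve `W` whose Brandt
eigenlattice is the line `ℤφ`, every class `i` and every degree-zero `y`: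
`ξ ∣ |2 w_i φ_i · ⟨φ, y⟩_w| · r_f`.  PROVED (crux dir `STUB_IDEAS_stub_xiDegreeComparison_1_g10_XiCoreComplete.lean`,
`StubIdeasK1G10.xiCoreDivisibility`, 0 sorries) — a hypothesis `hX` below only because crux workfiles are not importable. -/
def XiCoreDivisibility : Prop :=
  ∀ (Nplus Nminus M : ℕ) [NeZero M], Nplus * Nminus = M →
    ∀ (S : XiSetup Nplus Nminus) [Fintype (ClassSet S.O)] (W : WeierstrassCurve ℚ) [W.IsElliptic]
      (f : CuspForm (Gamma0 M) 2), IsNewformOf W f →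
    ∀ (φ : ClassSet S.O → ℤ), φ ≠ 0 →
      eigenLattice (Nplus * Nminus) (matrix S.O) (fun n => W.LFunction n) = ℤ ∙ φ →
    ∀ (i : ClassSet S.O) (y : ClassSet S.O → ℤ), ∑ c, y c = 0 →
      (S.xi fun n => W.LFunction n) ∣
        (2 * (weight S.O i : ℤ) * φ i * ∑ c, (weight S.O c : ℤ) * φ c * y c).natAbs *
          congruenceNumber f

/-! ## §1a  k3 g4 L1/L1′/L1″/L4/L2 — copied verbatim (PROVED there and here) -/

theorem dvd_sub_of_forall_dvd_weight_mul_sub_of_isCoprime {ι : Type*} [Fintype ι] {R : Type*}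
    [CommRing R] (T : Matrix ι ι R) (w : ι → R) {lam s : R} {v : ι → R}
    (hsymm : ∀ i j, w i * T i j = w j * T j i) (hcol : ∀ j, ∑ i, T i j = s)
    (hv : T *ᵥ v = lam • v) {m : R} {i₀ : ι} (h0 : IsCoprime m (w i₀ * v i₀))
    (hcong : ∀ i j, m ∣ w i * v i - w j * v j) : m ∣ lam - s := by
  have heig := sum_mul_weight_mul_eq_of_mulVec_eq_smul T w hsymm hv i₀
  have key : (lam - s) * (w i₀ * v i₀) = ∑ i, T i i₀ * (w i * v i - w i₀ * v i₀) := by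
    have h1 : ∑ i, T i i₀ * (w i * v i - w i₀ * v i₀) =
        ∑ i, T i i₀ * (w i * v i) - (∑ i, T i i₀) * (w i₀ * v i₀) := by
      rw [Finset.sum_mul, ← Finset.sum_sub_distrib]
      exact Finset.sum_congr rfl fun i _ => by ring
    rw [h1, heig, hcol i₀]
    ring
  have hdvd : m ∣ (lam - s) * (w i₀ * v i₀) := by
    rw [key]
    exact Finset.dvd_sum fun i _ => Dvd.dvd.mul_left (hcong i i₀) _
  exact h0.dvd_of_dvd_mul_right hdvd

variable {Nplus Nminus : ℕ}

theorem XiSetup.dvd_sub_prime_add_one_of_forall_dvd_of_isCoprime (S : XiSetup Nplus Nminus)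
    [Fintype (ClassSet S.O)] {lam : ℕ → ℤ} {v : ClassSet S.O → ℤ}
    (hv : v ∈ eigenLattice (Nplus * Nminus) (matrix S.O) lam) {m : ℤ} {c₀ : ClassSet S.O}
    (hm : IsCoprime m ((weight S.O c₀ : ℤ) * v c₀))
    (hcong : ∀ c c', m ∣ (weight S.O c : ℤ) * v c - (weight S.O c' : ℤ) * v c')
    {ℓ : ℕ} (hℓ : ℓ.Prime) (hℓN : ¬ ℓ ∣ Nplus * Nminus) :
    m ∣ lam ℓ - (ℓ + 1) :=
  dvd_sub_of_forall_dvd_weight_mul_sub_of_isCoprime (matrix S.O ℓ) (fun c => (weight S.O c : ℤ))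
    (fun i j => S.weight_mul_matrix_symm ℓ i j) (fun j => S.sum_matrix_prime_eq hℓ hℓN j)
    (hv ℓ hℓ hℓN) hm hcong

theorem XiSetup.exists_not_pow_dvd_weight_mul_sub (S : XiSetup Nplus Nminus)
    [Fintype (ClassSet S.O)] {lam : ℕ → ℤ} {v : ClassSet S.O → ℤ}
    (hv : v ∈ eigenLattice (Nplus * Nminus) (matrix S.O) lam) {p : ℕ} (hp : p.Prime)
    (h5 : 5 ≤ p) {c₀ : ClassSet S.O} (hv0 : ¬ (p : ℤ) ∣ v c₀)
    {ℓ : ℕ} (hℓ : ℓ.Prime) (hℓN : ¬ ℓ ∣ Nplus * Nminus) {e : ℕ}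
    (hne : ¬ (p : ℤ) ^ (e + 1) ∣ lam ℓ - (ℓ + 1)) :
    ∃ c c' : ClassSet S.O,
      ¬ (p : ℤ) ^ (e + 1) ∣ (weight S.O c : ℤ) * v c - (weight S.O c' : ℤ) * v c' := by
  by_contra h
  push Not at h
  have hpZ : Prime (p : ℤ) := Nat.prime_iff_prime_int.mp hp
  have hw0 : ¬ (p : ℤ) ∣ (weight S.O c₀ : ℤ) * v c₀ := by
    intro hd
    rcases hpZ.dvd_or_dvd hd with h1 | h1
    · exact S.not_dvd_weight c₀ hp h5 (Int.natCast_dvd_natCast.mp h1)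
    · exact hv0 h1
  have hcop : IsCoprime ((p : ℤ) ^ (e + 1)) ((weight S.O c₀ : ℤ) * v c₀) :=
    ((Prime.coprime_iff_not_dvd hpZ).mpr hw0).pow_left
  exact hne (XiSetup.dvd_sub_prime_add_one_of_forall_dvd_of_isCoprime S hv hcop h hℓ hℓN)

/-- L4 (PROVED): `|a_ℓ(W) − (ℓ+1)| ≤ 4ℓ`. -/
theorem natAbs_lFunction_sub_le (W : WeierstrassCurve ℚ) [W.IsElliptic] {ℓ : ℕ} (hℓ : ℓ.Prime) :
    (((W.LFunction ℓ - (ℓ + 1)).natAbs : ℕ) : ℝ) ≤ 4 * ℓ := by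
  have hb := W.abs_LFunction_prime_pow_le hℓ 1
  rw [pow_one, pow_one] at hb
  have hle : |(W.LFunction ℓ : ℝ)| ≤ 2 * Real.sqrt ℓ := by norm_num at hb ⊢; exact hb
  have hℓ1 : (1 : ℝ) ≤ ℓ := by exact_mod_cast hℓ.one_lt.le
  have hsq : Real.sqrt ℓ ≤ ℓ := by
    calc Real.sqrt ℓ ≤ Real.sqrt ((ℓ : ℝ) ^ 2) := Real.sqrt_le_sqrt (by nlinarith)
      _ = ℓ := Real.sqrt_sq (by positivity)
  rw [Nat.cast_natAbs, Int.cast_abs]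
  push_cast
  calc |(W.LFunction ℓ : ℝ) - (ℓ + 1)| ≤ |(W.LFunction ℓ : ℝ)| + |((ℓ : ℝ) + 1)| := abs_sub _ _
    _ ≤ 2 * Real.sqrt ℓ + (ℓ + 1) := by
        rw [abs_of_nonneg (by positivity : (0 : ℝ) ≤ (ℓ : ℝ) + 1)]; linarith
    _ ≤ 4 * ℓ := by nlinarith

theorem natAbs_lFunction_sub_ne_zero (W : WeierstrassCurve ℚ) [W.IsElliptic] {ℓ : ℕ}
    (hℓ : ℓ.Prime) : (W.LFunction ℓ - (ℓ + 1)).natAbs ≠ 0 := by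
  rw [ne_eq, Int.natAbs_eq_zero, sub_eq_zero]
  exact W.lFunction_ne_prime_add_one hℓ

/-- L2 (PROVED, k3 g4): core divisibility ⟹ `v_p x ≤ v_p r + v_p |a_ℓ(W) − (ℓ+1)|` (`p ≥ 5`, `ℓ ∤ N⁺N⁻`). -/
theorem factorization_le_of_core (S : XiSetup Nplus Nminus) [Fintype (ClassSet S.O)]
    [DecidableEq (ClassSet S.O)] (W : WeierstrassCurve ℚ) [W.IsElliptic]
    {φ : ClassSet S.O → ℤ} (hφ0 : φ ≠ 0)
    (hL : eigenLattice (Nplus * Nminus) (matrix S.O) (fun n => W.LFunction n) = ℤ ∙ φ)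
    {x r : ℕ} (hr : r ≠ 0)
    (hcore : ∀ (i : ClassSet S.O) (y : ClassSet S.O → ℤ), ∑ c, y c = 0 →
      x ∣ (2 * (weight S.O i : ℤ) * φ i * ∑ c, (weight S.O c : ℤ) * φ c * y c).natAbs * r)
    {p : ℕ} (hp : p.Prime) (h5 : 5 ≤ p) {ℓ : ℕ} (hℓ : ℓ.Prime) (hℓN : ¬ ℓ ∣ Nplus * Nminus) :
    x.factorization p ≤ r.factorization p + (W.LFunction ℓ - (ℓ + 1)).natAbs.factorization p := by
  have hpZ : Prime (p : ℤ) := Nat.prime_iff_prime_int.mp hp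
  have hE0 : (W.LFunction ℓ - (ℓ + 1)).natAbs ≠ 0 := natAbs_lFunction_sub_ne_zero W hℓ
  have hne : ¬ (p : ℤ) ^ ((W.LFunction ℓ - (ℓ + 1)).natAbs.factorization p + 1) ∣
      W.LFunction ℓ - (ℓ + 1) := by
    intro hd
    have hd' : p ^ ((W.LFunction ℓ - (ℓ + 1)).natAbs.factorization p + 1) ∣
        (W.LFunction ℓ - (ℓ + 1)).natAbs := Int.natCast_dvd.mp (by exact_mod_cast hd)
    exact Nat.pow_succ_factorization_not_dvd hE0 hp hd'
  obtain ⟨c₀, hc₀⟩ := exists_not_dvd_of_eigenLattice_eq_span hφ0 hL hp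
  have hφL : φ ∈ eigenLattice (Nplus * Nminus) (matrix S.O) (fun n => W.LFunction n) :=
    hL ▸ Submodule.mem_span_singleton_self φ
  obtain ⟨c, d, hcd⟩ := XiSetup.exists_not_pow_dvd_weight_mul_sub S hφL hp h5 hc₀ hℓ hℓN hne
  set δ : ℤ := (weight S.O c : ℤ) * φ c - (weight S.O d : ℤ) * φ d with hδ
  have hδ0 : δ ≠ 0 := by
    intro h; apply hcd; rw [h]; exact dvd_zero _
  have hδe : δ.natAbs.factorization p ≤ (W.LFunction ℓ - (ℓ + 1)).natAbs.factorization p := by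
    by_contra hlt
    push Not at hlt
    apply hcd
    have h1 : p ^ ((W.LFunction ℓ - (ℓ + 1)).natAbs.factorization p + 1) ∣ δ.natAbs :=
      (hp.pow_dvd_iff_le_factorization (Int.natAbs_ne_zero.mpr hδ0)).mpr hlt
    exact_mod_cast Int.natCast_dvd.mpr h1
  set y : ClassSet S.O → ℤ := Pi.single c 1 - Pi.single d 1 with hy
  have hy0 : ∑ i, y i = 0 := by
    simp only [hy, Pi.sub_apply, Pi.single_apply, Finset.sum_sub_distrib, Finset.sum_ite_eq',
      Finset.mem_univ, if_true, sub_self]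
  have hpair : ∑ i, (weight S.O i : ℤ) * φ i * y i = δ := by
    simp only [hy, hδ, Pi.sub_apply, Pi.single_apply, mul_sub, mul_ite, mul_one, mul_zero,
      Finset.sum_sub_distrib, Finset.sum_ite_eq', Finset.mem_univ, if_true]
  have hdiv := hcore c₀ y hy0
  rw [hpair, Int.natAbs_mul, mul_assoc] at hdiv
  have hA : ¬ p ∣ (2 * (weight S.O c₀ : ℤ) * φ c₀).natAbs := by
    intro hd
    have hd' : (p : ℤ) ∣ 2 * (weight S.O c₀ : ℤ) * φ c₀ := Int.natCast_dvd.mpr hd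
    rcases hpZ.dvd_or_dvd hd' with h2 | h2
    · rcases hpZ.dvd_or_dvd h2 with h3 | h3
      · have h4 : p ∣ 2 := by exact_mod_cast h3
        have := Nat.le_of_dvd two_pos h4
        omega
      · exact S.not_dvd_weight c₀ hp h5 (Int.natCast_dvd_natCast.mp h3)
    · exact hc₀ h2
  have h1 : p ^ x.factorization p ∣ δ.natAbs * r :=
    (Nat.Coprime.pow_left _ ((Nat.Prime.coprime_iff_not_dvd hp).mpr hA)).dvd_of_dvd_mul_left
      ((Nat.ordProj_dvd x p).trans hdiv)
  have hδr : δ.natAbs * r ≠ 0 := mul_ne_zero (Int.natAbs_ne_zero.mpr hδ0) hr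
  have h2 := (hp.pow_dvd_iff_le_factorization hδr).mp h1
  rw [Nat.factorization_mul (Int.natAbs_ne_zero.mpr hδ0) hr, Finsupp.add_apply] at h2
  omega

/-! ## §1b  The small helpers of the tail (each ≤ one prover cycle) -/

/-- **L3 — the least good prime is `N^{o(1)}` (XS, PROVED; where `ε` is spent).**  Tree:
`ModularForms.exists_prime_not_dvd_le_log` (Chebyshev: `ℓ ∤ N`, `ℓ ≤ 2 log N + C`), then
`log N ≤ N^ε/ε` (`Real.log_le_sub_one_of_pos` at `N^ε`). -/
theorem exists_prime_not_dvd_le_rpow {ε : ℝ} (hε : 0 < ε) :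
    ∃ C : ℝ, 0 < C ∧ ∀ N : ℕ, 1 ≤ N → ∃ ℓ : ℕ, ℓ.Prime ∧ ¬ ℓ ∣ N ∧ (ℓ : ℝ) ≤ C * (N : ℝ) ^ ε := by
  obtain ⟨C, hC⟩ := exists_prime_not_dvd_le_log
  refine ⟨2 / ε + max C 0, by positivity, fun N hN => ?_⟩
  obtain ⟨ℓ, hℓ, hℓN, hle⟩ := hC N (by omega)
  refine ⟨ℓ, hℓ, hℓN, hle.trans ?_⟩
  have hNpos : (0 : ℝ) < (N : ℝ) := by exact_mod_cast hN
  have hN1 : (1 : ℝ) ≤ (N : ℝ) := by exact_mod_cast hN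
  have h1 : (1 : ℝ) ≤ (N : ℝ) ^ ε := Real.one_le_rpow hN1 hε.le
  have hlog : Real.log N ≤ (N : ℝ) ^ ε / ε := by
    have h2 : Real.log ((N : ℝ) ^ ε) ≤ (N : ℝ) ^ ε - 1 :=
      Real.log_le_sub_one_of_pos (Real.rpow_pos_of_pos hNpos ε)
    rw [Real.log_rpow hNpos] at h2
    rw [le_div_iff₀ hε]
    linarith
  have hC0 : C ≤ max C 0 * (N : ℝ) ^ ε :=
    (le_max_left C 0).trans (le_mul_of_one_le_right (le_max_right _ _) h1)
  calc 2 * Real.log N + C ≤ 2 * ((N : ℝ) ^ ε / ε) + max C 0 * (N : ℝ) ^ ε :=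
        add_le_add (mul_le_mul_of_nonneg_left hlog zero_le_two) hC0
    _ = (2 / ε + max C 0) * (N : ℝ) ^ ε := by ring

/-- `2^{v₂ n} 3^{v₃ n} ∣ n`. -/
theorem ordProj_two_mul_ordProj_three_dvd (n : ℕ) : ordProj[2] n * ordProj[3] n ∣ n :=
  Nat.Coprime.mul_dvd_of_dvd_of_dvd (Nat.Coprime.pow _ _ (by norm_num)) (Nat.ordProj_dvd n 2)
    (Nat.ordProj_dvd n 3)

theorem primeToSix_ne_zero {n : ℕ} (hn : n ≠ 0) : n / (ordProj[2] n * ordProj[3] n) ≠ 0 :=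
  (Nat.div_pos (Nat.le_of_dvd (Nat.pos_of_ne_zero hn) (ordProj_two_mul_ordProj_three_dvd n))
    (Nat.pos_of_ne_zero (mul_ne_zero (pow_ne_zero _ two_ne_zero) (pow_ne_zero _ three_ne_zero)))).ne'

/-- The valuations of `cps n = n / (2^{v₂ n} 3^{v₃ n})`: `0` at `2, 3`, those of `n` elsewhere
(self-contained; cf. `SteinbergCore.Negative.primeToSix_eq_ordCompl`). -/
theorem factorization_primeToSix (n q : ℕ) :
    (n / (ordProj[2] n * ordProj[3] n)).factorization q =
      if q = 2 ∨ q = 3 then 0 else n.factorization q := by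
  rw [Nat.factorization_div (ordProj_two_mul_ordProj_three_dvd n), Finsupp.tsub_apply,
    Nat.factorization_mul (pow_ne_zero _ two_ne_zero) (pow_ne_zero _ three_ne_zero),
    Finsupp.add_apply, Nat.prime_two.factorization_pow, Nat.prime_three.factorization_pow,
    Finsupp.single_apply, Finsupp.single_apply]
  by_cases h2 : q = 2
  · subst h2; simp
  · by_cases h3 : q = 3
    · subst h3; simp
    · simp [h2, h3, Ne.symm h2, Ne.symm h3]

/-- **L5 — `cps` bookkeeping (XS, PROVED, self-contained).**  `v_p x ≤ v_p r + v_p e` for all primes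
`p ≥ 5` (`r, e ≠ 0`) gives `cps x ∣ cps r · e`, hence `cps x ≤ cps r · e`. -/
theorem primeToSix_le_mul_of_factorization_le {x r e : ℕ} (hr : r ≠ 0) (he : e ≠ 0)
    (h : ∀ p : ℕ, p.Prime → 5 ≤ p → x.factorization p ≤ r.factorization p + e.factorization p) :
    x / (ordProj[2] x * ordProj[3] x) ≤ r / (ordProj[2] r * ordProj[3] r) * e := by
  rcases eq_or_ne x 0 with rfl | hx
  · simp
  have hcx := primeToSix_ne_zero hx
  have hcre : r / (ordProj[2] r * ordProj[3] r) * e ≠ 0 := mul_ne_zero (primeToSix_ne_zero hr) he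
  refine Nat.le_of_dvd (Nat.pos_of_ne_zero hcre) ((Nat.factorization_le_iff_dvd hcx hcre).mp ?_)
  rw [Nat.factorization_mul (primeToSix_ne_zero hr) he]
  refine Finsupp.le_def.mpr fun q => ?_
  rw [Finsupp.add_apply, factorization_primeToSix, factorization_primeToSix]
  by_cases h23 : q = 2 ∨ q = 3
  · simp [h23]
  · rw [if_neg h23, if_neg h23]
    by_cases hq : q.Prime
    · have h4 : q ≠ 4 := by rintro rfl; exact absurd hq (by decide)
      have h2q := hq.two_le
      push Not at h23
      exact h q hq (by omega)
    · simp [Nat.factorization_eq_zero_of_not_prime _ hq]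

/-- **Generator helper (XS, PROVED).**  `brandtXi ≠ 0` ⟹ a setup `S` exists and, for any `Fintype`
structure on its class set, the eigen-lattice is a line `ℤφ` with `brandtXi = Σ_i w_i φ_i²`
(`XiSetup.brandtXi_eq_xi` — setup independence, PROVED in the tree; `xiOfOrder_eq`; `xi_eq_sum`;
contrapositive of `xi_of_not_isLine`; `brandtXi_of_isEmpty`). -/
theorem exists_generator_of_brandtXi_ne_zero {lam : ℕ → ℤ} (h : brandtXi Nplus Nminus lam ≠ 0) :
    ∃ S : XiSetup Nplus Nminus, ∀ [Fintype (ClassSet S.O)],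
      ∃ φ : ClassSet S.O → ℤ, φ ≠ 0 ∧ eigenLattice (Nplus * Nminus) (matrix S.O) lam = ℤ ∙ φ ∧
        brandtXi Nplus Nminus lam = ∑ i, weight S.O i * (φ i).natAbs ^ 2 := by
  by_cases hne : Nonempty (XiSetup Nplus Nminus)
  · obtain ⟨S⟩ := hne
    refine ⟨S, ?_⟩
    intro _inst
    have hxi : brandtXi Nplus Nminus lam =
        xi (weight S.O) (eigenLattice (Nplus * Nminus) (matrix S.O) lam) := by
      rw [S.brandtXi_eq_xi, XiSetup.xi, xiOfOrder_eq]
    by_cases hline : ∃ φ : ClassSet S.O → ℤ, φ ≠ 0 ∧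
        eigenLattice (Nplus * Nminus) (matrix S.O) lam = ℤ ∙ φ
    · obtain ⟨φ, hφ, hL⟩ := hline
      exact ⟨φ, hφ, hL, by rw [hxi, xi_eq_sum _ hφ hL]⟩
    · exact absurd (by rw [hxi]; exact xi_of_not_isLine _ hline) h
  · exact absurd (brandtXi_of_isEmpty (not_nonempty_iff.mp hne) lam) h

/-- **Guard (XS).**  The congruence number of the newform of an elliptic curve is `≠ 0`
(`r_f ∣ ∏_{P ≠ 𝕀_f} η_f(P) ≠ 0`, Pasten–Shimura §5.6; tree `congruenceNumber_dvd_prod_heckeCongruenceModulus`,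
`heckeCongruenceModulus_ne_zero` — the datum-free port of k2's `congruenceNumber_ne_zero`; the three inputs
`f ≠ 0`, `HasIntegralEigenvalues f`, `f ∈ S₂(Γ₀(N);ℤ)` are the proofs of `D.f_ne_zero`,
`D.hasIntegralEigenvalues_f`, `D.f_mem_integralCuspForms0` with `D.isNewformOf ↦ hf`). -/
theorem congruenceNumber_ne_zero_of_isNewformOf {N : ℕ} [NeZero N] {W : WeierstrassCurve ℚ}
    {f : CuspForm (Gamma0 N) 2} (hf : IsNewformOf W f) : congruenceNumber f ≠ 0 := by
  have hf0 : f ≠ 0 := by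
    intro h
    have h1 : (UpperHalfPlane.qExpansion 1 ⇑f).coeff 1 = 1 := hf.1.2.2
    rw [h, CuspForm.coe_zero, UpperHalfPlane.qExpansion_zero, map_zero] at h1
    exact zero_ne_one h1
  have hInt : HasIntegralEigenvalues f := by
    intro p hp _
    haveI : NeZero p := ⟨hp.ne_zero⟩
    obtain ⟨hnew, hcoeff⟩ := hf
    have heig := heckeT_eq_heckeEigenvalue_smul f p (hnew.2.1 p hp)
    have h1 := qExpansion_coeff_heckeT_holds N 2 f p hp 1
    have hcoe : ⇑(heckeT (Gamma0 N) 2 p f) = heckeEigenvalue f p • ⇑f := by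
      rw [heig]; rfl
    have hnorm : (UpperHalfPlane.qExpansion 1 ⇑f).coeff 1 = 1 := hnew.2.2
    rw [hcoe, ModularForm.qExpansion_smul one_pos (one_mem_strictPeriods_gamma0 N) _ f, map_smul,
      smul_eq_mul, hnorm, mul_one, mul_one, if_neg (Nat.Prime.not_dvd_one hp), mul_zero,
      ite_self, add_zero] at h1
    refine ⟨W.LFunction p, ?_⟩
    rw [heig, h1]
    exact congrArg (· • f) (hcoeff p)
  have hfL : f ∈ integralCuspForms0 N 2 := fun n ↦ ⟨W.LFunction n, (hf.2 n).symm⟩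
  intro h0
  have hdvd := congruenceNumber_dvd_prod_heckeCongruenceModulus hf.1 hInt hfL
  rw [h0, zero_dvd_iff, Finset.prod_eq_zero_iff] at hdvd
  obtain ⟨P, hP, hP0⟩ := hdvd
  exact heckeCongruenceModulus_ne_zero hInt hf0
    ((finite_minimalPrimes_anemicHeckeRing N 2).mem_toFinset.mp (Finset.mem_of_mem_erase hP))
    (Finset.ne_of_mem_erase hP) hP0

/-! ## §1c  CHILD 1 IN CONGRUENCE CURRENCY — facts-free -/

/-- **`XiCongruenceComparison` (child 1♮, the facts-free re-cut of `stub_xiDegreeComparison`).**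
For coprime `a, b` (`ab(a+b) ≠ 0`), `N = N(E_(a,b))`, admissible `Nm`, `ξ = ξ(E; N/Nm, Nm) ≠ 0` and EVERY
newform `f` of `E_(a,b)` at level `N`:  `cps ξ ≤ C_ε · N^ε · cps(r_f)`.
No datum, no minimality, no Tamagawa exponents, no ARS, no modularity (vacuous where no newform exists).
[mechanism: theta-lattice congruence transfer, k1/k2/k3 gens 3–10] -/
def XiCongruenceComparison : Prop :=
  ∀ ε : ℝ, 0 < ε → ∃ C : ℝ, ∀ a b : ℤ, IsCoprime a b → a * b * (a + b) ≠ 0 → ∀ (N : ℕ) [NeZero N],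
    (freyCurve a b).conductorNorm ℤ = N →
    ∀ Nm : ℕ, Odd Nm → Squarefree Nm → Odd Nm.primeFactors.card → Nm ∣ N →
    brandtXi (N / Nm) Nm (fun n => (freyCurve a b).LFunction n) ≠ 0 →
    ∀ f : CuspForm (Gamma0 N) 2, IsNewformOf (freyCurve a b) f →
      ((brandtXi (N / Nm) Nm (fun n => (freyCurve a b).LFunction n) /
          (ordProj[2] (brandtXi (N / Nm) Nm (fun n => (freyCurve a b).LFunction n)) *
            ordProj[3] (brandtXi (N / Nm) Nm (fun n => (freyCurve a b).LFunction n))) : ℕ) : ℝ) ≤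
        C * (N : ℝ) ^ ε *
          ((congruenceNumber f / (ordProj[2] (congruenceNumber f) * ordProj[3] (congruenceNumber f)) : ℕ) : ℝ)

/-- **L7♮ — child 1♮ from the core (S · assembly; NO named fact).**  `C := 4 C₃` (L3).  Given the data and
`ξ ≠ 0`: generator `φ` of the chosen setup `S` (`exists_generator_of_brandtXi_ne_zero`), `r_f ≠ 0` (guard),
`ℓ ∤ N = (N/Nm)·Nm` with `ℓ ≤ C₃ N^ε` (L3); L2 with `hcore := hX (N/Nm) Nm N _ S (freyCurve a b) f hf φ …`
(`S.xi = brandtXi` by `XiSetup.brandtXi_eq_xi`) gives `v_p ξ ≤ v_p r_f + v_p|a_ℓ − ℓ − 1|` for `p ≥ 5`;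
L5 + L4: `cps ξ ≤ cps r_f · |a_ℓ − ℓ − 1| ≤ cps r_f · 4ℓ ≤ 4 C₃ N^ε cps r_f`. -/
theorem xiCongruenceComparison_of_core (hX : XiCoreDivisibility) : XiCongruenceComparison := by
  intro ε hε
  obtain ⟨C₃, -, hC₃⟩ := exists_prime_not_dvd_le_rpow hε
  refine ⟨4 * C₃, fun a b hab h0 N _ hN Nm hodd hsq hcard hNmN hξ f hf => ?_⟩
  classical
  haveI := isElliptic_freyCurve h0
  obtain ⟨S, hS⟩ := exists_generator_of_brandtXi_ne_zero hξ
  letI : Fintype (ClassSet S.O) := Fintype.ofFinite _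
  obtain ⟨φ, hφ0, hL, -⟩ := hS
  have hN' : N / Nm * Nm = N := Nat.div_mul_cancel hNmN
  have hr : congruenceNumber f ≠ 0 := congruenceNumber_ne_zero_of_isNewformOf hf
  obtain ⟨ℓ, hℓ, hℓN, hℓle⟩ := hC₃ N (Nat.pos_of_ne_zero (NeZero.ne N))
  have hℓN' : ¬ ℓ ∣ N / Nm * Nm := by rwa [hN']
  have hcore := hX (N / Nm) Nm N hN' S (freyCurve a b) f hf φ hφ0 hL
  have hxS : S.xi (fun n => (freyCurve a b).LFunction n) =
      brandtXi (N / Nm) Nm (fun n => (freyCurve a b).LFunction n) := (S.brandtXi_eq_xi _).symm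
  set ξ : ℕ := brandtXi (N / Nm) Nm (fun n => (freyCurve a b).LFunction n) with hξdef
  set r : ℕ := congruenceNumber f with hrdef
  set e : ℕ := ((freyCurve a b).LFunction ℓ - (ℓ + 1)).natAbs with hedef
  have he : e ≠ 0 := natAbs_lFunction_sub_ne_zero (freyCurve a b) hℓ
  have hval : ∀ p : ℕ, p.Prime → 5 ≤ p →
      ξ.factorization p ≤ r.factorization p + e.factorization p := by
    intro p hp h5
    refine factorization_le_of_core S (freyCurve a b) hφ0 hL hr (x := ξ) ?_ hp h5 hℓ hℓN'
    intro i y hy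
    have h := hcore i y hy
    rwa [hxS] at h
  have hL5 := primeToSix_le_mul_of_factorization_le hr he hval
  have hL4 : (e : ℝ) ≤ 4 * ℓ := natAbs_lFunction_sub_le (freyCurve a b) hℓ
  have hcr0 : (0 : ℝ) ≤ ((r / (ordProj[2] r * ordProj[3] r) : ℕ) : ℝ) := Nat.cast_nonneg _
  calc ((ξ / (ordProj[2] ξ * ordProj[3] ξ) : ℕ) : ℝ)
      ≤ ((r / (ordProj[2] r * ordProj[3] r) * e : ℕ) : ℝ) := by exact_mod_cast hL5
    _ = ((r / (ordProj[2] r * ordProj[3] r) : ℕ) : ℝ) * (e : ℝ) := by rw [Nat.cast_mul]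
    _ ≤ ((r / (ordProj[2] r * ordProj[3] r) : ℕ) : ℝ) * (4 * ℓ) := mul_le_mul_of_nonneg_left hL4 hcr0
    _ ≤ ((r / (ordProj[2] r * ordProj[3] r) : ℕ) : ℝ) * (4 * (C₃ * (N : ℝ) ^ ε)) := by gcongr
    _ = 4 * C₃ * (N : ℝ) ^ ε * ((r / (ordProj[2] r * ordProj[3] r) : ℕ) : ℝ) := by ring

/-! ## §2  The atom in the same currency and the RE-CUT GLUE (PROVED) -/

/-- **`CongruenceNumberBound` (child 2♮; = k2 gen-5 `StubIdeas2G5.CpsCongruenceBound`, `cps` unfolded).**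
The prime-to-6 part of the congruence number of the Frey newform is `≤ C_ε N^(2+ε)`.  abc-STRENGTH ATOM
(⟺ `stub_primeToSixDegreeBound` modulo ARS 2.1(a)(b) + optimal-quotient transport, k2 g5 H8a/H8b);
data-free — a statement about `S₂(Γ₀(N); ℤ)` and one `q`-expansion; first tree rung
`r_f ∣ ∏_{P ≠ 𝕀_f} η_f(P)` (Pasten–Shimura Thm 5.5, PROVED), ceiling `log r_f ≤ (1/5) N log N` (Murty–Pasten, PROVED). -/
def CongruenceNumberBound : Prop :=
  ∀ ε : ℝ, 0 < ε → ∃ C : ℝ, ∀ a b : ℤ, IsCoprime a b → a * b * (a + b) ≠ 0 → ∀ (N : ℕ) [NeZero N],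
    (freyCurve a b).conductorNorm ℤ = N →
    ∀ f : CuspForm (Gamma0 N) 2, IsNewformOf (freyCurve a b) f →
      ((congruenceNumber f / (ordProj[2] (congruenceNumber f) * ordProj[3] (congruenceNumber f)) : ℕ) : ℝ) ≤
        C * (N : ℝ) ^ (2 + ε)

/-- **RE-CUT GLUE (PROVED).**  `XiCongruenceComparison → CongruenceNumberBound → AbcValuationProduct (stub 3
verbatim) → FreyModularity → SteinbergCore`:  at `ξ = 0` the left side is `0`; otherwise `FreyModularity`
gives a datum `D`, `f := D.f`, and `cps ξ · T ≤ C₀ N^{ε/3} cps(r_f) · T ≤ C₀ N^{ε/3} · C₁ N^{2+ε/3} · C₂ N^{ε/3}`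
(`stub_allTamExp_of_valuationProduct` for `T ≤ C₂ N^{ε/3}`). -/
theorem steinbergCore_of_congruenceSplit (h1 : XiCongruenceComparison) (h2 : CongruenceNumberBound)
    (h3 : ∀ ε : ℝ, 0 < ε → ∃ K : ℝ, ∀ a b c : ℕ, Literature.NumberTheory.DiophantineGeometry.IsABCTriple a b c →
      ((∏ p ∈ (a * b * c).primeFactors, (a * b * c).factorization p : ℕ) : ℝ) ≤
        K * ((Literature.NumberTheory.DiophantineGeometry.rad a b c : ℕ) : ℝ) ^ ε)
    (hMod : Summit.ABC.ABC.Theses.DefiniteXi.FreyModularity) :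
    Summit.ABC.ABC.Theses.DefiniteXi.SteinbergCore := by
  intro ε hε
  obtain ⟨C₀, hC₀⟩ := h1 (ε / 3) (by linarith)
  obtain ⟨C₁, hC₁⟩ := h2 (ε / 3) (by linarith)
  obtain ⟨C₂, hC₂⟩ := Summit.ABC.ABC.Theorems.stub_allTamExp_of_valuationProduct h3 (ε / 3) (by linarith)
  refine ⟨max C₀ 0 * max C₁ 0 * max C₂ 0, ?_⟩
  intro a b hab h0 N _ hN Nm hodd hsq hcard hdvd
  have hNpos : (0 : ℝ) < (N : ℝ) := by exact_mod_cast Nat.pos_of_ne_zero (NeZero.ne N)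
  set ξ : ℕ := brandtXi (N / Nm) Nm (fun n => (freyCurve a b).LFunction n) with hξ
  set T : ℕ := ∏ q ∈ N.primeFactors, ((freyCurve a b).minimalDiscriminantNorm ℤ).factorization q with hTdef
  have hsplit : (N : ℝ) ^ (ε / 3) * (N : ℝ) ^ (2 + ε / 3) * (N : ℝ) ^ (ε / 3) = (N : ℝ) ^ (2 + ε) := by
    rw [← Real.rpow_add hNpos, ← Real.rpow_add hNpos]
    ring_nf
  have hRHS0 : (0 : ℝ) ≤ max C₀ 0 * max C₁ 0 * max C₂ 0 * (N : ℝ) ^ (2 + ε) := by positivity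
  have hT0 : (0 : ℝ) ≤ (T : ℝ) := by positivity
  have hTle : (T : ℝ) ≤ max C₂ 0 * (N : ℝ) ^ (ε / 3) :=
    (hC₂ a b hab h0 N hN).trans (mul_le_mul_of_nonneg_right (le_max_left _ _) (by positivity))
  by_cases hξ0 : ξ = 0
  · have : ξ / (ordProj[2] ξ * ordProj[3] ξ) = 0 := by rw [hξ0, Nat.zero_div]
    rw [this]
    simpa using hRHS0
  · obtain ⟨D⟩ := hMod a b hab h0 N hN
    set r : ℕ := congruenceNumber D.f with hr
    have h1' : ((ξ / (ordProj[2] ξ * ordProj[3] ξ) : ℕ) : ℝ) ≤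
        max C₀ 0 * (N : ℝ) ^ (ε / 3) * ((r / (ordProj[2] r * ordProj[3] r) : ℕ) : ℝ) := by
      refine (hC₀ a b hab h0 N hN Nm hodd hsq hcard hdvd hξ0 D.f D.isNewformOf).trans ?_
      have h0' : (0 : ℝ) ≤ (N : ℝ) ^ (ε / 3) * ((r / (ordProj[2] r * ordProj[3] r) : ℕ) : ℝ) := by positivity
      calc C₀ * (N : ℝ) ^ (ε / 3) * ((r / (ordProj[2] r * ordProj[3] r) : ℕ) : ℝ)
          = C₀ * ((N : ℝ) ^ (ε / 3) * ((r / (ordProj[2] r * ordProj[3] r) : ℕ) : ℝ)) := by ring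
        _ ≤ max C₀ 0 * ((N : ℝ) ^ (ε / 3) * ((r / (ordProj[2] r * ordProj[3] r) : ℕ) : ℝ)) :=
            mul_le_mul_of_nonneg_right (le_max_left _ _) h0'
        _ = _ := by ring
    have h2' : ((r / (ordProj[2] r * ordProj[3] r) : ℕ) : ℝ) ≤ max C₁ 0 * (N : ℝ) ^ (2 + ε / 3) :=
      (hC₁ a b hab h0 N hN D.f D.isNewformOf).trans
        (mul_le_mul_of_nonneg_right (le_max_left _ _) (by positivity))
    calc ((ξ / (ordProj[2] ξ * ordProj[3] ξ) : ℕ) : ℝ) * (T : ℝ)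
        ≤ (max C₀ 0 * (N : ℝ) ^ (ε / 3) * ((r / (ordProj[2] r * ordProj[3] r) : ℕ) : ℝ)) *
            (max C₂ 0 * (N : ℝ) ^ (ε / 3)) := mul_le_mul h1' hTle hT0 (by positivity)
      _ ≤ (max C₀ 0 * (N : ℝ) ^ (ε / 3) * (max C₁ 0 * (N : ℝ) ^ (2 + ε / 3))) *
            (max C₂ 0 * (N : ℝ) ^ (ε / 3)) := by gcongr
      _ = max C₀ 0 * max C₁ 0 * max C₂ 0 *
            ((N : ℝ) ^ (ε / 3) * (N : ℝ) ^ (2 + ε / 3) * (N : ℝ) ^ (ε / 3)) := by ring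
      _ = max C₀ 0 * max C₁ 0 * max C₂ 0 * (N : ℝ) ^ (2 + ε) := by rw [hsplit]

/-! ## §3  Back to the REGISTERED stub (Plan A: the two foreign inputs, named) -/

/-- `q² ∤ N(E_(a,b))` at every odd prime `q` (`N ∣ 2⁸ rad(ab(a+b))`, radical squarefree; copy of
`XiBound.Negative.not_sq_dvd_conductorNorm_freyCurve`). -/
theorem not_sq_dvd_conductorNorm_freyCurve_of_ne_two {a b : ℤ} (hab : IsCoprime a b)
    (h0 : a * b * (a + b) ≠ 0) {q : ℕ} (hq : q.Prime) (hq2 : q ≠ 2) :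
    ¬ q ^ 2 ∣ (freyCurve a b).conductorNorm ℤ := by
  intro hq2N
  have h' : q ^ 2 ∣ 2 ^ 8 * (UniqueFactorizationMonoid.radical (a * b * (a + b))).natAbs :=
    hq2N.trans (conductorNorm_freyCurve_dvd_holds a b hab h0)
  have hcop : Nat.Coprime (q ^ 2) (2 ^ 8) :=
    Nat.Coprime.pow _ _ ((Nat.coprime_primes hq Nat.prime_two).mpr hq2)
  have hr : q ^ 2 ∣ (UniqueFactorizationMonoid.radical (a * b * (a + b))).natAbs :=
    hcop.dvd_of_dvd_mul_left h'
  have hsq : Squarefree (UniqueFactorizationMonoid.radical (a * b * (a + b))).natAbs :=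
    Int.squarefree_natAbs.mpr UniqueFactorizationMonoid.squarefree_radical
  have hu : IsUnit (q : ℕ) := hsq q ((pow_two q) ▸ hr)
  exact hq.ne_one (Nat.isUnit_iff.mp hu)

/-- `cps m ≤ cps n` for `m ∣ n ≠ 0` (self-contained; cf. `XiDegreeComparison.primeToSix_le_of_dvd`). -/
theorem primeToSix_le_of_dvd' {m n : ℕ} (h : m ∣ n) (hn : n ≠ 0) :
    m / (ordProj[2] m * ordProj[3] m) ≤ n / (ordProj[2] n * ordProj[3] n) := by
  have hm : m ≠ 0 := ne_zero_of_dvd_ne_zero hn h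
  have hle := Finsupp.le_def.mp ((Nat.factorization_le_iff_dvd hm hn).mpr h)
  have := primeToSix_le_mul_of_factorization_le (x := m) hn one_ne_zero
    (fun p _ _ => by simpa using hle p)
  simpa using this

/-- **L6′ (S, PROVED from the named fact; the ONLY place ARS enters).**  For the Frey curve and ANY datum `D` at its conductor:
`cps(r_{D.f}) ≤ cps(deg D)`.  Route: `D₀ := D.exists_optimalDatum'` (same newform, `ker = ⊥`, minimal among
same-newform data by `modularDegree_le_of_isogenyMap_ker_eq_bot`), `deg D₀ ∣ deg D` (`modularDegree_eq_card_ker_mul`,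
template p139336 :286–299), ARS (b) at `D₀` for every prime `p ≥ 5` (`p² ∤ N`: `N ∣ 2⁸ rad`,
`conductorNorm_freyCurve_dvd_holds`, `Nat.squarefree_radical`-type step) gives `v_p r_f = v_p deg D₀`; then L5-type
bookkeeping (`e = 1`) and `primeToSix_le_of_dvd`. [cite: AgasheRibetStein2012, Thm. 2.1] -/
theorem primeToSix_congruenceNumber_le_primeToSix_deg (hARS : padicValNat_congruenceNumber_eq_of_not_sq_dvd)
    {a b : ℤ} (hab : IsCoprime a b) (h0 : a * b * (a + b) ≠ 0) {N : ℕ} [NeZero N]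
    (hN : (freyCurve a b).conductorNorm ℤ = N) (D : ModularParametrizationData (freyCurve a b) N) :
    congruenceNumber D.f / (ordProj[2] (congruenceNumber D.f) * ordProj[3] (congruenceNumber D.f)) ≤
      D.deg / (ordProj[2] D.deg * ordProj[3] D.deg) := by
  haveI := isElliptic_freyCurve h0
  obtain ⟨W₀, hW₀, D₀, hf₀, h₀⟩ := D.exists_optimalDatum'
  haveI := hW₀
  have hker₀ : D₀.isogenyMap.ker = ⊥ := D₀.isogenyMap_ker_eq_bot_iff.mpr h₀
  have hmin₀ : ∀ (W₂ : WeierstrassCurve ℚ) [W₂.IsElliptic] (D₂ : ModularParametrizationData W₂ N),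
      D₂.f = D₀.f → D₀.modularDegree ≤ D₂.modularDegree := fun W₂ _ D₂ hD₂ =>
    D₀.modularDegree_le_of_isogenyMap_ker_eq_bot hker₀ D₂ hD₂
  have hdvd : D₀.modularDegree ∣ D.deg := by
    have hinj : Function.Injective D₀.isogenyMap := (AddMonoidHom.ker_eq_bot_iff _).mp hker₀
    obtain ⟨_, hdeg⟩ := D.modularDegree_eq_card_ker_mul hf₀.symm D₀.smul_periodLattice_le hinj
      D₀.deg_pos D₀.finite_setOf_natCard_fiberOrbits_ne
    exact ⟨_, hdeg.trans (mul_comm _ _)⟩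
  have hd0 : D₀.modularDegree ≠ 0 := D₀.deg_pos.ne'
  have hval : ∀ p : ℕ, p.Prime → 5 ≤ p → (congruenceNumber D.f).factorization p ≤
      D₀.modularDegree.factorization p + (1 : ℕ).factorization p := by
    intro p hp h5
    have hsq : ¬ p ^ 2 ∣ N := by
      have h := not_sq_dvd_conductorNorm_freyCurve_of_ne_two hab h0 hp (by omega)
      rwa [hN] at h
    have h := hARS W₀ N D₀ hmin₀ p hp hsq
    rw [hf₀, ← Nat.factorization_def _ hp, ← Nat.factorization_def _ hp] at h
    simp [h]
  calc congruenceNumber D.f / (ordProj[2] (congruenceNumber D.f) * ordProj[3] (congruenceNumber D.f))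
      ≤ D₀.modularDegree / (ordProj[2] D₀.modularDegree * ordProj[3] D₀.modularDegree) * 1 :=
        primeToSix_le_mul_of_factorization_le hd0 one_ne_zero hval
    _ = D₀.modularDegree / (ordProj[2] D₀.modularDegree * ordProj[3] D₀.modularDegree) := mul_one _
    _ ≤ D.deg / (ordProj[2] D.deg * ordProj[3] D.deg) := primeToSix_le_of_dvd' hdvd D.deg_pos.ne'

/-- **Plan A assembly (PROVED from child 1♮ + L6′): the REGISTERED stub, verbatim, from
`XiCongruenceComparison`, ARS 2.1(b) and `FreyModularity`.**  `D` := a minimal datum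
(`exists_minimal_datum (hMod …)`), child 1♮ at `f := D.f`, L6′, and `1 ≤ T³`. -/
theorem stub_of_xiCongruenceComparison (h1 : XiCongruenceComparison)
    (hARS : padicValNat_congruenceNumber_eq_of_not_sq_dvd)
    (hMod : Summit.ABC.ABC.Theses.DefiniteXi.FreyModularity) :
    ∀ ε : ℝ, 0 < ε → ∃ C : ℝ, ∀ a b : ℤ, IsCoprime a b → a * b * (a + b) ≠ 0 → ∀ (N : ℕ) [NeZero N],
      (Literature.NumberTheory.EllipticCurves.freyCurve a b).conductorNorm ℤ = N →
      ∀ Nm : ℕ, Odd Nm → Squarefree Nm → Odd Nm.primeFactors.card → Nm ∣ N →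
      Literature.NumberTheory.Automorphic.brandtXi (N / Nm) Nm
          (fun n => (Literature.NumberTheory.EllipticCurves.freyCurve a b).LFunction n) ≠ 0 →
      ∃ D : Literature.NumberTheory.EllipticCurves.ModularForms.ModularParametrizationData
        (Literature.NumberTheory.EllipticCurves.freyCurve a b) N,
        (∀ D' : Literature.NumberTheory.EllipticCurves.ModularForms.ModularParametrizationData
          (Literature.NumberTheory.EllipticCurves.freyCurve a b) N, D.deg ≤ D'.deg) ∧
        ((Literature.NumberTheory.Automorphic.brandtXi (N / Nm) Nm
              (fun n => (Literature.NumberTheory.EllipticCurves.freyCurve a b).LFunction n) /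
            (ordProj[2] (Literature.NumberTheory.Automorphic.brandtXi (N / Nm) Nm
                (fun n => (Literature.NumberTheory.EllipticCurves.freyCurve a b).LFunction n)) *
              ordProj[3] (Literature.NumberTheory.Automorphic.brandtXi (N / Nm) Nm
                (fun n => (Literature.NumberTheory.EllipticCurves.freyCurve a b).LFunction n))) : ℕ) : ℝ) ≤
          C * (N : ℝ) ^ ε * ((D.deg / (ordProj[2] D.deg * ordProj[3] D.deg) : ℕ) : ℝ) *
            ((∏ q ∈ N.primeFactors, ((Literature.NumberTheory.EllipticCurves.freyCurve a b).minimalDiscriminantNorm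
              ℤ).factorization q : ℕ) : ℝ) ^ 3 := by
  intro ε hε
  obtain ⟨C, hC⟩ := h1 ε hε
  refine ⟨max C 0, fun a b hab h0 N _ hN Nm hodd hsq hcard hNmN hξ => ?_⟩
  haveI := isElliptic_freyCurve h0
  obtain ⟨D, -, hDmin⟩ := exists_minimal_datum (hMod a b hab h0 N hN)
  refine ⟨D, fun D' => hDmin D', ?_⟩
  set ξ : ℕ := brandtXi (N / Nm) Nm (fun n => (freyCurve a b).LFunction n) with hξdef
  set T : ℕ := ∏ q ∈ N.primeFactors, ((freyCurve a b).minimalDiscriminantNorm ℤ).factorization q with hTdef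
  set r : ℕ := congruenceNumber D.f with hr
  have hcmp : ((ξ / (ordProj[2] ξ * ordProj[3] ξ) : ℕ) : ℝ) ≤
      C * (N : ℝ) ^ ε * ((r / (ordProj[2] r * ordProj[3] r) : ℕ) : ℝ) :=
    hC a b hab h0 N hN Nm hodd hsq hcard hNmN hξ D.f D.isNewformOf
  have hL6 : ((r / (ordProj[2] r * ordProj[3] r) : ℕ) : ℝ) ≤
      ((D.deg / (ordProj[2] D.deg * ordProj[3] D.deg) : ℕ) : ℝ) := by
    exact_mod_cast primeToSix_congruenceNumber_le_primeToSix_deg hARS hab h0 hN D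
  -- `1 ≤ T`, hence `1 ≤ T³`
  have hone : ∀ q ∈ N.primeFactors, 1 ≤ ((freyCurve a b).minimalDiscriminantNorm ℤ).factorization q :=
    fun q hq => factorization_minimalDiscriminantNorm_pos_of_dvd (freyCurve a b)
      (Nat.prime_of_mem_primeFactors hq) (hN ▸ Nat.dvd_of_mem_primeFactors hq)
  have hT1 : (1 : ℝ) ≤ (T : ℝ) := by
    have : 1 ≤ T := Finset.one_le_prod' fun q hq => hone q hq
    exact_mod_cast this
  have hT3 : (1 : ℝ) ≤ (T : ℝ) ^ 3 := one_le_pow₀ hT1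
  have hNε : (0 : ℝ) ≤ (N : ℝ) ^ ε := by positivity
  calc ((ξ / (ordProj[2] ξ * ordProj[3] ξ) : ℕ) : ℝ)
      ≤ C * (N : ℝ) ^ ε * ((r / (ordProj[2] r * ordProj[3] r) : ℕ) : ℝ) := hcmp
    _ ≤ max C 0 * (N : ℝ) ^ ε * ((r / (ordProj[2] r * ordProj[3] r) : ℕ) : ℝ) := by
        have h0' : (0 : ℝ) ≤ (N : ℝ) ^ ε * ((r / (ordProj[2] r * ordProj[3] r) : ℕ) : ℝ) := by positivity
        calc C * (N : ℝ) ^ ε * ((r / (ordProj[2] r * ordProj[3] r) : ℕ) : ℝ)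
            = C * ((N : ℝ) ^ ε * ((r / (ordProj[2] r * ordProj[3] r) : ℕ) : ℝ)) := by ring
          _ ≤ max C 0 * ((N : ℝ) ^ ε * ((r / (ordProj[2] r * ordProj[3] r) : ℕ) : ℝ)) :=
              mul_le_mul_of_nonneg_right (le_max_left _ _) h0'
          _ = _ := by ring
    _ ≤ max C 0 * (N : ℝ) ^ ε * ((D.deg / (ordProj[2] D.deg * ordProj[3] D.deg) : ℕ) : ℝ) := by gcongr
    _ = max C 0 * (N : ℝ) ^ ε * ((D.deg / (ordProj[2] D.deg * ordProj[3] D.deg) : ℕ) : ℝ) * 1 := by ring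
    _ ≤ max C 0 * (N : ℝ) ^ ε * ((D.deg / (ordProj[2] D.deg * ordProj[3] D.deg) : ℕ) : ℝ) * (T : ℝ) ^ 3 := by
        gcongr

end Summit.ABC.ABC.Cruxes.SteinbergCore.StubIdeasK1G11

end


-- ======================= PART III : unconditional corollaries =======================
noncomputable section

namespace Summit.ABC.ABC.Cruxes.SteinbergCore.StubIdeasK1G11

open scoped MatrixGroups ModularForm Matrix
open CongruenceSubgroup
open Literature.NumberTheory.EllipticCurves Literature.NumberTheory.EllipticCurves.ModularForms
open Literature.NumberTheory.Automorphic Literature.NumberTheory.Automorphic.Brandt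

/-- The core, unconditionally (PART I; the two verbatim copies of k3's `XiCoreDivisibility` agree). -/
theorem xiCoreDivisibility : XiCoreDivisibility := StubIdeasK1G10.xiCoreDivisibility

/-- **CHILD 1♮ IS A THEOREM.**  `XiCongruenceComparison` — for the Frey curve, admissible `Nm`, `ξ ≠ 0`
and every newform `f` of `E_(a,b)` at level `N`: `cps ξ ≤ C_ε N^ε cps(r_f)` — holds unconditionally. -/
theorem xiCongruenceComparison : XiCongruenceComparison :=
  xiCongruenceComparison_of_core xiCoreDivisibility

/-- **The REGISTERED stub from exactly two named inputs**: ARS 2.1(b)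
(`padicValNat_congruenceNumber_eq_of_not_sq_dvd`, Literature named fact, unproved) and the route item
`FreyModularity` (stmt-ABC-11340).  Statement = `stub_xiDegreeComparison` of `Lines/p6_tamagawa_split.lean`, verbatim. -/
theorem stub_xiDegreeComparison_of_facts
    (hARS : padicValNat_congruenceNumber_eq_of_not_sq_dvd)
    (hMod : Summit.ABC.ABC.Theses.DefiniteXi.FreyModularity) :
    ∀ ε : ℝ, 0 < ε → ∃ C : ℝ, ∀ a b : ℤ, IsCoprime a b → a * b * (a + b) ≠ 0 → ∀ (N : ℕ) [NeZero N],
      (Literature.NumberTheory.EllipticCurves.freyCurve a b).conductorNorm ℤ = N →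
      ∀ Nm : ℕ, Odd Nm → Squarefree Nm → Odd Nm.primeFactors.card → Nm ∣ N →
      Literature.NumberTheory.Automorphic.brandtXi (N / Nm) Nm
          (fun n => (Literature.NumberTheory.EllipticCurves.freyCurve a b).LFunction n) ≠ 0 →
      ∃ D : Literature.NumberTheory.EllipticCurves.ModularForms.ModularParametrizationData
        (Literature.NumberTheory.EllipticCurves.freyCurve a b) N,
        (∀ D' : Literature.NumberTheory.EllipticCurves.ModularForms.ModularParametrizationData
          (Literature.NumberTheory.EllipticCurves.freyCurve a b) N, D.deg ≤ D'.deg) ∧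
        ((Literature.NumberTheory.Automorphic.brandtXi (N / Nm) Nm
              (fun n => (Literature.NumberTheory.EllipticCurves.freyCurve a b).LFunction n) /
            (ordProj[2] (Literature.NumberTheory.Automorphic.brandtXi (N / Nm) Nm
                (fun n => (Literature.NumberTheory.EllipticCurves.freyCurve a b).LFunction n)) *
              ordProj[3] (Literature.NumberTheory.Automorphic.brandtXi (N / Nm) Nm
                (fun n => (Literature.NumberTheory.EllipticCurves.freyCurve a b).LFunction n))) : ℕ) : ℝ) ≤
          C * (N : ℝ) ^ ε * ((D.deg / (ordProj[2] D.deg * ordProj[3] D.deg) : ℕ) : ℝ) *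
            ((∏ q ∈ N.primeFactors, ((Literature.NumberTheory.EllipticCurves.freyCurve a b).minimalDiscriminantNorm
              ℤ).factorization q : ℕ) : ℝ) ^ 3 :=
  stub_of_xiCongruenceComparison xiCongruenceComparison hARS hMod

/-- **THE CRUX FROM THE RE-CUT CHILDREN**: `SteinbergCore` from `CongruenceNumberBound` (child 2♮, abc-strength
atom), `AbcValuationProduct` (child 3 = stmt-ABC-1567, verbatim `stub_abcValuationProduct`) and `FreyModularity`. -/
theorem steinbergCore_of_facts (h2 : CongruenceNumberBound)
    (h3 : ∀ ε : ℝ, 0 < ε → ∃ K : ℝ, ∀ a b c : ℕ, Literature.NumberTheory.DiophantineGeometry.IsABCTriple a b c →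
      ((∏ p ∈ (a * b * c).primeFactors, (a * b * c).factorization p : ℕ) : ℝ) ≤
        K * ((Literature.NumberTheory.DiophantineGeometry.rad a b c : ℕ) : ℝ) ^ ε)
    (hMod : Summit.ABC.ABC.Theses.DefiniteXi.FreyModularity) :
    Summit.ABC.ABC.Theses.DefiniteXi.SteinbergCore :=
  steinbergCore_of_congruenceSplit xiCongruenceComparison h2 h3 hMod

end Summit.ABC.ABC.Cruxes.SteinbergCore.StubIdeasK1G11

end
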